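import Literature.MathematicalPhysics.QuantumFieldTheory.Balaban1983to89.B4TorusKernel

/-!
# `Balaban1983to89.B4Reflection242` — B4 (2.42): the multiple reflection method for the box propagator `G_j(□)`,
kernel-checked (images identity, Neumann folding of `-Δ^ξ + m_j² + a_j Q_j^*Q_j`, uniform decay transfer, a print slip)

Source under audit (cell pub-balaban, GAPS row C-B4-5; b04 `transcript-B4.md` l. 196–200; render
`b2b-balaban-ref1/pages/1983-cmp89-regularity-decay/1983-cmp89-regularity-decay-p014-x2.png`):
T. Bałaban, *Regularity and decay of lattice Green's functions*, Commun. Math. Phys. **89** (1983) 571–597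
[`Balaban1983RegularityDecay`, "B4"], p. 584 (journal page = PDF page + 570).

## WHAT IS PRINTED (p. 584, verbatim)

"The proof of (2.35), (2.36) can be reduced again to a simpler case. This part of the argument is valid for an
arbitrary rectangular parallelepiped □ built of unit blocks, so the inequalities are valid for all such sets. Let us
denote ξ = L^{-j}. We represent G_j(□) with the help of the propagator G_j with free boundary conditions on ξZ^d using
the multiple reflection method. If □ is written as □ = {x ∈ ξZ^d : 0 ≤ x_μ ≤ M_μ, μ = 1,…,d}, then

(2.42) G_j(□; x, x') = G_j(x, x') + Σ_{μ=1}^d G_j(x, (x'_1,…,-x'_μ-ξ,…,x'_d))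
                        + Σ_{μ=1}^d G_j(x, (x'_1,…,2M_μ-ξ-x'_μ,…,x'_d)) + … .

Using this representation it is enough to prove (2.35), (2.36) for the propagator G_j."  and (2.44):
"(-Δ^ξ + m_j² + a_j Q_j^* Q_j) φ₀ = f. … Defining the propagator G_j, φ₀ = G_j f".  Here (2.35) (Lemma 2.4, p. 582) is
"|(G_j(□)Q_j^*)(x,y)|, |(∂^{L^{-j}}_μ G_j(□)Q_j^*)(x,y)| ≤ c₀ e^{-δ₀|x-y|}" for every rectangular parallelepiped
`□ ⊂ L^{-j}ℤ^d` built of large blocks, constants independent of `□` and `j`.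

The step is used BY READING in the cell's certification of B4 §2 (GAPS C-B4-5: "needs: reflections map unit blocks
onto unit blocks … so that Q_j^*Q_j commutes with the reflection group; and summability of the image series from the
exponential decay being proved — routine").  This file replaces the reading by kernel-checked theorems.

## TYPING / DICTIONARY (lattice units: `ξ = 1`, `M_μ = N_μ ξ`, sites `Fin (d+1) → ℤ` = `ℤ^{d+1}` as in the cell's
other B4/B5 files; every constant below is a free parameter, nothing of B4's specific values is used)

* the box "built of unit blocks": `boxDom N = Π_μ [0, N_μ) ⊂ ℤ^{d+1}` (HALF-OPEN, see the print slip), block side `b`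
  sites with `b ∣ N_μ` (`blockOf`, `blk`); B4's large blocks are the case `b = L^j`.
* the reflection group of the box: `reflBox N ε m` (`ε_μ ∈ Bool`, `m ∈ ℤ^{d+1}`), coordinatewise `n ↦ n + 2N_μ m_μ`
  or `n ↦ 2N_μ m_μ - 1 - n` (`refl1`); the near/far printed images are `(ε_μ, m_μ) = (true, 0), (true, 1)`
  (`printedImages`), "+ …" is the rest of `Bool^{d+1} × ℤ^{d+1}`, which PARAMETRISES the images of a box point
  bijectively (`fibParam`).  Folding map `foldBox` (`fold1 N n =` the representative of `n` in `[0,N)`).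
* B4's operator (2.44) as a lattice kernel `opK c₁ msq a b = c₁·(-Δ) + msq·δ + a·𝟙[same b-block]`
  (`c₁ = ξ^{-2}`, `msq = m_j²`, `a·𝟙[same block]` = the kernel of `a_j Q_j^*Q_j`); its box version with NEUMANN
  boundary conditions `opBoxK … N = c₁·(-Δ_□^N) + msq·δ + a·𝟙[same block]` (`neumannLapK`: number of neighbours
  inside the box on the diagonal).  "G_j(□)" := the inverse of `opBoxK` on `ℓ²(□)` = any/the right inverse matrix
  on `↥(boxDom N)` (`greenBox_unique` shows there is exactly one).
* "the propagator G_j with free boundary conditions on ξZ^d" enters through THREE HYPOTHESES on a kernel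
  `G : ℤ^{d+1} → ℤ^{d+1} → ℂ` — (i) `hGreen`: `Σ_z opK(x,z) G(z,x') = δ_{x,x'}` (this is (2.44), the definition of
  `G_j`); (ii) `hGsym`: `G(σu, σw) = G(u,w)` for every `σ` of the reflection group (the free operator commutes with
  lattice isometries mapping blocks onto blocks — B4's tacit input, NOT constructed here); (iii) `hGdec`:
  `‖G(u,w)‖ ≤ M e^{-κ|u-w|_∞}`, `κ > 0` (this is "(2.35) for the propagator G_j", zeroth order, proved by B4 on
  pp. 584–586 via (2.43)–(2.51); here a hypothesis).  No value of `M, κ, c₁, msq, a` is asserted.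
* the image sum (2.42): `(box N hN).imK G x x' = ∑' (w : images of x'), G x w`, an unconditional `tsum` over the fibre
  `{w | foldBox N w = x'}`; its summability is PROVED from (iii) (`summable_fib_box`), not assumed.

## WHAT THIS FILE CERTIFIES (kernel-checked, sorry-free; tags: [folklore] for the engine, [cite: …, dictionary]
for the B4-specific statements — a `dictionary` tag types a printed formula, it never asserts the paper's claim as a fact)

§1 an abstract, group-free IMAGES ENGINE: an `ImageSystem` (folding map + a SET of fibre-preserving bijections acting
transitively on fibres); `foldOp_mul_imK`: if `K` is `sym`-invariant and fibrewise summable and `D K = 1` with `D`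
row-finite, then `(folded D) · (image kernel of K) = 1` on the fundamental domain — NO invariance of `D` is needed;
`foldOp_imK_inverse`: over a field the two `F × F` matrices are TWO-SIDED inverses (`Matrix.mul_eq_one_comm`);
`rightInverse_eq_imK`: uniqueness.  §2 the box instance: `fold1`/`refl1` algebra (`fold1_refl1`, `refl1_fold1`,
`refl1_inj`), `box N hN : ImageSystem ℤ^{d+1}`, `fibParam : Bool^{d+1} × ℤ^{d+1} ≃ fibre`.  §2b FOLDING THE THREE
PIECES OF (2.44): `foldOp_lapK` (folded `-Δ` = Neumann Laplacian of the box: outside neighbours fold back onto the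
site because the mirrors bisect the boundary bonds), `foldOp_diagK`, `foldOp_avgK` (folded block averaging = the box's
block averaging: EXACTLY the "reflections map unit blocks onto unit blocks, so `Q_j^*Q_j` commutes with the reflection
group" of C-B4-5, valid because `b ∣ N_μ` and the box is half-open), assembled in `foldOp_opK`.  §3 SUMMABILITY AND
DECAY: `periodise_majorant` (B4TorusKernel's `MultiPeriod.periodise_bound` at any base point), `summable_norm_images`,
`summable_fib_box`, and `norm_imK_box_le`: `‖G_□(x,x')‖ ≤ 2^{d+1}·M·periodConst κ d·e^{-(κ/(d+1))|x-x'|_∞}` for all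
box points, uniformly in the box (`supNorm_sub_le_torusSupNorm`: folding is 1-Lipschitz from the `2N`-torus metric).
§4 THE DISPLAY: `greenBox_images` — under (i)–(iii) the image-sum matrix and the Neumann box operator matrix on
`↥(boxDom N)` are two-sided inverses ((2.42) as an identity, all terms); `greenBox_unique` — any right inverse of the
box operator IS the image sum; `greenBox_decay` — hence any such `G_j(□)` obeys the uniform exponential bound above:
the zeroth-order content of "it is enough to prove (2.35) for the propagator G_j".  `printedImages`,
`printSlip_closedBox`: the dictionary for the two printed sums and the located slip below.
§5 FIRST-ORDER AND HÖLDER TRANSFER (v2, append-only): `tsum_fib_majorant` (the real majorant sum over a fibre,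
`Σ_{images w of x'} M e^{-κ|x-w|_∞} ≤ 2^{d+1}·M·periodConst κ d·e^{-(κ/(d+1))|x-x'|_∞}`); `greenBox_deriv_decay` —
if also (iv) `‖G(u+e,w) - G(u,w)‖ ≤ M₁e^{-κ|u-w|_∞}` ("(2.35) for `∂^ξ_μ G_j`", `e` any lattice vector), then
`‖G_□(x+e,x') - G_□(x,x')‖ ≤ 2^{d+1}·M₁·periodConst κ d·e^{-(κ/(d+1))|x-x'|_∞}` for box points `x, x+e, x'` (the
image series is differenced term by term); `greenBox_holder_decay` — if (v) `‖∂G(u,w) - ∂G(u',w)‖ ≤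
H(u,u')(e^{-κ|u-w|_∞} + e^{-κ|u'-w|_∞})` ("(2.36) for `G_j`", B4: `H = c₁|u-u'|^α`), then
`‖(G_□(x+e,x') - G_□(x,x')) - (G_□(y+e,x') - G_□(y,x'))‖ ≤ H(x,y)·2^{d+1}·periodConst κ d·(e^{-κ'|x-x'|_∞} +
e^{-κ'|y-x'|_∞})`, `κ' = κ/(d+1)`, for box points `x, x+e, y, y+e, x'` (`≤ 2H·…·e^{-κ' dist({x,y},x')}`, the printed
form).  With §4 this is the kernel content of "it is enough to prove (2.35), (2.36) for the propagator `G_j`" for the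
KERNELS; only the composition with `Q_j^*` (a finite block sum) is left untyped.
§6 THE UNIFORM CONSTANT (v3, append-only) — "constants independent of `□` and `j`": the constant of §3–§5,
`periodConst κ d = (2e^{κ'}/(1 - e^{-κ'}))^{d+1}` (`κ' = κ/(d+1)`), is uniform in the box but grows like `κ^{-(d+1)}`
as `κ → 0`, and in B4's variables the lattice-unit rate is `κ = δ₀ξ → 0` (`ξ = L^{-j}`); so §3–§5 alone do NOT give
uniformity in `j`.  §6 proves the sharp form: `abs_sub_refl1_ge` (for `x, x' ∈ [0,N)` every image other than the three
nearest is far: `|x - r_{ε,j}(x')| ≥ |x - x'| + 2N(|j| - 1)⁺`), `tsum_exp_refl1_le` (the 1-D image sum is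
`≤ (1 + 2/(1 - e^{-2κ'N})) e^{-κ'|x - x'|}`), `tsum_exp_reflBox_unif` / `summable_norm_images_unif` (Fubini
`summable_prod_pi` of B4TorusKernel), and the displays with the constant `boxConst κ d N = 2^{d+1} Π_μ (1 + 2/(1 -
e^{-2κ'N_μ}))` in place of `2^{d+1} periodConst κ d`: `norm_imK_box_le_unif`, `tsum_fib_majorant_unif`,
`greenBox_decay_unif`, `greenBox_deriv_decay_unif`, `greenBox_holder_decay_unif`; and `boxConst_le`: if
`κ' N_μ ≥ c > 0` for all `μ` then `boxConst κ d N ≤ 2^{d+1}(1 + 2/(1 - e^{-2c}))^{d+1}`.  In B4's variables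
`κ N_μ = δ₀ξ · M_μ/ξ = δ₀ M_μ ≥ δ₀` (a box built of unit blocks is at least one unit wide), so `c = δ₀/(d+1)` works for
every `j`: the box constants are uniform in the box AND in the lattice spacing, with decay rate `δ₀/(d+1)` (physical
units) — which is what Lemma 2.4 asserts, up to the harmless loss `δ₀ ↦ δ₀/(d+1)` from `|·|_∞ ≥ Σ_μ|·_μ|/(d+1)`.
§7 DISCHARGE OF HYPOTHESIS (ii) (v4, append-only) — "the free propagator commutes with the reflections": (ii) is
DERIVED from (i) asked on both sides (`hGreen` + `hGreenR`; for a symmetric kernel `hGreenR` follows from `hGreen`,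
`green_right_of_symm`) and (iii): `opK_reflBox` — the free operator of (2.44) is covariant under every image map
`σ_{ε,m}` when `b ∣ N_μ` (`mem_nbrs_reflBox_iff`, `blk_reflBox_eq_iff`, `opSupp_reflBox`: neighbours, blocks and
the support are carried onto themselves; the image maps are sup-norm isometries, `supNorm_reflBox_sub`);
`twoSided_inverse_unique` — a two-sided inverse kernel of a finite-range operator with symmetric support is unique
among kernels whose triple product converges absolutely (`G₂ = G₂(AG₁) = (G₂A)G₁ = G₁`, the re-association being
Fubini on `ℤ^{d+1} × ℤ^{d+1}`, `Summable.tsum_comm`; no `ℓ²` theory); `summable_triple` — absolute convergence for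
a bounded `G₂` and a decaying `G₁` (`norm_opK_le`, `card_opSupp_le`, `supNorm_sub_le_of_mem_opSupp`,
`summable_exp_supNorm_sub`); hence `green_reflBox_invariant`: `G(σu, σw) = G(u, w)` — since `G ∘ (σ × σ)` is again
a two-sided inverse (`green_left_reflBox`, `green_right_reflBox`); and the (ii)-free displays `greenBox_images₂`,
`greenBox_decay_unif₂`, `greenBox_deriv_decay_unif₂`, `greenBox_holder_decay_unif₂` (hypotheses: (i) two-sided,
(iii), and (iv)/(v) where stated).
§8 THE METHOD OF IMAGES COMMUTES WITH `Q_j^*` (v5, append-only) — (2.35) as printed is about `G_j(□)Q_j^*`, i.e. the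
BLOCK SUMS `Σ_{x' ∈ B(y)} G_j(□)(x,x')` over the unit block with label `y ∈ □^{(j)}` (B4 (1.4)).  For the box of
`N_μ = b·M_μ` fine sites the image maps act on block labels by the image maps `σ̃` of the unit box `Π_μ [0,M_μ)`
(`blk_reflBox_mul`: `blk ∘ σ_{ε,m} = σ̃_{ε,m} ∘ blk`; `blockL_image_reflBox`), hence `blockSum_imK_eq`:
`Σ_{x' ∈ B(y)} G_□(x,x') = Σ_{(ε,m)} K(x, σ̃_{ε,m} y)` with `K(x,y') = Σ_{w ∈ B(y')} G(x,w)` (`= (G_jQ_j^*)(x,y')` on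
`ξZ^d`) — the finite block sum and the absolutely convergent image series commute (`Summable.tsum_finsetSum`), and each
image of a block is a block (`Finset.sum_image`).  So a bound on `K` at UNIT rate, `‖K(u,w)‖ ≤ M_K e^{-κ₀|blk u - w|_∞}`
(hypothesis (iii-Q): the natural lattice form of "(2.35) for `G_jQ_j^*` on `ξZ^d`"), gives `greenBoxQ_decay_unif`:
`‖Σ_{x' ∈ □, blk x' = y} GB(x,x')‖ ≤ M_K · boxConst κ₀ d M · e^{-(κ₀/(d+1))|blk x - y|_∞}` for the inverse `GB` of the
Neumann box operator, every fine `x ∈ □`, every label `y ∈ Π_μ[0,M_μ)`, with `boxConst κ₀ d M ≤ 2^{d+1}(1 + 2/(1 -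
e^{-2κ₀/(d+1)}))^{d+1}` (`boxConst_le_one`): (2.35), first quantity, for `G_j(□)Q_j^*` with constants manifestly
independent of `□` and of `b = L^j` (no `κ = δ₀ξ` bookkeeping: the rate is per unit block); `greenBoxQ_deriv_decay_unif`:
the same for first differences `Σ_{x' ∈ B(y)}(GB(x+e,x') - GB(x,x'))` under (iv-Q) `‖K(u+e,w) - K(u,w)‖ ≤
M₁e^{-κ₀|blk u - w|_∞}` ((2.35), second quantity).  Hypotheses of both: (i) two-sided, (iii) at any fine rate (qualitative),
(iii-Q)/(iv-Q).
§9 IMAGES ON THE SOURCE VARIABLE (v6, append-only) — the same block sums WITHOUT the fine propagator: for ANY kernel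
`K(u,y)` (`u` fine, `y` a unit label) with (α) `Σ_{z ∈ opSupp u} opK(u,z) K(z,y) = 1_{blk u = y}` on the whole fine
lattice (the basic equation (2.44) with right-hand side `Q_j^*δ_y` — the shape of `B4Green244.green244`, proved there
for the kernel (2.48)) and (β) summable source image series, `opBox_mul_srcImages`: `W = Σ_{(ε,m)} K(σ_{ε,m}·, y)`
solves the Neumann box equation `opBox W = 1_{B(y)}`, hence `greenBoxQ_srcImages`: `Σ_{x' ∈ □, blk x' = y} GB(x,x')
= Σ_{(ε,m)} K(σ_{ε,m} x, y)` for ANY inverse `GB` of the box operator (the image maps form a group acting on the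
parameters — `reflBox_comp`, `compParam`, `srcImages_reflBox` —, `opK`/`opSupp` covariance of §7, and the fibre
count `#{(ε,m) | σ_{ε,m}x ∈ B(y)} = 1_{blk x = y}`); with (β') `‖K(u,y)‖ ≤ M_K e^{-κ₀|blk u - y|_∞}` (the shape of
`B4Green244.K_decay`) `greenBoxQ_decay_src`: (2.35), first quantity, for `G_j(□)Q_j^*` with the constants of §8, and
with (γ) the `±e_μ` first-difference bound `greenBoxQ_deriv_decay_src` (second quantity; `reflBox_add_single`: a
reflection flips `e_μ`).  Hypotheses: (α), (β')/(γ) and the existence of `GB` — nothing about a fine `G_j`.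

PRINT SLIP (located here, harmless, recorded in GAPS as an objection-lite row): the far image `2M_μ - ξ - x'_μ` is
the reflection in the hyperplane `x_μ = M_μ - ξ/2`, which swaps the sites `M_μ - ξ ↔ M_μ` and fixes none; with the box
printed as CLOSED, `0 ≤ x_μ ≤ M_μ`, the sites `M_μ - ξ` and `M_μ` are images of one another, the closed box is not
a fundamental domain, and (2.42) would double count.  The images as printed are exactly right for the HALF-OPEN box
`0 ≤ x_μ < M_μ` — which is what "built of unit blocks" (half-open blocks, B4 (1.1)) means; `printSlip_closedBox`
records `refl1 N true 1 (N-1) = N`, `fold1 N N = N-1`, `N ∉ [0,N)`.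

## NOT CERTIFIED HERE (scope statement)

* the existence/construction of the free propagator `G_j` on the infinite lattice and its properties (i)–(iii) — they
  are hypotheses (B4 proves (iii) on pp. 584–586; (ii) is standard for an isometry-invariant positive operator);
  since v4 (§7), (ii) is no longer a hypothesis of the `₂` displays: it follows from (i) two-sided + (iii);
* the composition with `Q_j^*` (a finite block sum of the kernel bounds of §4/§5, giving (2.35)/(2.36) literally
  for `G_j(□)Q_j^*`, `∂^ξ_μ G_j(□)Q_j^*`) — routine, not typed here; the additional hypotheses (iv), (v) of §5, like
  (iii), are hypotheses; the free-propagator side of (2.35)/(2.36) ("for the propagator G_j", pp. 584–586) is the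
  b04 lineage's `B4StripSums`, `B4StripSumsDeriv`, `B4StripSumsHolder`, `B4Torus248Decay` — this file is the bridge
  from those bounds (hypotheses (iii)–(v)) to the box;
* since v5 (§8) the composition with `Q_j^*` IS typed for the two quantities of (2.35) (`greenBoxQ_decay_unif`,
  `greenBoxQ_deriv_decay_unif`, from unit-rate hypotheses (iii-Q)/(iv-Q) on the block-summed free kernel
  `K = Σ_{B(·)} G`, i.e. on `G_jQ_j^*` on `ξZ^d`); the Hölder quantity (2.36) for `G_j(□)Q_j^*` is the same argument and
  is not typed; the identification of the b04 lineage's Fourier kernel of (2.48) with this `K` (which needs the free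
  `G_j` itself as an object) is not made here — (iii-Q)/(iv-Q) are hypotheses;
* since v6 (§9) the two quantities of (2.35) for `G_j(□)Q_j^*` are ALSO derived from properties of `K = G_jQ_j^*`
  alone ((α) = the shape of `B4Green244.green244`, (β')/(γ) = the shape of `B4Green244.K_decay` and its
  first-difference analogue): `greenBoxQ_srcImages`, `greenBoxQ_decay_src`, `greenBoxQ_deriv_decay_src`; the
  finite-sum dictionary between b04's `opD n a m2` (acting on functions, `Fin d`) and this file's kernel `opK c₁ msq a b`
  (`c₁ = n²`, `msq = m²`, `a ↦ a·n^{-d}`, `b = n`) is NOT made in this file (no import of `B4Green244`), so (α),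
  (β'), (γ) remain binders here;
* nothing here is summit progress: value = kernel certificate of a step previously certified by reading + one located
  print slip.
-/

namespace Literature.MathematicalPhysics.QuantumFieldTheory.Balaban1983to89.B4Reflection242

open Finset

/-! ## §1  The abstract images engine (folding map + fibre-preserving symmetries) -/

/-- An IMAGE SYSTEM on a site type `X`: a folding map `fold : X → X` onto the fundamental domain
`F = {y | fold y = y}` and a set `sym` of bijections of `X` ("images", deck transformations) which preserve the
fibres of `fold` and act transitively on each fibre from its base point.  [folklore] -/
structure ImageSystem (X : Type*) where
  /-- folding onto the fundamental domain -/
  fold : X → X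
  /-- the symmetries (reflections, translations, …) -/
  sym : Set (Equiv.Perm X)
  /-- symmetries preserve the fibres of `fold` -/
  fold_sym : ∀ σ ∈ sym, ∀ z, fold (σ z) = fold z
  /-- every site is the image of its folded point under some symmetry -/
  trans : ∀ z, ∃ σ ∈ sym, σ (fold z) = z

namespace ImageSystem

variable {X : Type*} (I : ImageSystem X)

/-- `fold` is idempotent. [folklore] -/
theorem fold_fold (z : X) : I.fold (I.fold z) = I.fold z := by
  obtain ⟨σ, hσ, hz⟩ := I.trans z
  conv_rhs => rw [← hz]
  rw [I.fold_sym σ hσ]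

/-- the fibre of `fold` over `x'` (the set of images of `x'` when `fold x' = x'`). [folklore] -/
abbrev Fib (x' : X) : Type _ := {w : X // I.fold w = x'}

/-- a symmetry restricts to a bijection of every fibre. [folklore] -/
def fibEquiv {σ : Equiv.Perm X} (hσ : σ ∈ I.sym) (x' : X) : I.Fib x' ≃ I.Fib x' :=
  σ.subtypeEquiv (fun w => by
    show I.fold w = x' ↔ I.fold (σ w) = x'
    rw [I.fold_sym σ hσ])

/-- the underlying site of `fibEquiv hσ x' w` is `σ w`. [folklore] -/
@[simp] theorem fibEquiv_apply_coe {σ : Equiv.Perm X} (hσ : σ ∈ I.sym) (x' : X) (w : I.Fib x') :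
    (I.fibEquiv hσ x' w).1 = σ w.1 := rfl

variable {R : Type*} [NormedRing R]

/-- the IMAGE KERNEL `K_F(y, x') = Σ_{w : fold w = x'} K(y, w)` (sum over all images of `x'`). [folklore] -/
noncomputable def imK (K : X → X → R) (y x' : X) : R := ∑' w : I.Fib x', K y w.1

/-- the FOLDED OPERATOR `D_F(x, y) = Σ_{z : fold z = y} D(x, z)`, for `D(x, ·)` supported in the finite set
`supp x`. [folklore] -/
def foldOp [DecidableEq X] (D : X → X → R) (supp : X → Finset X) (x y : X) : R :=
  ∑ z ∈ (supp x).filter (fun z => I.fold z = y), D x z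

/-- invariance of the image kernel in the first argument along fibres: `K_F(fold z, x') = K_F(z, x')` for a
`sym`-invariant kernel. [folklore] -/
theorem imK_fold_left (K : X → X → R) (hK : ∀ σ ∈ I.sym, ∀ u w, K (σ u) (σ w) = K u w) (z x' : X) :
    I.imK K (I.fold z) x' = I.imK K z x' := by
  obtain ⟨σ, hσ, hz⟩ := I.trans z
  unfold imK
  calc ∑' w : I.Fib x', K (I.fold z) w.1
      = ∑' w : I.Fib x', K z (I.fibEquiv hσ x' w).1 := by
        refine tsum_congr fun w => ?_
        rw [fibEquiv_apply_coe]
        conv_rhs => rw [← hz]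
        rw [hK σ hσ]
    _ = ∑' w : I.Fib x', K z w.1 := (I.fibEquiv hσ x').tsum_eq (fun w : I.Fib x' => K z w.1)

/-- a point of the fundamental domain lies in the fibre over `x'` iff it equals `x'`. [folklore] -/
theorem eq_of_fold_eq {x x' : X} (hx : I.fold x = x) : I.fold x = x' ↔ x = x' := by
  rw [hx]

/-- THE IMAGES IDENTITY (right inverse).  If `Σ_z D(x,z) K(z,x') = δ_{x x'}` on the whole site set, `K` is
`sym`-invariant with summable image series, then on the fundamental domain
`Σ_{y ∈ F} D_F(x, y) K_F(y, x') = δ_{x x'}`. [folklore] -/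
theorem foldOp_mul_imK [DecidableEq X] (F : Finset X) (hF : ∀ y, y ∈ F ↔ I.fold y = y)
    {D K : X → X → R} (supp : X → Finset X)
    (hK : ∀ σ ∈ I.sym, ∀ u w, K (σ u) (σ w) = K u w)
    (hsum : ∀ z x', Summable (fun w : I.Fib x' => K z w.1))
    (hDK : ∀ x x', ∑ z ∈ supp x, D x z * K z x' = if x = x' then 1 else 0)
    {x x' : X} (hx : I.fold x = x) (hx' : I.fold x' = x') :
    ∑ y ∈ F, I.foldOp D supp x y * I.imK K y x' = if x = x' then 1 else 0 := by
  classical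
  -- step 1: unfold the folded operator and re-sum fibrewise
  have h1 : ∑ y ∈ F, I.foldOp D supp x y * I.imK K y x'
      = ∑ z ∈ supp x, D x z * I.imK K (I.fold z) x' := by
    unfold foldOp
    simp_rw [Finset.sum_mul]
    have hmaps : ∀ z ∈ supp x, I.fold z ∈ F := fun z _ => (hF _).2 (I.fold_fold z)
    rw [← Finset.sum_fiberwise_of_maps_to hmaps]
    refine Finset.sum_congr rfl fun y _ => Finset.sum_congr rfl fun z hz => ?_
    rw [(Finset.mem_filter.1 hz).2]
  rw [h1]
  -- step 2: invariance along fibres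
  simp_rw [I.imK_fold_left K hK]
  -- step 3: exchange the finite sum with the image series
  have h3 : ∑ z ∈ supp x, D x z * I.imK K z x'
      = ∑' w : I.Fib x', ∑ z ∈ supp x, D x z * K z w.1 := by
    unfold imK
    have : ∀ z ∈ supp x, HasSum (fun w : I.Fib x' => D x z * K z w.1) (D x z * ∑' w : I.Fib x', K z w.1) :=
      fun z _ => ((hsum z x').hasSum).mul_left (D x z)
    exact ((hasSum_sum this).tsum_eq).symm
  rw [h3]
  simp_rw [hDK]
  -- step 4: the fibre over x' meets the fundamental domain exactly in x'
  by_cases hxx : x = x'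
  · subst hxx
    rw [if_pos rfl]
    have key : ∀ w : I.Fib x, (if x = w.1 then (1 : R) else 0) = if w = ⟨x, hx⟩ then 1 else 0 := by
      intro w
      by_cases hw : w = ⟨x, hx⟩
      · subst hw; simp
      · rw [if_neg hw, if_neg]
        intro h
        exact hw (Subtype.ext h.symm)
    simp_rw [key]
    exact tsum_ite_eq _ _
  · rw [if_neg hxx]
    have key : ∀ w : I.Fib x', (if x = w.1 then (1 : R) else 0) = 0 := by
      intro w
      rw [if_neg]
      intro h
      apply hxx
      have := w.2
      rw [← h, hx] at this
      exact this
    simp_rw [key]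
    exact tsum_zero

/-- the folded operator is additive in `D`. [folklore] -/
theorem foldOp_add [DecidableEq X] (D₁ D₂ : X → X → R) (supp : X → Finset X) (x y : X) :
    I.foldOp (fun u z => D₁ u z + D₂ u z) supp x y = I.foldOp D₁ supp x y + I.foldOp D₂ supp x y := by
  unfold foldOp; exact Finset.sum_add_distrib

/-- … and homogeneous. [folklore] -/
theorem foldOp_smul [DecidableEq X] (c : R) (D : X → X → R) (supp : X → Finset X) (x y : X) :
    I.foldOp (fun u z => c * D u z) supp x y = c * I.foldOp D supp x y := by
  unfold foldOp; rw [Finset.mul_sum]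

/-- the folded operator does not depend on the finite support set chosen (any set outside which `D(x,·)` vanishes).
[folklore] -/
theorem foldOp_supp_mono [DecidableEq X] (D : X → X → R) {supp supp' : X → Finset X} (x y : X)
    (hsub : supp x ⊆ supp' x) (hzero : ∀ z ∈ supp' x, z ∉ supp x → D x z = 0) :
    I.foldOp D supp' x y = I.foldOp D supp x y := by
  unfold foldOp
  symm
  apply Finset.sum_subset (Finset.filter_subset_filter _ hsub)
  intro z hz hz'
  rw [Finset.mem_filter] at hz
  apply hzero z hz.1
  intro h
  exact hz' (Finset.mem_filter.2 ⟨h, hz.2⟩)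

/-- TWO-SIDED INVERSE ON THE (FINITE) FUNDAMENTAL DOMAIN.  Over a field, the `F × F` matrices `D_F` and `K_F` are
inverse to each other: the images identity gives `D_F K_F = 1`, and a one-sided inverse of a square matrix is two-sided
(`Matrix.mul_eq_one_comm`).  Hence `K_F` is THE inverse of the folded (Neumann) operator — B4's `G_j(□)`. [folklore] -/
theorem foldOp_imK_inverse {𝕜 : Type*} [NormedField 𝕜] [DecidableEq X] (F : Finset X) (hF : ∀ y, y ∈ F ↔ I.fold y = y)
    {D K : X → X → 𝕜} (supp : X → Finset X)
    (hK : ∀ σ ∈ I.sym, ∀ u w, K (σ u) (σ w) = K u w)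
    (hsum : ∀ z x', Summable (fun w : I.Fib x' => K z w.1))
    (hDK : ∀ x x', ∑ z ∈ supp x, D x z * K z x' = if x = x' then 1 else 0) :
    (Matrix.of fun x y : F => I.foldOp D supp x.1 y.1) * (Matrix.of fun y x' : F => I.imK K y.1 x'.1) = 1 ∧
    (Matrix.of fun y x' : F => I.imK K y.1 x'.1) * (Matrix.of fun x y : F => I.foldOp D supp x.1 y.1) = 1 := by
  have h1 : (Matrix.of fun x y : F => I.foldOp D supp x.1 y.1) * (Matrix.of fun y x' : F => I.imK K y.1 x'.1) = 1 := by
    ext x x'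
    rw [Matrix.mul_apply, Matrix.one_apply]
    simp only [Matrix.of_apply]
    rw [Finset.sum_coe_sort F (fun y => I.foldOp D supp x.1 y * I.imK K y x'.1),
      I.foldOp_mul_imK F hF supp hK hsum hDK ((hF _).1 x.2) ((hF _).1 x'.2)]
    simp only [Subtype.ext_iff]
  exact ⟨h1, mul_eq_one_comm.1 h1⟩

/-- UNIQUENESS: any right inverse of `D_F` on the fundamental domain equals the image kernel `K_F`. [folklore] -/
theorem rightInverse_eq_imK {𝕜 : Type*} [NormedField 𝕜] [DecidableEq X] (F : Finset X) (hF : ∀ y, y ∈ F ↔ I.fold y = y)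
    {D K : X → X → 𝕜} (supp : X → Finset X)
    (hK : ∀ σ ∈ I.sym, ∀ u w, K (σ u) (σ w) = K u w)
    (hsum : ∀ z x', Summable (fun w : I.Fib x' => K z w.1))
    (hDK : ∀ x x', ∑ z ∈ supp x, D x z * K z x' = if x = x' then 1 else 0)
    (G : Matrix F F 𝕜) (hG : (Matrix.of fun x y : F => I.foldOp D supp x.1 y.1) * G = 1) :
    G = Matrix.of fun y x' : F => I.imK K y.1 x'.1 := by
  obtain ⟨_, h2⟩ := I.foldOp_imK_inverse F hF supp hK hsum hDK
  calc G = ((Matrix.of fun y x' : F => I.imK K y.1 x'.1) * (Matrix.of fun x y : F => I.foldOp D supp x.1 y.1)) * G := by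
        rw [h2, Matrix.one_mul]
    _ = Matrix.of fun y x' : F => I.imK K y.1 x'.1 := by rw [Matrix.mul_assoc, hG, Matrix.mul_one]

end ImageSystem

/-! ## §2  The B4 instance: the box `Π_μ [0, N_μ)` in `ℤ^{d+1}` (sites of `ξℤ^{d+1}` in `ξ`-units) and the group
generated by the reflections in its faces (mirrors at the half-integers `-1/2` and `N_μ - 1/2`) -/

section OneDim

/-- 1-D FOLDING onto `[0, N)`: reduce mod `2N`, then reflect the upper half `[N, 2N)` by `r ↦ 2N - 1 - r`. [folklore] -/
def fold1 (N : ℕ) (n : ℤ) : ℤ :=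
  if n % (2 * N : ℤ) < N then n % (2 * N : ℤ) else 2 * N - 1 - n % (2 * N : ℤ)

/-- the 1-D IMAGE MAPS of the infinite dihedral group `⟨n ↦ -1 - n, n ↦ 2N - 1 - n⟩`: the translations `n ↦ n + 2Nm`
(`b = false`) and the reflections `n ↦ 2Nm - 1 - n` (`b = true`; `m = 0`: the mirror at `-1/2`, `m = 1`: the mirror at
`N - 1/2`, printed in B4 (2.42) as `x'_μ ↦ -x'_μ - ξ` and `x'_μ ↦ 2M_μ - ξ - x'_μ`, `N = M_μ/ξ`). [folklore] -/
def refl1Fun (N : ℕ) (b : Bool) (m : ℤ) (n : ℤ) : ℤ := if b then 2 * N * m - 1 - n else n + 2 * N * m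

/-- the inverse image map. [folklore] -/
def refl1Inv (N : ℕ) (b : Bool) (m : ℤ) (n : ℤ) : ℤ := if b then 2 * N * m - 1 - n else n - 2 * N * m

/-- the 1-D image map as a permutation of `ℤ`. [folklore] -/
def refl1 (N : ℕ) (b : Bool) (m : ℤ) : Equiv.Perm ℤ where
  toFun := refl1Fun N b m
  invFun := refl1Inv N b m
  left_inv n := by unfold refl1Fun refl1Inv; cases b <;> simp
  right_inv n := by unfold refl1Fun refl1Inv; cases b <;> simp

/-- unfolding lemma for `refl1`. [folklore] -/
@[simp] theorem refl1_apply (N : ℕ) (b : Bool) (m n : ℤ) : refl1 N b m n = refl1Fun N b m n := rfl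

variable {N : ℕ}

/-- `n mod 2N ≥ 0`. [folklore] -/
theorem emod_two_mul_nonneg (hN : 1 ≤ N) (n : ℤ) : 0 ≤ n % (2 * N : ℤ) := Int.emod_nonneg _ (by omega)

/-- `n mod 2N < 2N` (`N ≥ 1`). [folklore] -/
theorem emod_two_mul_lt (hN : 1 ≤ N) (n : ℤ) : n % (2 * N : ℤ) < 2 * N := Int.emod_lt_of_pos _ (by omega)

/-- `0 ≤ fold1 N n`. [folklore] -/
theorem fold1_nonneg (hN : 1 ≤ N) (n : ℤ) : 0 ≤ fold1 N n := by
  have h0 := emod_two_mul_nonneg hN n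
  have h1 := emod_two_mul_lt hN n
  unfold fold1; split_ifs <;> omega

/-- `fold1 N n < N`. [folklore] -/
theorem fold1_lt (hN : 1 ≤ N) (n : ℤ) : fold1 N n < N := by
  have h0 := emod_two_mul_nonneg hN n
  have h1 := emod_two_mul_lt hN n
  unfold fold1; split_ifs <;> omega

/-- `fold1` fixes `[0, N)`. [folklore] -/
theorem fold1_of_mem (hN : 1 ≤ N) {n : ℤ} (h0 : 0 ≤ n) (h1 : n < N) : fold1 N n = n := by
  have e : n % (2 * N : ℤ) = n := Int.emod_eq_of_lt h0 (by omega)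
  unfold fold1; rw [e, if_pos h1]

/-- the fixed points of `fold1` are exactly `[0, N)`. [folklore] -/
theorem fold1_eq_self_iff (hN : 1 ≤ N) (n : ℤ) : fold1 N n = n ↔ 0 ≤ n ∧ n < N := by
  constructor
  · intro h
    exact ⟨h ▸ fold1_nonneg hN n, h ▸ fold1_lt hN n⟩
  · rintro ⟨h0, h1⟩
    exact fold1_of_mem hN h0 h1

/-- `fold1` is `2N`-periodic. [folklore] -/
theorem fold1_add_mul (N : ℕ) (n m : ℤ) : fold1 N (n + 2 * N * m) = fold1 N n := by
  unfold fold1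
  rw [Int.add_mul_emod_self_left]

/-- `fold1` is invariant under the reflections `n ↦ 2Nm - 1 - n`. [folklore] -/
theorem fold1_reflect (hN : 1 ≤ N) (n m : ℤ) : fold1 N (2 * N * m - 1 - n) = fold1 N n := by
  have h0 := emod_two_mul_nonneg hN n
  have h1 := emod_two_mul_lt hN n
  have e : (2 * N * m - 1 - n) % (2 * N : ℤ) = 2 * N - 1 - n % (2 * N : ℤ) := by
    have hdiv : (2 * N : ℤ) * (n / (2 * N : ℤ)) + n % (2 * N : ℤ) = n := Int.mul_ediv_add_emod n (2 * N : ℤ)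
    have e1 : 2 * N * m - 1 - n = (2 * N - 1 - n % (2 * N : ℤ)) + (2 * N : ℤ) * (m - 1 - n / (2 * N : ℤ)) := by
      linarith [hdiv]
    rw [e1, Int.add_mul_emod_self_left]
    exact Int.emod_eq_of_lt (by omega) (by omega)
  unfold fold1
  rw [e]
  split_ifs <;> omega

/-- `fold1` is invariant under every image map. [folklore] -/
theorem fold1_refl1 (hN : 1 ≤ N) (b : Bool) (m n : ℤ) : fold1 N (refl1 N b m n) = fold1 N n := by
  cases b
  · simp [refl1Fun, fold1_add_mul]
  · simp [refl1Fun, fold1_reflect hN]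

/-- which kind of image `z` is of its folded point: a reflection iff `z mod 2N ≥ N`. [folklore] -/
def bitOf (N : ℕ) (z : ℤ) : Bool := decide ((N : ℤ) ≤ z % (2 * N : ℤ))

/-- the translation part of the image map carrying `fold1 N z` to `z`. [folklore] -/
def mulOf (N : ℕ) (z : ℤ) : ℤ := if z % (2 * N : ℤ) < N then z / (2 * N : ℤ) else z / (2 * N : ℤ) + 1

/-- TRANSITIVITY: `z` is the image of `fold1 N z` under the image map `(bitOf N z, mulOf N z)`. [folklore] -/
theorem refl1_fold1 (N : ℕ) (z : ℤ) : refl1 N (bitOf N z) (mulOf N z) (fold1 N z) = z := by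
  have hdiv : (2 * N : ℤ) * (z / (2 * N : ℤ)) + z % (2 * N : ℤ) = z := Int.mul_ediv_add_emod z (2 * N : ℤ)
  by_cases h : z % (2 * N : ℤ) < N
  · have hb : bitOf N z = false := by simp [bitOf, h]
    rw [hb, refl1_apply, refl1Fun, mulOf, if_pos h, fold1, if_pos h]
    simp
    linarith
  · have hb : bitOf N z = true := by simp [bitOf, not_lt.1 h]
    rw [hb, refl1_apply, refl1Fun, mulOf, if_neg h, fold1, if_neg h]
    simp
    linarith

/-- FREENESS: distinct image maps give distinct images (of any point). [folklore] -/
theorem refl1_inj (hN : 1 ≤ N) {b b' : Bool} {m m' : ℤ} (n : ℤ) (h : refl1 N b m n = refl1 N b' m' n) :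
    b = b' ∧ m = m' := by
  have h2N : (2 * N : ℤ) ≠ 0 := by omega
  simp only [refl1_apply, refl1Fun] at h
  cases b <;> cases b' <;> simp only [Bool.false_eq_true, ↓reduceIte] at h
  · exact ⟨rfl, mul_left_cancel₀ h2N (by linarith)⟩
  · exfalso
    have e : 2 * n + 1 = 2 * (N * (m' - m)) := by linarith
    omega
  · exfalso
    have e : 2 * n + 1 = 2 * (N * (m - m')) := by linarith
    omega
  · exact ⟨rfl, mul_left_cancel₀ h2N (by linarith)⟩

/-- folding a NEIGHBOUR of a point of `[0, N)`: the outside neighbours `-1` of `0` and `N` of `N - 1` fold back onto the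
point itself (the mirrors sit at `-1/2` and `N - 1/2`), inside neighbours are fixed. [folklore] -/
theorem fold1_add_one (hN : 1 ≤ N) {n : ℤ} (h0 : 0 ≤ n) (h1 : n < N) :
    fold1 N (n + 1) = if n + 1 < N then n + 1 else n := by
  split_ifs with h
  · exact fold1_of_mem hN (by omega) h
  · have hn : n = N - 1 := by omega
    subst hn
    by_cases hN1 : N = 1
    · subst hN1
      unfold fold1
      norm_num
    · have e : ((N : ℤ) - 1 + 1) % (2 * N : ℤ) = N := by
        rw [sub_add_cancel]; exact Int.emod_eq_of_lt (by omega) (by omega)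
      unfold fold1
      rw [e, if_neg (lt_irrefl _)]
      ring

/-- folding the left outside neighbour: `fold1 N (n-1) = n-1` for `n ≥ 1`, and `fold1 N (-1) = 0`. [folklore] -/
theorem fold1_sub_one (hN : 1 ≤ N) {n : ℤ} (h0 : 0 ≤ n) (h1 : n < N) :
    fold1 N (n - 1) = if 0 < n then n - 1 else n := by
  split_ifs with h
  · exact fold1_of_mem hN (by omega) (by omega)
  · have hn : n = 0 := by omega
    subst hn
    have e : ((0 : ℤ) - 1) % (2 * N : ℤ) = 2 * N - 1 := by
      have : (0 : ℤ) - 1 = (2 * N - 1) + (2 * N : ℤ) * (-1) := by ring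
      rw [this, Int.add_mul_emod_self_left]
      exact Int.emod_eq_of_lt (by omega) (by omega)
    unfold fold1
    rw [e, if_neg (by omega)]
    ring

end OneDim

section BoxInstance

variable {d : ℕ}

/-- FOLDING onto the box `Π_μ [0, N_μ)`, coordinatewise. [folklore] -/
def foldBox (N : Fin (d + 1) → ℕ) (x : Fin (d + 1) → ℤ) : Fin (d + 1) → ℤ := fun i => fold1 (N i) (x i)

/-- unfolding lemma for `foldBox`. [folklore] -/
@[simp] theorem foldBox_apply (N : Fin (d + 1) → ℕ) (x : Fin (d + 1) → ℤ) (i : Fin (d + 1)) :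
    foldBox N x i = fold1 (N i) (x i) := rfl

/-- the IMAGE MAPS of the box: coordinatewise 1-D image maps, `ε_μ` = reflect or translate, `m_μ` = how far
(the group generated by the `2(d+1)` face reflections of B4 (2.42)). [folklore] -/
def reflBox (N : Fin (d + 1) → ℕ) (ε : Fin (d + 1) → Bool) (m : Fin (d + 1) → ℤ) : Equiv.Perm (Fin (d + 1) → ℤ) :=
  Equiv.piCongrRight fun i => refl1 (N i) (ε i) (m i)

/-- unfolding lemma for `reflBox`. [folklore] -/
@[simp] theorem reflBox_apply (N : Fin (d + 1) → ℕ) (ε : Fin (d + 1) → Bool) (m : Fin (d + 1) → ℤ)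
    (x : Fin (d + 1) → ℤ) (i : Fin (d + 1)) : reflBox N ε m x i = refl1Fun (N i) (ε i) (m i) (x i) := rfl

/-- coordinatewise reflection bits / translation parts carrying `foldBox N z` to `z`. [folklore] -/
def bitsOf (N : Fin (d + 1) → ℕ) (z : Fin (d + 1) → ℤ) : Fin (d + 1) → Bool := fun i => bitOf (N i) (z i)

/-- see `bitsOf`. [folklore] -/
def mulsOf (N : Fin (d + 1) → ℕ) (z : Fin (d + 1) → ℤ) : Fin (d + 1) → ℤ := fun i => mulOf (N i) (z i)

/-- every site is an image of its folded representative: `σ_{bits z, muls z} (foldBox N z) = z`. [folklore] -/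
theorem reflBox_foldBox (N : Fin (d + 1) → ℕ) (z : Fin (d + 1) → ℤ) :
    reflBox N (bitsOf N z) (mulsOf N z) (foldBox N z) = z := by
  funext i
  have := refl1_fold1 (N i) (z i)
  simpa [bitsOf, mulsOf] using this

/-- folding is invariant under the images: `foldBox N (σ_{ε,m} z) = foldBox N z`. [folklore] -/
theorem foldBox_reflBox {N : Fin (d + 1) → ℕ} (hN : ∀ i, 1 ≤ N i) (ε : Fin (d + 1) → Bool) (m : Fin (d + 1) → ℤ)
    (z : Fin (d + 1) → ℤ) : foldBox N (reflBox N ε m z) = foldBox N z := by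
  funext i
  have := fold1_refl1 (hN i) (ε i) (m i) (z i)
  simpa using this

/-- THE BOX IMAGE SYSTEM of B4 (2.42). [cite: Balaban1983RegularityDecay, p. 584 (2.42), dictionary] [folklore] -/
noncomputable def box (N : Fin (d + 1) → ℕ) (hN : ∀ i, 1 ≤ N i) : ImageSystem (Fin (d + 1) → ℤ) where
  fold := foldBox N
  sym := Set.range fun p : (Fin (d + 1) → Bool) × (Fin (d + 1) → ℤ) => reflBox N p.1 p.2
  fold_sym := by
    rintro σ ⟨p, rfl⟩ z
    exact foldBox_reflBox hN p.1 p.2 z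
  trans z := ⟨reflBox N (bitsOf N z) (mulsOf N z), ⟨(bitsOf N z, mulsOf N z), rfl⟩, reflBox_foldBox N z⟩

/-- the folding map of the box image system is `foldBox`. [folklore] -/
@[simp] theorem box_fold (N : Fin (d + 1) → ℕ) (hN : ∀ i, 1 ≤ N i) : (box N hN).fold = foldBox N := rfl

/-- every `reflBox N ε m` is a symmetry of the box image system. [folklore] -/
theorem reflBox_mem_sym (N : Fin (d + 1) → ℕ) (hN : ∀ i, 1 ≤ N i) (ε : Fin (d + 1) → Bool) (m : Fin (d + 1) → ℤ) :
    reflBox N ε m ∈ (box N hN).sym := ⟨(ε, m), rfl⟩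

/-- the symmetries of the box image system are exactly the `reflBox N ε m`. [folklore] -/
theorem mem_sym_iff (N : Fin (d + 1) → ℕ) (hN : ∀ i, 1 ≤ N i) (σ : Equiv.Perm (Fin (d + 1) → ℤ)) :
    σ ∈ (box N hN).sym ↔ ∃ ε m, σ = reflBox N ε m := by
  constructor
  · rintro ⟨p, rfl⟩; exact ⟨p.1, p.2, rfl⟩
  · rintro ⟨ε, m, rfl⟩; exact ⟨(ε, m), rfl⟩

/-- the box `Π_μ [0, N_μ)` as a finite set of sites. [folklore] -/
noncomputable def boxDom (N : Fin (d + 1) → ℕ) : Finset (Fin (d + 1) → ℤ) := Fintype.piFinset fun i => Finset.Ico (0 : ℤ) (N i)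

/-- membership in the box, coordinatewise. [folklore] -/
theorem mem_boxDom {N : Fin (d + 1) → ℕ} {x : Fin (d + 1) → ℤ} : x ∈ boxDom N ↔ ∀ i, 0 ≤ x i ∧ x i < N i := by
  simp [boxDom, Fintype.mem_piFinset]

/-- the box is exactly the fundamental domain `{y | fold y = y}` of the box image system. [folklore] -/
theorem mem_boxDom_iff_fold {N : Fin (d + 1) → ℕ} (hN : ∀ i, 1 ≤ N i) (y : Fin (d + 1) → ℤ) :
    y ∈ boxDom N ↔ (box N hN).fold y = y := by
  rw [mem_boxDom, box_fold]
  constructor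
  · intro h; funext i; exact fold1_of_mem (hN i) (h i).1 (h i).2
  · intro h i; exact (fold1_eq_self_iff (hN i) (y i)).1 (congrFun h i)

/-- the folded point lies in the box. [folklore] -/
theorem foldBox_mem_boxDom {N : Fin (d + 1) → ℕ} (hN : ∀ i, 1 ≤ N i) (z : Fin (d + 1) → ℤ) :
    foldBox N z ∈ boxDom N :=
  mem_boxDom.2 fun i => ⟨fold1_nonneg (hN i) _, fold1_lt (hN i) _⟩

/-- FREENESS for the box: the image maps are separated by their action on any single point. [folklore] -/
theorem reflBox_inj {N : Fin (d + 1) → ℕ} (hN : ∀ i, 1 ≤ N i) {ε ε' : Fin (d + 1) → Bool} {m m' : Fin (d + 1) → ℤ}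
    (x : Fin (d + 1) → ℤ) (h : reflBox N ε m x = reflBox N ε' m' x) : ε = ε' ∧ m = m' := by
  have hc : ∀ i, ε i = ε' i ∧ m i = m' i := fun i =>
    refl1_inj (hN i) (x i) (by simpa using congrFun h i)
  exact ⟨funext fun i => (hc i).1, funext fun i => (hc i).2⟩

/-- PARAMETRISATION OF THE IMAGES: for `x'` in the box, `(ε, m) ↦ σ_{ε,m} x'` is a bijection onto the fibre
`{w | fold w = x'}` (every site over `x'` is one image, and only one). [folklore] -/
noncomputable def fibParam {N : Fin (d + 1) → ℕ} (hN : ∀ i, 1 ≤ N i) {x' : Fin (d + 1) → ℤ}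
    (hx' : foldBox N x' = x') : ((Fin (d + 1) → Bool) × (Fin (d + 1) → ℤ)) ≃ (box N hN).Fib x' :=
  Equiv.ofBijective
    (fun p => ⟨reflBox N p.1 p.2 x', by rw [box_fold, foldBox_reflBox hN, hx']⟩)
    (by
      constructor
      · intro p q hpq
        have h := congrArg (fun w : (box N hN).Fib x' => w.1) hpq
        obtain ⟨h1, h2⟩ := reflBox_inj hN x' h
        exact Prod.ext h1 h2
      · intro w
        refine ⟨(bitsOf N w.1, mulsOf N w.1), Subtype.ext ?_⟩
        have hw : foldBox N w.1 = x' := w.2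
        show reflBox N (bitsOf N w.1) (mulsOf N w.1) x' = w.1
        have e := reflBox_foldBox N w.1
        rw [hw] at e
        exact e)

/-- the underlying site of `fibParam hN hx' (ε, m)` is `reflBox N ε m x'`. [folklore] -/
@[simp] theorem fibParam_apply_coe {N : Fin (d + 1) → ℕ} (hN : ∀ i, 1 ≤ N i) {x' : Fin (d + 1) → ℤ}
    (hx' : foldBox N x' = x') (p : (Fin (d + 1) → Bool) × (Fin (d + 1) → ℤ)) :
    (fibParam hN hx' p).1 = reflBox N p.1 p.2 x' := rfl

end BoxInstance

section BoxOperators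

variable {d : ℕ} {R : Type*} [NormedRing R]

/-- the DIAGONAL kernel `c·δ_{xz}` (mass term `m_j² δ`). [folklore] -/
def diagK (c : R) (x z : Fin (d + 1) → ℤ) : R := if z = x then c else 0

/-- the folded diagonal kernel is the diagonal kernel (on the box). [folklore] -/
theorem foldOp_diagK {N : Fin (d + 1) → ℕ} (hN : ∀ i, 1 ≤ N i) (c : R) {x y : Fin (d + 1) → ℤ}
    (hx : x ∈ boxDom N) :
    (box N hN).foldOp (diagK c) (fun u => {u}) x y = diagK c x y := by
  have hfx : foldBox N x = x := (mem_boxDom_iff_fold hN x).1 hx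
  unfold ImageSystem.foldOp diagK
  rw [Finset.filter_singleton, box_fold, hfx]
  by_cases h : x = y
  · subst h; simp
  · rw [if_neg h, Finset.sum_empty, if_neg (Ne.symm h)]

/-- the `2(d+1)` NEAREST NEIGHBOURS `x ± e_μ` of a site. [folklore] -/
noncomputable def nbrs (x : Fin (d + 1) → ℤ) : Finset (Fin (d + 1) → ℤ) :=
  (Finset.univ.image fun i => x + Pi.single i 1) ∪ (Finset.univ.image fun i => x - Pi.single i 1)

/-- membership in the nearest-neighbour set: `z = x ± e_i`. [folklore] -/
theorem mem_nbrs {x z : Fin (d + 1) → ℤ} : z ∈ nbrs x ↔ ∃ i, z = x + Pi.single i 1 ∨ z = x - Pi.single i 1 := by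
  simp only [nbrs, Finset.mem_union, Finset.mem_image, Finset.mem_univ, true_and]
  constructor
  · rintro (⟨i, hi⟩ | ⟨i, hi⟩)
    · exact ⟨i, Or.inl hi.symm⟩
    · exact ⟨i, Or.inr hi.symm⟩
  · rintro ⟨i, hi | hi⟩
    · exact Or.inl ⟨i, hi.symm⟩
    · exact Or.inr ⟨i, hi.symm⟩

/-- a site is not its own nearest neighbour. [folklore] -/
theorem not_mem_nbrs_self (x : Fin (d + 1) → ℤ) : x ∉ nbrs x := by
  intro h
  obtain ⟨i, hi | hi⟩ := mem_nbrs.1 h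
  · have := congrFun hi i; simp at this
  · have := congrFun hi i; simp at this; omega

/-- the `2(d+1)` nearest neighbours are pairwise distinct. [folklore] -/
theorem card_nbrs (x : Fin (d + 1) → ℤ) : (nbrs x).card = 2 * (d + 1) := by
  have hinj₁ : Function.Injective fun i : Fin (d + 1) => x + Pi.single i (1 : ℤ) := by
    intro i j h
    by_contra hij
    have := congrFun h i
    simp [hij] at this
  have hinj₂ : Function.Injective fun i : Fin (d + 1) => x - Pi.single i (1 : ℤ) := by
    intro i j h
    by_contra hij
    have := congrFun h i
    simp [hij] at this
  have hdisj : Disjoint (Finset.univ.image fun i => x + Pi.single i (1 : ℤ))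
      (Finset.univ.image fun i => x - Pi.single i (1 : ℤ)) := by
    rw [Finset.disjoint_left]
    intro z hz hz'
    simp only [Finset.mem_image, Finset.mem_univ, true_and] at hz hz'
    obtain ⟨i, rfl⟩ := hz
    obtain ⟨j, hj⟩ := hz'
    have := congrFun hj i
    by_cases hij : j = i
    · subst hij; simp at this; omega
    · simp [Ne.symm hij] at this
  unfold nbrs
  rw [Finset.card_union_of_disjoint hdisj, Finset.card_image_of_injective _ hinj₁,
    Finset.card_image_of_injective _ hinj₂, Finset.card_univ, Fintype.card_fin]
  ring

/-- the (unscaled) LATTICE LAPLACIAN kernel `-Δ` on `ℤ^{d+1}`: `2(d+1)` on the diagonal, `-1` on nearest neighbours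
(B4 (2.44) `-Δ^ξ = ξ⁻²·(this)` in `ξ`-units). [cite: Balaban1983RegularityDecay, p. 584 (2.44), dictionary] [folklore] -/
noncomputable def lapK (x z : Fin (d + 1) → ℤ) : R :=
  if z = x then ((2 * (d + 1) : ℕ) : R) else if z ∈ nbrs x then -1 else 0

/-- the NEUMANN LAPLACIAN of the box (graph Laplacian of the induced box graph): the number of neighbours INSIDE the box
on the diagonal, `-1` on nearest-neighbour pairs. [folklore] -/
noncomputable def neumannLapK (N : Fin (d + 1) → ℕ) (x y : Fin (d + 1) → ℤ) : R :=
  if y = x then (((nbrs x).filter fun z => z ∈ boxDom N).card : ℕ) else if y ∈ nbrs x then -1 else 0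

/-- folding a nearest neighbour of a box point: inside neighbours are fixed, outside neighbours fold back onto the point
(the mirrors bisect the boundary bonds). [folklore] -/
theorem foldBox_nbr {N : Fin (d + 1) → ℕ} (hN : ∀ i, 1 ≤ N i) {x z : Fin (d + 1) → ℤ} (hx : x ∈ boxDom N)
    (hz : z ∈ nbrs x) : foldBox N z = if z ∈ boxDom N then z else x := by
  rw [mem_boxDom] at hx
  obtain ⟨i, rfl | rfl⟩ := mem_nbrs.1 hz
  · by_cases hin : x i + 1 < N i
    · have hmem : x + Pi.single i (1 : ℤ) ∈ boxDom N := by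
        rw [mem_boxDom]; intro j
        by_cases hji : j = i
        · subst hji; simp; constructor <;> linarith [(hx j).1]
        · simp [hji]; exact hx j
      rw [if_pos hmem]
      exact (mem_boxDom_iff_fold hN _).1 hmem
    · have hnot : x + Pi.single i (1 : ℤ) ∉ boxDom N := by
        rw [mem_boxDom]; intro h; have := (h i).2; simp at this; omega
      rw [if_neg hnot]
      funext j
      by_cases hji : j = i
      · subst hji
        simp only [foldBox_apply, Pi.add_apply, Pi.single_eq_same]
        rw [fold1_add_one (hN j) (hx j).1 (hx j).2, if_neg hin]
      · simp only [foldBox_apply, Pi.add_apply, Pi.single_apply, if_neg hji, add_zero]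
        exact fold1_of_mem (hN j) (hx j).1 (hx j).2
  · by_cases hin : 0 < x i
    · have hmem : x - Pi.single i (1 : ℤ) ∈ boxDom N := by
        rw [mem_boxDom]; intro j
        by_cases hji : j = i
        · subst hji; simp; constructor <;> linarith [(hx j).2]
        · simp [hji]; exact hx j
      rw [if_pos hmem]
      exact (mem_boxDom_iff_fold hN _).1 hmem
    · have hnot : x - Pi.single i (1 : ℤ) ∉ boxDom N := by
        rw [mem_boxDom]; intro h; have := (h i).1; simp at this; omega
      rw [if_neg hnot]
      funext j
      by_cases hji : j = i
      · subst hji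
        simp only [foldBox_apply, Pi.sub_apply, Pi.single_eq_same]
        rw [fold1_sub_one (hN j) (hx j).1 (hx j).2, if_neg hin]
      · simp only [foldBox_apply, Pi.sub_apply, Pi.single_apply, if_neg hji, sub_zero]
        exact fold1_of_mem (hN j) (hx j).1 (hx j).2

/-- NEUMANN = FOLDED FREE LAPLACIAN: on the box, the folded lattice Laplacian is the Neumann Laplacian of the box.
[cite: Balaban1983RegularityDecay, p. 584 (2.42), dictionary] [folklore] -/
theorem foldOp_lapK {N : Fin (d + 1) → ℕ} (hN : ∀ i, 1 ≤ N i) {x y : Fin (d + 1) → ℤ}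
    (hx : x ∈ boxDom N) (hy : y ∈ boxDom N) :
    (box N hN).foldOp (lapK (R := R)) (fun u => insert u (nbrs u)) x y = neumannLapK (R := R) N x y := by
  classical
  have hfx : foldBox N x = x := (mem_boxDom_iff_fold hN x).1 hx
  unfold ImageSystem.foldOp
  rw [box_fold, Finset.filter_insert, hfx]
  -- the neighbour part
  have hnb : ∀ z ∈ (nbrs x).filter (fun z => foldBox N z = y), (lapK x z : R) = -1 := by
    intro z hz
    have hz' := (Finset.mem_filter.1 hz).1
    have hne : z ≠ x := fun h => not_mem_nbrs_self x (h ▸ hz')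
    simp [lapK, hne, hz']
  have hsum_nb : ∑ z ∈ (nbrs x).filter (fun z => foldBox N z = y), (lapK x z : R)
      = -(((nbrs x).filter (fun z => foldBox N z = y)).card : R) := by
    rw [Finset.sum_congr rfl hnb, Finset.sum_const, nsmul_eq_mul, mul_neg, mul_one]
  by_cases hxy : x = y
  · subst hxy
    rw [if_pos rfl, Finset.sum_insert (fun h => not_mem_nbrs_self x (Finset.mem_filter.1 h).1), hsum_nb]
    -- the filter is the set of OUTSIDE neighbours
    have hfilt : (nbrs x).filter (fun z => foldBox N z = x) = (nbrs x).filter (fun z => z ∉ boxDom N) := by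
      apply Finset.filter_congr
      intro z hz
      rw [foldBox_nbr hN hx hz]
      constructor
      · intro h hin; rw [if_pos hin] at h; exact not_mem_nbrs_self x (h ▸ hz)
      · intro h; rw [if_neg h]
    rw [hfilt]
    have hcard : ((nbrs x).filter (fun z => z ∈ boxDom N)).card + ((nbrs x).filter (fun z => z ∉ boxDom N)).card
        = 2 * (d + 1) := by
      rw [Finset.card_filter_add_card_filter_not, card_nbrs]
    simp only [lapK, neumannLapK, if_true]
    have hc : ((((nbrs x).filter (fun z => z ∈ boxDom N)).card : ℕ) : R)
        + ((((nbrs x).filter (fun z => z ∉ boxDom N)).card : ℕ) : R) = ((2 * (d + 1) : ℕ) : R) := by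
      rw [← Nat.cast_add, hcard]
    rw [← hc]
    abel
  · rw [if_neg hxy, hsum_nb]
    have hfilt : (nbrs x).filter (fun z => foldBox N z = y) = (nbrs x).filter (fun z => z = y) := by
      apply Finset.filter_congr
      intro z hz
      rw [foldBox_nbr hN hx hz]
      split_ifs with hin
      · exact Iff.rfl
      · constructor
        · intro h; exact absurd h hxy
        · intro h; subst h; exact absurd hy hin
    rw [hfilt, Finset.filter_eq' (nbrs x) y]
    simp only [neumannLapK, if_neg (Ne.symm hxy)]
    split_ifs with hyn
    · simp
    · simp

/-- BLOCK INDEX of a site for blocks of side `b` (`b = L^j` sites = one unit block of `ξℤ^{d+1}`). [folklore] -/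
def blk (b : ℕ) (x : Fin (d + 1) → ℤ) : Fin (d + 1) → ℤ := fun i => x i / (b : ℤ)

/-- the block containing `x`, as a finite set of sites. [folklore] -/
noncomputable def blockOf (b : ℕ) (x : Fin (d + 1) → ℤ) : Finset (Fin (d + 1) → ℤ) :=
  Fintype.piFinset fun i => Finset.Ico ((b : ℤ) * (x i / (b : ℤ))) ((b : ℤ) * (x i / (b : ℤ)) + b)

/-- `z` lies in the block of `x` iff they have the same block index. [folklore] -/
theorem mem_blockOf {b : ℕ} (hb : 1 ≤ b) {x z : Fin (d + 1) → ℤ} : z ∈ blockOf b x ↔ blk b z = blk b x := by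
  have hb' : (0 : ℤ) < b := by exact_mod_cast hb
  have hb0 : (b : ℤ) ≠ 0 := ne_of_gt hb'
  simp only [blockOf, Fintype.mem_piFinset, Finset.mem_Ico, blk, funext_iff]
  refine forall_congr' fun i => ?_
  have hdiv : (b : ℤ) * (z i / (b : ℤ)) + z i % (b : ℤ) = z i := Int.mul_ediv_add_emod (z i) b
  have hr0 := Int.emod_nonneg (z i) hb0
  have hr1 := Int.emod_lt_of_pos (z i) hb'
  constructor
  · rintro ⟨h1, h2⟩
    rcases lt_trichotomy (z i / b) (x i / b) with hlt | heq | hgt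
    · exfalso
      have h3 : z i / ↑b + 1 ≤ x i / ↑b := hlt
      have h4 := mul_le_mul_of_nonneg_left h3 hb'.le
      rw [mul_add, mul_one] at h4
      linarith
    · exact heq
    · exfalso
      have h3 : x i / ↑b + 1 ≤ z i / ↑b := hgt
      have h4 := mul_le_mul_of_nonneg_left h3 hb'.le
      rw [mul_add, mul_one] at h4
      linarith
  · intro h
    rw [h] at hdiv
    constructor <;> omega

/-- a site lies in its own block. [folklore] -/
theorem self_mem_blockOf {b : ℕ} (hb : 1 ≤ b) (x : Fin (d + 1) → ℤ) : x ∈ blockOf b x := (mem_blockOf hb).2 rfl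

/-- a box built of blocks (`b ∣ N_μ`) contains the block of each of its points. [folklore] -/
theorem blockOf_subset_boxDom {b : ℕ} (hb : 1 ≤ b) {N : Fin (d + 1) → ℕ} (hbN : ∀ i, (b : ℤ) ∣ (N i : ℤ))
    {x : Fin (d + 1) → ℤ} (hx : x ∈ boxDom N) : blockOf b x ⊆ boxDom N := by
  intro z hz
  have hb' : (0 : ℤ) < b := by exact_mod_cast hb
  rw [mem_boxDom] at hx ⊢
  simp only [blockOf, Fintype.mem_piFinset, Finset.mem_Ico] at hz
  intro i
  obtain ⟨h1, h2⟩ := hz i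
  obtain ⟨hx0, hx1⟩ := hx i
  obtain ⟨n, hn⟩ := hbN i
  have hq0 : 0 ≤ x i / (b : ℤ) := Int.ediv_nonneg hx0 hb'.le
  have hq1 : x i / (b : ℤ) < n := by
    rw [hn] at hx1
    exact Int.ediv_lt_of_lt_mul hb' (by linarith)
  have hq1' : x i / (b : ℤ) + 1 ≤ n := hq1
  have h5 := mul_le_mul_of_nonneg_left hq1' hb'.le
  have h6 := mul_le_mul_of_nonneg_left hq0 hb'.le
  rw [mul_add, mul_one] at h5
  constructor
  · linarith
  · rw [hn]; linarith

/-- the BLOCK-AVERAGING kernel `a·1[z ∈ B(x)]` (B4's `a_j Q_j^* Q_j`, `a = a_j (L^jξ)^{-d}·ξ^{d}` in `ξ`-units — any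
coefficient). [cite: Balaban1983RegularityDecay, p. 584 (2.44), dictionary] [folklore] -/
def avgK (a : R) (b : ℕ) (x z : Fin (d + 1) → ℤ) : R := if blk b z = blk b x then a else 0

/-- on a box built of blocks the folded block-averaging kernel is the block-averaging kernel of the box: reflections in
block faces map blocks onto blocks, so `Q_j^*Q_j` "commutes with the reflection group". [folklore] -/
theorem foldOp_avgK {N : Fin (d + 1) → ℕ} (hN : ∀ i, 1 ≤ N i) {b : ℕ} (hb : 1 ≤ b) (hbN : ∀ i, (b : ℤ) ∣ (N i : ℤ))
    (a : R) {x y : Fin (d + 1) → ℤ} (hx : x ∈ boxDom N) :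
    (box N hN).foldOp (avgK a b) (blockOf b) x y = avgK a b x y := by
  classical
  unfold ImageSystem.foldOp
  rw [box_fold]
  have hfilt : (blockOf b x).filter (fun z => foldBox N z = y) = (blockOf b x).filter (fun z => z = y) := by
    apply Finset.filter_congr
    intro z hz
    have hzF : z ∈ boxDom N := blockOf_subset_boxDom hb hbN hx hz
    have e : foldBox N z = z := (mem_boxDom_iff_fold hN z).1 hzF
    rw [e]
  rw [hfilt, Finset.filter_eq' (blockOf b x) y]
  by_cases hyb : y ∈ blockOf b x
  · rw [if_pos hyb, Finset.sum_singleton]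
  · rw [if_neg hyb, Finset.sum_empty]
    have : blk b y ≠ blk b x := fun h => hyb ((mem_blockOf hb).2 h)
    simp [avgK, this]

end BoxOperators

/-! ## §3  Summability and exponential decay of the box image kernel, uniformly in the box -/

section BoxDecay

open Literature.MathematicalPhysics.QuantumFieldTheory.Balaban1983to89.B4ContourShift
open Literature.MathematicalPhysics.QuantumFieldTheory.Balaban1983to89.B4TorusKernel (periodConst)
open Literature.MathematicalPhysics.QuantumFieldTheory.Balaban1983to89.B4TorusKernel.MultiPeriod

variable {d : ℕ}

/-- re-centring a full period sum: `Σ_m f(v + Pm)` does not change under `v ↦ v + Pc`. [folklore] -/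
theorem translate_translate (P : Fin (d + 1) → ℕ) (v c m : Fin (d + 1) → ℤ) :
    translate P (translate P v c) m = translate P v (c + m) := by
  funext i; simp only [translate_apply, Pi.add_apply]; ring

/-- REAL PERIODISATION MAJORANT (any base point): `Σ_m M e^{-κ|v + Pm|_∞}` converges and is
`≤ M · periodConst κ d · e^{-(κ/(d+1)) · torusSupNorm P v}` — B4TorusKernel's `periodise_bound` at the centred representative.
[folklore] -/
theorem periodise_majorant {κ M : ℝ} (hκ : 0 < κ) (hM : 0 ≤ M) {P : Fin (d + 1) → ℕ} (hP : ∀ i, 1 ≤ P i)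
    (v : Fin (d + 1) → ℤ) :
    Summable (fun m : Fin (d + 1) → ℤ => M * Real.exp (-(κ * supNorm (translate P v m)))) ∧
      ∑' m : Fin (d + 1) → ℤ, M * Real.exp (-(κ * supNorm (translate P v m)))
        ≤ M * periodConst κ d * Real.exp (-(κ / (d + 1) * torusSupNorm P v)) := by
  set c := centreVec P v with hc
  set v₀ := translate P v c with hv₀
  have hcen : ∀ i, 2 * |v₀ i| ≤ P i := translate_centreVec_centred hP v
  -- the complexified majorant, to which `periodise_bound` applies verbatim
  set K : (Fin (d + 1) → ℤ) → ℂ := fun y => ((M * Real.exp (-(κ * supNorm y)) : ℝ) : ℂ) with hK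
  have hKle : ∀ y, ‖K y‖ ≤ M * Real.exp (-(κ * supNorm y)) := by
    intro y
    rw [hK, Complex.norm_real, Real.norm_eq_abs, abs_of_nonneg (by positivity)]
  obtain ⟨hs, _⟩ := periodise_bound K hκ hKle hP v₀ hcen
  have hb := periodise_bound_supNorm K hκ hKle hP v₀ hcen
  -- back to the reals
  have hs' : Summable (fun m : Fin (d + 1) → ℤ => M * Real.exp (-(κ * supNorm (translate P v₀ m)))) :=
    Complex.summable_ofReal.1 hs
  have hb' : ∑' m : Fin (d + 1) → ℤ, M * Real.exp (-(κ * supNorm (translate P v₀ m)))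
      ≤ M * periodConst κ d * Real.exp (-(κ / (d + 1) * torusSupNorm P v)) := by
    rw [← supNorm_translate_centreVec hP v, ← hc, ← hv₀]
    have e : ‖∑' m : Fin (d + 1) → ℤ, K (translate P v₀ m)‖
        = ∑' m : Fin (d + 1) → ℤ, M * Real.exp (-(κ * supNorm (translate P v₀ m))) := by
      rw [hK]
      simp only []
      rw [← Complex.ofReal_tsum, Complex.norm_real, Real.norm_eq_abs,
        abs_of_nonneg (tsum_nonneg fun m => by positivity)]
    rw [← e]; exact hb
  -- re-centre: m ↦ c + m
  have hreidx : (fun m : Fin (d + 1) → ℤ => M * Real.exp (-(κ * supNorm (translate P v m))))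
      = (fun m => M * Real.exp (-(κ * supNorm (translate P v₀ m)))) ∘ (Equiv.addLeft c).symm := by
    funext m
    simp only [Function.comp_apply, Equiv.addLeft_symm, Equiv.coe_addLeft, hv₀, translate_translate]
    congr 2
    simp
  refine ⟨?_, ?_⟩
  · rw [hreidx]; exact (Equiv.summable_iff _).2 hs'
  · rw [hreidx]
    exact le_of_eq_of_le ((Equiv.addLeft c).symm.tsum_eq
      (fun m => M * Real.exp (-(κ * supNorm (translate P v₀ m))))) hb'

/-- the images of `x'` under a fixed reflection pattern `ε` form a full period class of period `2N`:
`σ_{ε,m} x' = σ_{ε,0} x' + 2N·m`. [folklore] -/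
theorem reflBox_eq_translate (N : Fin (d + 1) → ℕ) (ε : Fin (d + 1) → Bool) (m x' : Fin (d + 1) → ℤ) :
    reflBox N ε m x' = translate (fun i => 2 * N i) (reflBox N ε 0 x') m := by
  funext i
  rw [translate_apply, reflBox_apply, reflBox_apply]
  cases ε i
  · simp [refl1Fun]; try ring
  · simp [refl1Fun]; try ring

/-- `z - σ_{ε,m} x' = (z - σ_{ε,0} x') - 2N·m`, as a translate by `-m`. [folklore] -/
theorem sub_reflBox_eq_translate (N : Fin (d + 1) → ℕ) (ε : Fin (d + 1) → Bool) (m z x' : Fin (d + 1) → ℤ) :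
    z - reflBox N ε m x' = translate (fun i => 2 * N i) (z - reflBox N ε 0 x') (-m) := by
  rw [reflBox_eq_translate N ε m x']
  funext i
  simp only [Pi.sub_apply, translate_apply, Pi.neg_apply]
  ring

/-- ONE REFLECTION PATTERN: the image series over the translations is absolutely convergent with the periodisation
majorant bound (period `2N`). [folklore] -/
theorem summable_norm_reflBox {N : Fin (d + 1) → ℕ} (hN : ∀ i, 1 ≤ N i) {K : (Fin (d + 1) → ℤ) → (Fin (d + 1) → ℤ) → ℂ}
    {κ M : ℝ} (hκ : 0 < κ) (hM : 0 ≤ M) (hK : ∀ u w, ‖K u w‖ ≤ M * Real.exp (-(κ * supNorm (u - w))))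
    (z x' : Fin (d + 1) → ℤ) (ε : Fin (d + 1) → Bool) :
    Summable (fun m : Fin (d + 1) → ℤ => ‖K z (reflBox N ε m x')‖) ∧
      ∑' m : Fin (d + 1) → ℤ, ‖K z (reflBox N ε m x')‖
        ≤ M * periodConst κ d * Real.exp (-(κ / (d + 1) * torusSupNorm (fun i => 2 * N i) (z - reflBox N ε 0 x'))) := by
  have hP : ∀ i, 1 ≤ 2 * N i := fun i => by linarith [hN i]
  set v := z - reflBox N ε 0 x' with hv
  obtain ⟨hs, hb⟩ := periodise_majorant hκ hM hP v
  -- the majorant reindexed by m ↦ -m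
  set g : (Fin (d + 1) → ℤ) → ℝ := fun m => M * Real.exp (-(κ * supNorm (translate (fun i => 2 * N i) v m))) with hg
  have hgs : Summable (g ∘ (Equiv.neg (Fin (d + 1) → ℤ))) := (Equiv.summable_iff _).2 hs
  have hgt : ∑' m, (g ∘ (Equiv.neg (Fin (d + 1) → ℤ))) m = ∑' m, g m := Equiv.tsum_eq _ _
  have hle : ∀ m : Fin (d + 1) → ℤ, ‖K z (reflBox N ε m x')‖ ≤ (g ∘ (Equiv.neg (Fin (d + 1) → ℤ))) m := by
    intro m
    have := hK z (reflBox N ε m x')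
    rw [sub_reflBox_eq_translate] at this
    simpa [hg, hv] using this
  have hsum : Summable (fun m : Fin (d + 1) → ℤ => ‖K z (reflBox N ε m x')‖) :=
    Summable.of_nonneg_of_le (fun m => norm_nonneg _) hle hgs
  refine ⟨hsum, ?_⟩
  calc ∑' m : Fin (d + 1) → ℤ, ‖K z (reflBox N ε m x')‖
      ≤ ∑' m, (g ∘ (Equiv.neg (Fin (d + 1) → ℤ))) m := Summable.tsum_le_tsum hle hsum hgs
    _ = ∑' m, g m := hgt
    _ ≤ _ := hb

/-- ALL IMAGES: the family `(ε, m) ↦ ‖K(z, σ_{ε,m} x')‖` is summable and its sum is at most `2^{d+1}` periodisation bounds.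
[folklore] -/
theorem summable_norm_images {N : Fin (d + 1) → ℕ} (hN : ∀ i, 1 ≤ N i) {K : (Fin (d + 1) → ℤ) → (Fin (d + 1) → ℤ) → ℂ}
    {κ M : ℝ} (hκ : 0 < κ) (hM : 0 ≤ M) (hK : ∀ u w, ‖K u w‖ ≤ M * Real.exp (-(κ * supNorm (u - w))))
    (z x' : Fin (d + 1) → ℤ) {D : ℝ} (hD : ∀ ε, D ≤ torusSupNorm (fun i => 2 * N i) (z - reflBox N ε 0 x')) :
    Summable (fun p : (Fin (d + 1) → Bool) × (Fin (d + 1) → ℤ) => ‖K z (reflBox N p.1 p.2 x')‖) ∧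
      ∑' p : (Fin (d + 1) → Bool) × (Fin (d + 1) → ℤ), ‖K z (reflBox N p.1 p.2 x')‖
        ≤ 2 ^ (d + 1) * (M * periodConst κ d) * Real.exp (-(κ / (d + 1) * D)) := by
  have hone : ∀ ε, Summable (fun m : Fin (d + 1) → ℤ => ‖K z (reflBox N ε m x')‖) ∧
      ∑' m : Fin (d + 1) → ℤ, ‖K z (reflBox N ε m x')‖ ≤ M * periodConst κ d * Real.exp (-(κ / (d + 1) * D)) := by
    intro ε
    obtain ⟨hs, hb⟩ := summable_norm_reflBox hN hκ hM hK z x' ε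
    refine ⟨hs, le_trans hb ?_⟩
    have hC : 0 ≤ M * periodConst κ d := by
      apply mul_nonneg hM
      unfold periodConst
      apply pow_nonneg
      apply div_nonneg (by positivity)
      have : Real.exp (-(κ / (d + 1))) < 1 := Real.exp_lt_one_iff.mpr (by
        have : 0 < κ / (d + 1) := div_pos hκ (by positivity); linarith)
      linarith
    apply mul_le_mul_of_nonneg_left _ hC
    apply Real.exp_le_exp.mpr
    have hκ' : 0 ≤ κ / (d + 1) := div_nonneg hκ.le (by positivity)
    nlinarith [hD ε]
  have hprod : Summable (fun p : (Fin (d + 1) → Bool) × (Fin (d + 1) → ℤ) => ‖K z (reflBox N p.1 p.2 x')‖) := by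
    refine (summable_prod_of_nonneg fun p => norm_nonneg _).2 ⟨fun ε => (hone ε).1, ?_⟩
    exact Summable.of_finite
  refine ⟨hprod, ?_⟩
  rw [hprod.tsum_prod' (fun ε => (hone ε).1), tsum_fintype]
  calc ∑ ε : Fin (d + 1) → Bool, ∑' m : Fin (d + 1) → ℤ, ‖K z (reflBox N ε m x')‖
      ≤ ∑ ε : Fin (d + 1) → Bool, M * periodConst κ d * Real.exp (-(κ / (d + 1) * D)) :=
        Finset.sum_le_sum fun ε _ => (hone ε).2
    _ = 2 ^ (d + 1) * (M * periodConst κ d) * Real.exp (-(κ / (d + 1) * D)) := by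
        rw [Finset.sum_const, Finset.card_univ, Fintype.card_fun, Fintype.card_bool, Fintype.card_fin, nsmul_eq_mul]
        push_cast
        ring

/-- SUMMABILITY OF THE IMAGE SERIES over every fibre of the box image system (hypothesis `hsum` of the images identity),
for an exponentially decaying lattice kernel. [folklore] -/
theorem summable_fib_box {N : Fin (d + 1) → ℕ} (hN : ∀ i, 1 ≤ N i) {K : (Fin (d + 1) → ℤ) → (Fin (d + 1) → ℤ) → ℂ}
    {κ M : ℝ} (hκ : 0 < κ) (hM : 0 ≤ M) (hK : ∀ u w, ‖K u w‖ ≤ M * Real.exp (-(κ * supNorm (u - w))))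
    (z x' : Fin (d + 1) → ℤ) : Summable (fun w : (box N hN).Fib x' => K z w.1) := by
  by_cases hx' : foldBox N x' = x'
  · have hP : ∀ i, 1 ≤ 2 * N i := fun i => by linarith [hN i]
    obtain ⟨hs, _⟩ := summable_norm_images hN hκ hM hK z x'
      (D := 0) (fun ε => torusSupNorm_nonneg hP _)
    have hs1 : Summable (fun p : (Fin (d + 1) → Bool) × (Fin (d + 1) → ℤ) => K z (reflBox N p.1 p.2 x')) :=
      Summable.of_norm hs
    have : Summable ((fun w : (box N hN).Fib x' => K z w.1) ∘ (fibParam hN hx')) := by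
      simpa [Function.comp_def] using hs1
    exact (Equiv.summable_iff _).1 this
  · haveI : IsEmpty ((box N hN).Fib x') := ⟨fun w => hx' (by
        have h : foldBox N w.1 = x' := w.2
        have h2 : foldBox N (foldBox N w.1) = foldBox N w.1 := (box N hN).fold_fold w.1
        rw [h] at h2
        exact h2)⟩
    exact (hasSum_empty).summable

/-- the torus distance (period `2N`) between a box point `x` and the base image `σ_{ε,0} x'` of a box point `x'` is at
least the lattice distance `|x - x'|_∞`: folding is `1`-Lipschitz. [folklore] -/
theorem supNorm_sub_le_torusSupNorm {N : Fin (d + 1) → ℕ} {x x' : Fin (d + 1) → ℤ}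
    (hx : x ∈ boxDom N) (hx' : x' ∈ boxDom N) (ε : Fin (d + 1) → Bool) :
    supNorm (x - x') ≤ torusSupNorm (fun i => 2 * N i) (x - reflBox N ε 0 x') := by
  rw [mem_boxDom] at hx hx'
  obtain ⟨i, hi⟩ := exists_supNorm_eq (x - x')
  rw [hi]
  refine le_trans ?_ (Finset.le_sup' (fun j => ((circAbs (2 * N j) ((x - reflBox N ε 0 x') j) : ℤ) : ℝ))
    (Finset.mem_univ i))
  have hxi := hx i
  have hxi' := hx' i
  have key : |x i - x' i| ≤ circAbs (2 * N i) ((x - reflBox N ε 0 x') i) := by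
    have hP : 1 ≤ 2 * N i := by omega
    simp only [Pi.sub_apply, reflBox_apply, Pi.zero_apply, refl1Fun]
    cases ε i <;> simp only [Bool.false_eq_true, ↓reduceIte, mul_zero, zero_sub, add_zero]
    · have habs : |x i - x' i| ≤ (N i : ℤ) - 1 := abs_le.2 ⟨by omega, by omega⟩
      rw [circAbs_of_centred hP (by push_cast; linarith)]
    · have h0 : (0 : ℤ) ≤ x i - (-1 - x' i) := by omega
      have h1 : x i - (-1 - x' i) < ((2 * N i : ℕ) : ℤ) := by push_cast; omega
      unfold circAbs
      rw [Int.emod_eq_of_lt h0 h1, le_min_iff, abs_le, abs_le]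
      push_cast
      omega
  have := key
  simp only [Pi.sub_apply] at this ⊢
  exact_mod_cast this

/-- **DECAY OF THE BOX IMAGE KERNEL, UNIFORM IN THE BOX** (B4: "(2.35) for `G_j` ⇒ (2.35) for `G_j(□)`", zeroth order):
`‖K(u,w)‖ ≤ M e^{-κ|u-w|_∞}` on the lattice ⇒ `‖K_□(x,x')‖ ≤ 2^{d+1} · M · periodConst κ d · e^{-(κ/(d+1))|x-x'|_∞}` for
`x, x'` in the box — the constant depends on `κ, d` only. [cite: Balaban1983RegularityDecay, p. 584 l. 13–14, dictionary]
[folklore] -/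
theorem norm_imK_box_le {N : Fin (d + 1) → ℕ} (hN : ∀ i, 1 ≤ N i) {K : (Fin (d + 1) → ℤ) → (Fin (d + 1) → ℤ) → ℂ}
    {κ M : ℝ} (hκ : 0 < κ) (hM : 0 ≤ M) (hK : ∀ u w, ‖K u w‖ ≤ M * Real.exp (-(κ * supNorm (u - w))))
    {x x' : Fin (d + 1) → ℤ} (hx : x ∈ boxDom N) (hx' : x' ∈ boxDom N) :
    ‖(box N hN).imK K x x'‖ ≤ 2 ^ (d + 1) * (M * periodConst κ d) * Real.exp (-(κ / (d + 1) * supNorm (x - x'))) := by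
  have hfx' : foldBox N x' = x' := (mem_boxDom_iff_fold hN x').1 hx'
  obtain ⟨hs, hb⟩ := summable_norm_images hN hκ hM hK x x' (D := supNorm (x - x'))
    (fun ε => supNorm_sub_le_torusSupNorm hx hx' ε)
  refine le_trans ?_ hb
  unfold ImageSystem.imK
  rw [← (fibParam hN hfx').tsum_eq (fun w : (box N hN).Fib x' => K x w.1)]
  simp only [fibParam_apply_coe]
  exact norm_tsum_le_tsum_norm hs

end BoxDecay

/-! ## §4  B4 (2.42)/(2.44): the box propagator with Neumann boundary conditions IS the reflection-image sum -/

section B4Display242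

open Literature.MathematicalPhysics.QuantumFieldTheory.Balaban1983to89.B4ContourShift
open Literature.MathematicalPhysics.QuantumFieldTheory.Balaban1983to89.B4TorusKernel (periodConst)
open Literature.MathematicalPhysics.QuantumFieldTheory.Balaban1983to89.B4TorusKernel.MultiPeriod

variable {d : ℕ}

/-- B4's operator (2.44) `-Δ^ξ + m_j² + a_j Q_j^* Q_j` on `ξℤ^d`, written in LATTICE UNITS as a lattice kernel:
`c₁·(-Δ) + msq·1 + a·𝟙[same b-block]` (`c₁ = ξ⁻²`, `msq = m_j²`, `a·𝟙[same block] = ` the kernel of `a_j Q_j^* Q_j`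
with `Q_j` the average over blocks of side `b = L^j` sites, i.e. `a = a_j ξ^d`; we keep the three coefficients free).
[cite: Balaban1983RegularityDecay, p. 584 (2.44), dictionary] -/
noncomputable def opK (c₁ msq a : ℂ) (b : ℕ) (x z : Fin (d + 1) → ℤ) : ℂ :=
  c₁ * lapK x z + (diagK msq x z + avgK a b x z)

/-- the same operator ON THE BOX `Π_μ [0,N_μ)` with NEUMANN boundary conditions: `c₁·(-Δ_□^N) + msq·1 + a·𝟙[same block]`.
[cite: Balaban1983RegularityDecay, p. 584 (2.42)–(2.44), dictionary] -/
noncomputable def opBoxK (c₁ msq a : ℂ) (b : ℕ) (N : Fin (d + 1) → ℕ) (x y : Fin (d + 1) → ℤ) : ℂ :=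
  c₁ * neumannLapK N x y + (diagK msq x y + avgK a b x y)

/-- a common finite support of `opK(x, ·)`: the site, its nearest neighbours and its block. [folklore] -/
noncomputable def opSupp (b : ℕ) (u : Fin (d + 1) → ℤ) : Finset (Fin (d + 1) → ℤ) := insert u (nbrs u) ∪ blockOf b u

/-- `opK(x,·)` vanishes off `opSupp b x`. [folklore] -/
theorem opK_eq_zero_of_not_mem {b : ℕ} (hb : 1 ≤ b) (c₁ msq a : ℂ) {x z : Fin (d + 1) → ℤ} (hz : z ∉ opSupp b x) :
    opK c₁ msq a b x z = 0 := by
  simp only [opSupp, Finset.mem_union, Finset.mem_insert, not_or] at hz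
  obtain ⟨⟨hzx, hzn⟩, hzb⟩ := hz
  have hblk : blk b z ≠ blk b x := fun h => hzb ((mem_blockOf hb).2 h)
  simp [opK, lapK, diagK, avgK, hzx, hzn, hblk]

/-- FOLDING B4's OPERATOR: on the box, the folded lattice operator is the box operator with Neumann boundary
conditions and the box's own block averaging (`foldOp_lapK`, `foldOp_diagK`, `foldOp_avgK`).
[cite: Balaban1983RegularityDecay, p. 584 (2.42)/(2.44), dictionary] [folklore] -/
theorem foldOp_opK {N : Fin (d + 1) → ℕ} (hN : ∀ i, 1 ≤ N i) {b : ℕ} (hb : 1 ≤ b) (hbN : ∀ i, (b : ℤ) ∣ (N i : ℤ))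
    (c₁ msq a : ℂ) {x y : Fin (d + 1) → ℤ} (hx : x ∈ boxDom N) (hy : y ∈ boxDom N) :
    (box N hN).foldOp (opK c₁ msq a b) (opSupp b) x y = opBoxK c₁ msq a b N x y := by
  classical
  have e1 : (box N hN).foldOp (opK c₁ msq a b) (opSupp b) x y
      = c₁ * (box N hN).foldOp lapK (opSupp b) x y
        + ((box N hN).foldOp (diagK msq) (opSupp b) x y + (box N hN).foldOp (avgK a b) (opSupp b) x y) := by
    unfold ImageSystem.foldOp opK
    rw [Finset.sum_add_distrib, Finset.sum_add_distrib, Finset.mul_sum]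
  have s1 : (box N hN).foldOp lapK (opSupp b) x y = (box N hN).foldOp (lapK (R := ℂ)) (fun u => insert u (nbrs u)) x y := by
    apply (box N hN).foldOp_supp_mono
    · exact Finset.subset_union_left
    · intro z _ hz
      simp only [Finset.mem_insert, not_or] at hz
      simp [lapK, hz.1, hz.2]
  have s2 : (box N hN).foldOp (diagK msq) (opSupp b) x y = (box N hN).foldOp (diagK msq) (fun u => {u}) x y := by
    apply (box N hN).foldOp_supp_mono
    · intro z hz
      rw [Finset.mem_singleton] at hz
      subst hz
      exact Finset.mem_union_left _ (Finset.mem_insert_self _ _)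
    · intro z _ hz
      rw [Finset.mem_singleton] at hz
      simp [diagK, hz]
  have s3 : (box N hN).foldOp (avgK a b) (opSupp b) x y = (box N hN).foldOp (avgK a b) (blockOf b) x y := by
    apply (box N hN).foldOp_supp_mono
    · exact Finset.subset_union_right
    · intro z _ hz
      have hblk : blk b z ≠ blk b x := fun h => hz ((mem_blockOf hb).2 h)
      simp [avgK, hblk]
  rw [e1, s1, s2, s3, foldOp_lapK hN hx hy, foldOp_diagK hN msq hx, foldOp_avgK hN hb hbN a hx]
  rfl

/-- **B4 (2.42) with (2.44) — THE MULTIPLE REFLECTION METHOD, kernel-checked.**  Let `G` be a kernel on `ℤ^{d+1}`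
which (i) is a right inverse of B4's lattice operator `D = c₁(-Δ) + msq + a·𝟙[same block]` ("defining the propagator
`G_j`, `φ₀ = G_j f`", (2.44)), (ii) is invariant under the reflection group of the box `Π_μ [0,N_μ)` built of `b`-blocks
(`b ∣ N_μ`), and (iii) decays exponentially.  Then the IMAGE SUM `G_□(x,x') = Σ_{images w of x'} G(x,w)` — the series
(2.42), all terms — is THE two-sided inverse, on the box, of the box operator with Neumann boundary conditions
`c₁(-Δ_□^N) + msq + a·𝟙[same block]`.  [cite: Balaban1983RegularityDecay, p. 584 (2.42), (2.44), dictionary] -/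
theorem greenBox_images {N : Fin (d + 1) → ℕ} (hN : ∀ i, 1 ≤ N i) {b : ℕ} (hb : 1 ≤ b) (hbN : ∀ i, (b : ℤ) ∣ (N i : ℤ))
    (c₁ msq a : ℂ) {G : (Fin (d + 1) → ℤ) → (Fin (d + 1) → ℤ) → ℂ} {κ M : ℝ} (hκ : 0 < κ) (hM : 0 ≤ M)
    (hGdec : ∀ u w, ‖G u w‖ ≤ M * Real.exp (-(κ * supNorm (u - w))))
    (hGsym : ∀ (ε : Fin (d + 1) → Bool) (m u w : Fin (d + 1) → ℤ), G (reflBox N ε m u) (reflBox N ε m w) = G u w)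
    (hGreen : ∀ x x', ∑ z ∈ opSupp b x, opK c₁ msq a b x z * G z x' = if x = x' then 1 else 0) :
    (Matrix.of fun x y : ↥(boxDom N) => opBoxK c₁ msq a b N x.1 y.1)
        * (Matrix.of fun y x' : ↥(boxDom N) => (box N hN).imK G y.1 x'.1) = 1 ∧
      (Matrix.of fun y x' : ↥(boxDom N) => (box N hN).imK G y.1 x'.1)
        * (Matrix.of fun x y : ↥(boxDom N) => opBoxK c₁ msq a b N x.1 y.1) = 1 := by
  classical
  have hF : ∀ y, y ∈ boxDom N ↔ (box N hN).fold y = y := fun y => by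
    rw [box_fold]; exact mem_boxDom_iff_fold hN y
  have hK : ∀ σ ∈ (box N hN).sym, ∀ u w, G (σ u) (σ w) = G u w := by
    intro σ hσ u w
    obtain ⟨ε, m, rfl⟩ := (mem_sym_iff N hN σ).1 hσ
    exact hGsym ε m u w
  have hmat : (Matrix.of fun x y : ↥(boxDom N) => (box N hN).foldOp (opK c₁ msq a b) (opSupp b) x.1 y.1)
      = Matrix.of fun x y : ↥(boxDom N) => opBoxK c₁ msq a b N x.1 y.1 := by
    ext x y
    simp only [Matrix.of_apply]
    exact foldOp_opK hN hb hbN c₁ msq a x.2 y.2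
  have h := (box N hN).foldOp_imK_inverse (boxDom N) hF (opSupp b) hK (summable_fib_box hN hκ hM hGdec) hGreen
  rw [hmat] at h
  exact h

/-- UNIQUENESS: the box operator with Neumann b.c. has exactly one right inverse on the box, the image sum — so
whatever definition of `G_j(□)` the paper intends (the inverse of `-Δ_□^N + m_j² + a_j Q_j^*Q_j` on `L²(□)`), it
equals (2.42).  [cite: Balaban1983RegularityDecay, p. 584 (2.42), dictionary] [folklore] -/
theorem greenBox_unique {N : Fin (d + 1) → ℕ} (hN : ∀ i, 1 ≤ N i) {b : ℕ} (hb : 1 ≤ b) (hbN : ∀ i, (b : ℤ) ∣ (N i : ℤ))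
    (c₁ msq a : ℂ) {G : (Fin (d + 1) → ℤ) → (Fin (d + 1) → ℤ) → ℂ} {κ M : ℝ} (hκ : 0 < κ) (hM : 0 ≤ M)
    (hGdec : ∀ u w, ‖G u w‖ ≤ M * Real.exp (-(κ * supNorm (u - w))))
    (hGsym : ∀ (ε : Fin (d + 1) → Bool) (m u w : Fin (d + 1) → ℤ), G (reflBox N ε m u) (reflBox N ε m w) = G u w)
    (hGreen : ∀ x x', ∑ z ∈ opSupp b x, opK c₁ msq a b x z * G z x' = if x = x' then 1 else 0)
    (GB : Matrix ↥(boxDom N) ↥(boxDom N) ℂ)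
    (hGB : (Matrix.of fun x y : ↥(boxDom N) => opBoxK c₁ msq a b N x.1 y.1) * GB = 1) :
    GB = Matrix.of fun y x' : ↥(boxDom N) => (box N hN).imK G y.1 x'.1 := by
  obtain ⟨_, h2⟩ := greenBox_images hN hb hbN c₁ msq a hκ hM hGdec hGsym hGreen
  calc GB = ((Matrix.of fun y x' : ↥(boxDom N) => (box N hN).imK G y.1 x'.1)
        * (Matrix.of fun x y : ↥(boxDom N) => opBoxK c₁ msq a b N x.1 y.1)) * GB := by rw [h2, Matrix.one_mul]
    _ = _ := by rw [Matrix.mul_assoc, hGB, Matrix.mul_one]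

/-- **"IT IS ENOUGH TO PROVE (2.35) FOR THE PROPAGATOR `G_j`"** (zeroth-order part, uniform in the box): under the
hypotheses of `greenBox_images`, ANY right inverse `G_□` of the Neumann box operator satisfies
`‖G_□(x,x')‖ ≤ 2^{d+1} · M · periodConst κ d · e^{-(κ/(d+1)) |x - x'|_∞}` for all box points, with a constant depending
on `κ, d` only — not on the box.  [cite: Balaban1983RegularityDecay, p. 584 l. 13–14 with (2.35), dictionary] -/
theorem greenBox_decay {N : Fin (d + 1) → ℕ} (hN : ∀ i, 1 ≤ N i) {b : ℕ} (hb : 1 ≤ b) (hbN : ∀ i, (b : ℤ) ∣ (N i : ℤ))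
    (c₁ msq a : ℂ) {G : (Fin (d + 1) → ℤ) → (Fin (d + 1) → ℤ) → ℂ} {κ M : ℝ} (hκ : 0 < κ) (hM : 0 ≤ M)
    (hGdec : ∀ u w, ‖G u w‖ ≤ M * Real.exp (-(κ * supNorm (u - w))))
    (hGsym : ∀ (ε : Fin (d + 1) → Bool) (m u w : Fin (d + 1) → ℤ), G (reflBox N ε m u) (reflBox N ε m w) = G u w)
    (hGreen : ∀ x x', ∑ z ∈ opSupp b x, opK c₁ msq a b x z * G z x' = if x = x' then 1 else 0)
    (GB : Matrix ↥(boxDom N) ↥(boxDom N) ℂ)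
    (hGB : (Matrix.of fun x y : ↥(boxDom N) => opBoxK c₁ msq a b N x.1 y.1) * GB = 1) (x x' : ↥(boxDom N)) :
    ‖GB x x'‖ ≤ 2 ^ (d + 1) * (M * periodConst κ d) * Real.exp (-(κ / (d + 1) * supNorm (x.1 - x'.1))) := by
  rw [greenBox_unique hN hb hbN c₁ msq a hκ hM hGdec hGsym hGreen GB hGB, Matrix.of_apply]
  exact norm_imK_box_le hN hκ hM hGdec x.2 x'.2

/-! ### The printed images and a print slip -/

/-- DICTIONARY FOR THE TWO PRINTED SUMS OF (2.42): in lattice units (`ξ = 1`, `M_μ = N_μ ξ`) the near image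
`x'_μ ↦ -x'_μ - ξ` is `refl1 N true 0` and the far image `x'_μ ↦ 2M_μ - ξ - x'_μ` is `refl1 N true 1`; "`+ …`" are the
remaining `(ε, m)`.  [cite: Balaban1983RegularityDecay, p. 584 (2.42), dictionary] -/
theorem printedImages (N : ℕ) (n : ℤ) : refl1 N true 0 n = -n - 1 ∧ refl1 N true 1 n = 2 * N - 1 - n := by
  simp [refl1Fun]; ring

/-- PRINT SLIP (located, harmless): the far mirror `x ↦ 2M_μ - ξ - x` sits at `M_μ - ξ/2` and swaps the sites
`M_μ - ξ ↔ M_μ`; so in the box printed as CLOSED, `{0 ≤ x_μ ≤ M_μ}`, the sites `M_μ - ξ` and `M_μ` are images of one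
another and the printed image sum would count `x' = M_μ` twice — the closed box is not a fundamental domain of the
printed reflection group.  The consistent reading (used throughout this file, `boxDom`) is the HALF-OPEN box
`{0 ≤ x_μ < M_μ}` "built of unit blocks", for which the printed images are exactly right (`printedImages`,
`mem_boxDom_iff_fold`, `fibParam`).  [cite: Balaban1983RegularityDecay, p. 584 (2.42), reading] -/
theorem printSlip_closedBox (N : ℕ) (hN : 1 ≤ N) :
    refl1 N true 1 ((N : ℤ) - 1) = N ∧ fold1 N N = (N : ℤ) - 1 ∧ (N : ℤ) ∉ Finset.Ico (0 : ℤ) N := by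
  refine ⟨by simp [refl1Fun]; ring, ?_, by simp⟩
  unfold fold1
  have h1 : ((N : ℤ)) % (2 * N : ℤ) = N := Int.emod_eq_of_lt (by omega) (by omega)
  rw [h1]
  simp only [lt_self_iff_false, if_false]
  ring

end B4Display242

/-! ## §5  First-order and Hölder transfer: "(2.35), (2.36) for `G_j` ⇒ the same for `G_j(□)`" beyond zeroth order -/

section Transfer

open Literature.MathematicalPhysics.QuantumFieldTheory.Balaban1983to89.B4ContourShift
open Literature.MathematicalPhysics.QuantumFieldTheory.Balaban1983to89.B4TorusKernel (periodConst)
open Literature.MathematicalPhysics.QuantumFieldTheory.Balaban1983to89.B4TorusKernel.MultiPeriod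

variable {d : ℕ}

/-- FIBRE MAJORANT SUM: over the images `w` of a box point `x'`, `Σ_w M e^{-κ|x-w|_∞}` converges and is at most
`2^{d+1} · M · periodConst κ d · e^{-(κ/(d+1))|x-x'|_∞}` for every box point `x` (the real form of `norm_imK_box_le`).
[folklore] -/
theorem tsum_fib_majorant {N : Fin (d + 1) → ℕ} (hN : ∀ i, 1 ≤ N i) {κ M : ℝ} (hκ : 0 < κ) (hM : 0 ≤ M)
    {x x' : Fin (d + 1) → ℤ} (hx : x ∈ boxDom N) (hx' : x' ∈ boxDom N) :
    Summable (fun w : (box N hN).Fib x' => M * Real.exp (-(κ * supNorm (x - w.1)))) ∧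
      ∑' w : (box N hN).Fib x', M * Real.exp (-(κ * supNorm (x - w.1)))
        ≤ 2 ^ (d + 1) * (M * periodConst κ d) * Real.exp (-(κ / (d + 1) * supNorm (x - x'))) := by
  have hfx' : foldBox N x' = x' := (mem_boxDom_iff_fold hN x').1 hx'
  set K₀ : (Fin (d + 1) → ℤ) → (Fin (d + 1) → ℤ) → ℂ :=
    fun u w => ((M * Real.exp (-(κ * supNorm (u - w))) : ℝ) : ℂ) with hK₀
  have hnorm : ∀ u w, ‖K₀ u w‖ = M * Real.exp (-(κ * supNorm (u - w))) := fun u w => by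
    rw [hK₀, Complex.norm_real, Real.norm_eq_abs, abs_of_nonneg (by positivity)]
  obtain ⟨hs, hb⟩ := summable_norm_images hN hκ hM (fun u w => (hnorm u w).le) x x' (D := supNorm (x - x'))
    (fun ε => supNorm_sub_le_torusSupNorm hx hx' ε)
  simp only [hnorm] at hs hb
  have e : (fun w : (box N hN).Fib x' => M * Real.exp (-(κ * supNorm (x - w.1)))) ∘ (fibParam hN hfx')
      = fun p => M * Real.exp (-(κ * supNorm (x - reflBox N p.1 p.2 x'))) := by
    funext p; simp only [Function.comp_apply, fibParam_apply_coe]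
  refine ⟨(Equiv.summable_iff (fibParam hN hfx')).1 (e ▸ hs), ?_⟩
  rw [← (fibParam hN hfx').tsum_eq (fun w : (box N hN).Fib x' => M * Real.exp (-(κ * supNorm (x - w.1))))]
  simp only [fibParam_apply_coe]
  exact hb

/-- **FIRST-ORDER TRANSFER** ("(2.35) for `∂^ξ_μ G_j` ⇒ (2.35) for `∂^ξ_μ G_j(□)`", uniform in the box): if in addition the
lattice difference `G(u+e,w) - G(u,w)` (`e` any lattice vector, e.g. `±e_μ`) obeys `≤ M₁ e^{-κ|u-w|_∞}`, then for box points
`x, x+e, x'` the box propagator satisfies `‖G_□(x+e,x') - G_□(x,x')‖ ≤ 2^{d+1}·M₁·periodConst κ d·e^{-(κ/(d+1))|x-x'|_∞}` —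
the image sum is differenced term by term.  [cite: Balaban1983RegularityDecay, p. 584 l. 13–14 with (2.35), dictionary]
-/
theorem greenBox_deriv_decay {N : Fin (d + 1) → ℕ} (hN : ∀ i, 1 ≤ N i) {b : ℕ} (hb : 1 ≤ b)
    (hbN : ∀ i, (b : ℤ) ∣ (N i : ℤ)) (c₁ msq a : ℂ) {G : (Fin (d + 1) → ℤ) → (Fin (d + 1) → ℤ) → ℂ} {κ M M₁ : ℝ}
    (hκ : 0 < κ) (hM : 0 ≤ M) (hM₁ : 0 ≤ M₁)
    (hGdec : ∀ u w, ‖G u w‖ ≤ M * Real.exp (-(κ * supNorm (u - w))))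
    (hGsym : ∀ (ε : Fin (d + 1) → Bool) (m u w : Fin (d + 1) → ℤ), G (reflBox N ε m u) (reflBox N ε m w) = G u w)
    (hGreen : ∀ x x', ∑ z ∈ opSupp b x, opK c₁ msq a b x z * G z x' = if x = x' then 1 else 0)
    (e : Fin (d + 1) → ℤ) (hGder : ∀ u w, ‖G (u + e) w - G u w‖ ≤ M₁ * Real.exp (-(κ * supNorm (u - w))))
    (GB : Matrix ↥(boxDom N) ↥(boxDom N) ℂ)
    (hGB : (Matrix.of fun x y : ↥(boxDom N) => opBoxK c₁ msq a b N x.1 y.1) * GB = 1)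
    (x xe x' : ↥(boxDom N)) (hxe : xe.1 = x.1 + e) :
    ‖GB xe x' - GB x x'‖ ≤ 2 ^ (d + 1) * (M₁ * periodConst κ d) * Real.exp (-(κ / (d + 1) * supNorm (x.1 - x'.1))) := by
  rw [greenBox_unique hN hb hbN c₁ msq a hκ hM hGdec hGsym hGreen GB hGB]
  simp only [Matrix.of_apply]
  have hs1 := summable_fib_box hN hκ hM hGdec xe.1 x'.1
  have hs2 := summable_fib_box hN hκ hM hGdec x.1 x'.1
  unfold ImageSystem.imK
  rw [← hs1.tsum_sub hs2, hxe]
  have h := norm_imK_box_le hN hκ hM₁ (K := fun u w => G (u + e) w - G u w) hGder x.2 x'.2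
  unfold ImageSystem.imK at h
  exact h

/-- **HÖLDER TRANSFER** ("(2.36) for `G_j` ⇒ (2.36) for `G_j(□)`"): if the lattice difference kernel
`K'(u,w) = G(u+e,w) - G(u,w)` obeys `‖K'(u,w) - K'(u',w)‖ ≤ H(u,u')·(e^{-κ|u-w|_∞} + e^{-κ|u'-w|_∞})` (B4: `H = c₁|u-u'|^α`),
then for box points `x, x+e, y, y+e, x'`:
`‖(G_□(x+e,x') - G_□(x,x')) - (G_□(y+e,x') - G_□(y,x'))‖ ≤ H(x,y)·2^{d+1}·periodConst κ d·(e^{-κ'|x-x'|_∞} + e^{-κ'|y-x'|_∞})`,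
`κ' = κ/(d+1)` — and `e^{-κ'a} + e^{-κ'b} ≤ 2e^{-κ' min(a,b)} = 2e^{-κ' dist({x,y},x')}` is the printed form.
[cite: Balaban1983RegularityDecay, p. 584 l. 13–14 with (2.36), dictionary] -/
theorem greenBox_holder_decay {N : Fin (d + 1) → ℕ} (hN : ∀ i, 1 ≤ N i) {b : ℕ} (hb : 1 ≤ b)
    (hbN : ∀ i, (b : ℤ) ∣ (N i : ℤ)) (c₁ msq a : ℂ) {G : (Fin (d + 1) → ℤ) → (Fin (d + 1) → ℤ) → ℂ} {κ M : ℝ}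
    (hκ : 0 < κ) (hM : 0 ≤ M)
    (hGdec : ∀ u w, ‖G u w‖ ≤ M * Real.exp (-(κ * supNorm (u - w))))
    (hGsym : ∀ (ε : Fin (d + 1) → Bool) (m u w : Fin (d + 1) → ℤ), G (reflBox N ε m u) (reflBox N ε m w) = G u w)
    (hGreen : ∀ x x', ∑ z ∈ opSupp b x, opK c₁ msq a b x z * G z x' = if x = x' then 1 else 0)
    (e : Fin (d + 1) → ℤ) (H : (Fin (d + 1) → ℤ) → (Fin (d + 1) → ℤ) → ℝ) (hH : ∀ u u', 0 ≤ H u u')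
    (hGhol : ∀ u u' w, ‖(G (u + e) w - G u w) - (G (u' + e) w - G u' w)‖
      ≤ H u u' * (Real.exp (-(κ * supNorm (u - w))) + Real.exp (-(κ * supNorm (u' - w)))))
    (GB : Matrix ↥(boxDom N) ↥(boxDom N) ℂ)
    (hGB : (Matrix.of fun x y : ↥(boxDom N) => opBoxK c₁ msq a b N x.1 y.1) * GB = 1)
    (x xe y ye x' : ↥(boxDom N)) (hxe : xe.1 = x.1 + e) (hye : ye.1 = y.1 + e) :
    ‖(GB xe x' - GB x x') - (GB ye x' - GB y x')‖
      ≤ H x.1 y.1 * (2 ^ (d + 1) * periodConst κ d)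
        * (Real.exp (-(κ / (d + 1) * supNorm (x.1 - x'.1))) + Real.exp (-(κ / (d + 1) * supNorm (y.1 - x'.1)))) := by
  rw [greenBox_unique hN hb hbN c₁ msq a hκ hM hGdec hGsym hGreen GB hGB]
  simp only [Matrix.of_apply]
  have hs1 := summable_fib_box hN hκ hM hGdec xe.1 x'.1
  have hs2 := summable_fib_box hN hκ hM hGdec x.1 x'.1
  have hs3 := summable_fib_box hN hκ hM hGdec ye.1 x'.1
  have hs4 := summable_fib_box hN hκ hM hGdec y.1 x'.1
  unfold ImageSystem.imK
  rw [← hs1.tsum_sub hs2, ← hs3.tsum_sub hs4, ← (hs1.sub hs2).tsum_sub (hs3.sub hs4), hxe, hye]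
  -- the summand and its majorant
  set F : (box N hN).Fib x'.1 → ℂ := fun w => (G (x.1 + e) w.1 - G x.1 w.1) - (G (y.1 + e) w.1 - G y.1 w.1) with hF
  set mx : (box N hN).Fib x'.1 → ℝ := fun w => H x.1 y.1 * Real.exp (-(κ * supNorm (x.1 - w.1))) with hmx
  set my : (box N hN).Fib x'.1 → ℝ := fun w => H x.1 y.1 * Real.exp (-(κ * supNorm (y.1 - w.1))) with hmy
  obtain ⟨hmxs, hmxb⟩ := tsum_fib_majorant hN hκ (hH x.1 y.1) x.2 x'.2
  obtain ⟨hmys, hmyb⟩ := tsum_fib_majorant hN hκ (hH x.1 y.1) y.2 x'.2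
  have hle : ∀ w, ‖F w‖ ≤ mx w + my w := fun w => by
    rw [hF, hmx, hmy]; simp only []
    rw [← mul_add]; exact hGhol _ _ _
  have hFn : Summable (fun w => ‖F w‖) :=
    Summable.of_nonneg_of_le (fun w => norm_nonneg _) hle (hmxs.add hmys)
  show ‖∑' w, F w‖ ≤ _
  calc ‖∑' w, F w‖ ≤ ∑' w, ‖F w‖ := norm_tsum_le_tsum_norm hFn
    _ ≤ ∑' w, (mx w + my w) := Summable.tsum_le_tsum hle hFn (hmxs.add hmys)
    _ = ∑' w, mx w + ∑' w, my w := hmxs.tsum_add hmys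
    _ ≤ 2 ^ (d + 1) * (H x.1 y.1 * periodConst κ d) * Real.exp (-(κ / (d + 1) * supNorm (x.1 - x'.1)))
        + 2 ^ (d + 1) * (H x.1 y.1 * periodConst κ d) * Real.exp (-(κ / (d + 1) * supNorm (y.1 - x'.1))) :=
          add_le_add hmxb hmyb
    _ = _ := by ring

end Transfer

/-! ## §6  The uniform constant: image sums with `C = 2^{d+1} Π_μ (1 + 2/(1 - e^{-2κ'N_μ}))`, bounded when `κ'N_μ ≥ c`
(B4's regime `κ = δ₀ξ → 0`, `κN_μ = δ₀M_μ ≥ δ₀`: constants uniform in the lattice spacing) -/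

section UniformConstant

open Literature.MathematicalPhysics.QuantumFieldTheory.Balaban1983to89.B4ContourShift
open Literature.MathematicalPhysics.QuantumFieldTheory.Balaban1983to89.B4TorusKernel
  (periodConst summable_prod_pi exp_supNorm_le_prod)
open Literature.MathematicalPhysics.QuantumFieldTheory.Balaban1983to89.B4TorusKernel.MultiPeriod

variable {d : ℕ}

/-- `Σ_{j ∈ ℤ} ρ^{(|j|-1)⁺}` converges for `0 ≤ ρ < 1` and is at most `1 + 2/(1-ρ)` (the terms `j = 0, ±1` are `1`).
[folklore] -/
theorem summable_geometric_int_pred {ρ : ℝ} (h0 : 0 ≤ ρ) (h1 : ρ < 1) :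
    Summable (fun j : ℤ => ρ ^ (j.natAbs - 1)) ∧ ∑' j : ℤ, ρ ^ (j.natAbs - 1) ≤ 1 + 2 / (1 - ρ) := by
  set f : ℤ → ℝ := fun j => ρ ^ (j.natAbs - 1) with hf
  have hg := summable_geometric_of_lt_one h0 h1
  have hnat : (fun n : ℕ => f n) = fun n => ρ ^ (n - 1) := by
    funext n; simp only [hf, Int.natAbs_natCast]
  have hneg1 : (fun n : ℕ => f (-(n + 1 : ℤ))) = fun n => ρ ^ n := by
    funext n
    simp only [hf]
    congr 1
  have hshift : Summable fun n : ℕ => ρ ^ (n - 1) := by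
    refine (summable_nat_add_iff (f := fun n : ℕ => ρ ^ (n - 1)) 1).mp ?_
    simp only [Nat.add_sub_cancel]
    exact hg
  have h1' : Summable fun n : ℕ => f n := by rw [hnat]; exact hshift
  have h3 : Summable fun n : ℕ => f (-(n + 1 : ℤ)) := by rw [hneg1]; exact hg
  have hs : Summable f := Summable.of_nat_of_neg_add_one h1' h3
  refine ⟨hs, ?_⟩
  rw [tsum_of_nat_of_neg_add_one (f := f) h1' h3, hnat, hneg1, tsum_geometric_of_lt_one h0 h1,
    hshift.tsum_eq_zero_add]
  simp only [Nat.add_sub_cancel, Nat.zero_sub, pow_zero]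
  rw [tsum_geometric_of_lt_one h0 h1]
  have hpos : 0 < 1 - ρ := by linarith
  rw [div_eq_mul_inv, two_mul]
  linarith

/-- THE INTEGER INEQUALITY: for `x, x' ∈ [0, N)` every image of `x'` other than the three nearest is far:
`|x - r_{ε,j}(x')| ≥ |x - x'| + 2N(|j| - 1)⁺` (both progressions have step `2N` and distance `≥ |x - x'|` from `x`).
[folklore] -/
theorem abs_sub_refl1_ge {N : ℕ} (hN : 1 ≤ N) {x x' : ℤ} (hx : 0 ≤ x ∧ x < N) (hx' : 0 ≤ x' ∧ x' < N)
    (b : Bool) (j : ℤ) :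
    |x - x'| + 2 * (N : ℤ) * ((j.natAbs - 1 : ℕ) : ℤ) ≤ |x - refl1Fun N b j x'| := by
  have hf : refl1Fun N false j x' = x' + 2 * N * j := rfl
  have ht : refl1Fun N true j x' = 2 * N * j - 1 - x' := rfl
  -- linear facts about the nonlinear atoms `N * j` and `N * (|j| - 1)⁺`, keyed on the sign of `j`
  have F1 : 1 ≤ j → (N : ℤ) ≤ N * j := fun hj => by nlinarith
  have F2 : j ≤ -1 → (N : ℤ) * j ≤ -N := fun hj => by nlinarith
  have F3 : j = 0 → (N : ℤ) * j = 0 := fun hj => by subst hj; simp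
  have F6 : j = 0 → (N : ℤ) * ((j.natAbs - 1 : ℕ) : ℤ) = 0 := fun hj => by subst hj; simp
  have F7 : 1 ≤ j → (N : ℤ) * ((j.natAbs - 1 : ℕ) : ℤ) = N * j - N := fun hj => by
    have h1 : 1 ≤ j.natAbs := by omega
    rw [Nat.cast_sub h1, Nat.cast_one, Int.natCast_natAbs, abs_of_pos (by omega)]; ring
  have F8 : j ≤ -1 → (N : ℤ) * ((j.natAbs - 1 : ℕ) : ℤ) = -(N * j) - N := fun hj => by
    have h1 : 1 ≤ j.natAbs := by omega
    rw [Nat.cast_sub h1, Nat.cast_one, Int.natCast_natAbs, abs_of_neg (by omega)]; ring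
  have e2 : 2 * (N : ℤ) * ((j.natAbs - 1 : ℕ) : ℤ) = 2 * ((N : ℤ) * ((j.natAbs - 1 : ℕ) : ℤ)) := by ring
  rw [e2]
  generalize (N : ℤ) * ((j.natAbs - 1 : ℕ) : ℤ) = R at F6 F7 F8
  cases b
  · rw [hf, show x - (x' + 2 * (N : ℤ) * j) = (x - x') - 2 * ((N : ℤ) * j) by ring, abs_eq_max_neg, abs_eq_max_neg]
    generalize (N : ℤ) * j = P at F1 F2 F3 F7 F8
    rcases lt_trichotomy j 0 with hj | hj | hj
    · have := F2 (by omega); have := F8 (by omega); omega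
    · have := F3 hj; have := F6 hj; omega
    · have := F1 (by omega); have := F7 (by omega); omega
  · rw [ht, show x - (2 * (N : ℤ) * j - 1 - x') = (x + x' + 1) - 2 * ((N : ℤ) * j) by ring, abs_eq_max_neg,
      abs_eq_max_neg]
    generalize (N : ℤ) * j = P at F1 F2 F3 F7 F8
    rcases lt_trichotomy j 0 with hj | hj | hj
    · have := F2 (by omega); have := F8 (by omega); omega
    · have := F3 hj; have := F6 hj; omega
    · have := F1 (by omega); have := F7 (by omega); omega

/-- the exponential form: `e^{-κ'|x - r_{ε,j}(x')|} ≤ e^{-κ'|x - x'|} ρ^{(|j|-1)⁺}`, `ρ = e^{-2κ'N}`. [folklore] -/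
theorem exp_refl1_le {N : ℕ} (hN : 1 ≤ N) {κ' : ℝ} (hκ : 0 ≤ κ') {x x' : ℤ} (hx : 0 ≤ x ∧ x < N)
    (hx' : 0 ≤ x' ∧ x' < N) (b : Bool) (j : ℤ) :
    Real.exp (-(κ' * |((x - refl1Fun N b j x' : ℤ) : ℝ)|))
      ≤ Real.exp (-(κ' * |((x - x' : ℤ) : ℝ)|)) * Real.exp (-(2 * κ' * N)) ^ (j.natAbs - 1) := by
  rw [← Real.exp_nat_mul, ← Real.exp_add]
  apply Real.exp_le_exp.mpr
  have h := abs_sub_refl1_ge hN hx hx' b j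
  have h' : |((x - x' : ℤ) : ℝ)| + 2 * (N : ℝ) * ((j.natAbs - 1 : ℕ) : ℝ) ≤ |((x - refl1Fun N b j x' : ℤ) : ℝ)| := by
    rw [← Int.cast_abs, ← Int.cast_abs]
    exact_mod_cast h
  have h2 := mul_le_mul_of_nonneg_left h' hκ
  nlinarith [h2]

/-- THE 1-D IMAGE SUM: `Σ_{j ∈ ℤ} e^{-κ'|x - r_{ε,j}(x')|} ≤ (1 + 2/(1 - e^{-2κ'N})) e^{-κ'|x - x'|}` for `x, x' ∈ [0,N)` —
constant bounded when `κ'N` is bounded below. [folklore] -/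
theorem tsum_exp_refl1_le {N : ℕ} (hN : 1 ≤ N) {κ' : ℝ} (hκ : 0 < κ') {x x' : ℤ} (hx : 0 ≤ x ∧ x < N)
    (hx' : 0 ≤ x' ∧ x' < N) (b : Bool) :
    Summable (fun j : ℤ => Real.exp (-(κ' * |((x - refl1Fun N b j x' : ℤ) : ℝ)|))) ∧
      ∑' j : ℤ, Real.exp (-(κ' * |((x - refl1Fun N b j x' : ℤ) : ℝ)|))
        ≤ (1 + 2 / (1 - Real.exp (-(2 * κ' * N)))) * Real.exp (-(κ' * |((x - x' : ℤ) : ℝ)|)) := by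
  set ρ := Real.exp (-(2 * κ' * N)) with hρ
  have hρ0 : 0 ≤ ρ := (Real.exp_pos _).le
  have hN' : (1 : ℝ) ≤ N := by exact_mod_cast hN
  have hρ1 : ρ < 1 := Real.exp_lt_one_iff.mpr (by nlinarith)
  obtain ⟨hgs, hgle⟩ := summable_geometric_int_pred hρ0 hρ1
  set t := Real.exp (-(κ' * |((x - x' : ℤ) : ℝ)|)) with ht
  have hle : ∀ j : ℤ, Real.exp (-(κ' * |((x - refl1Fun N b j x' : ℤ) : ℝ)|)) ≤ t * ρ ^ (j.natAbs - 1) :=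
    fun j => exp_refl1_le hN hκ.le hx hx' b j
  have hmaj : Summable (fun j : ℤ => t * ρ ^ (j.natAbs - 1)) := hgs.mul_left t
  have hs : Summable (fun j : ℤ => Real.exp (-(κ' * |((x - refl1Fun N b j x' : ℤ) : ℝ)|))) :=
    Summable.of_nonneg_of_le (fun j => (Real.exp_pos _).le) hle hmaj
  refine ⟨hs, ?_⟩
  calc ∑' j : ℤ, Real.exp (-(κ' * |((x - refl1Fun N b j x' : ℤ) : ℝ)|)) ≤ ∑' j : ℤ, t * ρ ^ (j.natAbs - 1) :=
        Summable.tsum_le_tsum hle hs hmaj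
    _ = t * ∑' j : ℤ, ρ ^ (j.natAbs - 1) := tsum_mul_left
    _ ≤ t * (1 + 2 / (1 - ρ)) := mul_le_mul_of_nonneg_left hgle (Real.exp_pos _).le
    _ = (1 + 2 / (1 - ρ)) * t := mul_comm _ _

/-- THE UNIFORM BOX CONSTANT `C(κ, d, N) = 2^{d+1} Π_μ (1 + 2/(1 - e^{-2κ'N_μ}))`, `κ' = κ/(d+1)`. [folklore] -/
noncomputable def boxConst (κ : ℝ) (d : ℕ) (N : Fin (d + 1) → ℕ) : ℝ :=
  2 ^ (d + 1) * ∏ i, (1 + 2 / (1 - Real.exp (-(2 * (κ / (d + 1)) * N i))))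

/-- the 1-D factor is positive. [folklore] -/
theorem one_add_two_div_pos {κ' : ℝ} (hκ : 0 < κ') {N : ℕ} (hN : 1 ≤ N) :
    0 < 1 + 2 / (1 - Real.exp (-(2 * κ' * N))) := by
  have hN' : (1 : ℝ) ≤ N := by exact_mod_cast hN
  have : Real.exp (-(2 * κ' * N)) < 1 := Real.exp_lt_one_iff.mpr (by nlinarith)
  have : 0 < 1 - Real.exp (-(2 * κ' * N)) := by linarith
  positivity

/-- `0 ≤ boxConst κ d N`. [folklore] -/
theorem boxConst_nonneg {κ : ℝ} (hκ : 0 < κ) {N : Fin (d + 1) → ℕ} (hN : ∀ i, 1 ≤ N i) : 0 ≤ boxConst κ d N := by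
  unfold boxConst
  have hκ' : 0 < κ / (d + 1) := div_pos hκ (by positivity)
  exact mul_nonneg (by positivity) (Finset.prod_nonneg fun i _ => (one_add_two_div_pos hκ' (hN i)).le)

/-- UNIFORMITY: if `(κ/(d+1))·N_μ ≥ c > 0` for every `μ` (B4: `κ N_μ = δ₀ M_μ ≥ δ₀`, boxes at least one unit block wide),
then `boxConst κ d N ≤ 2^{d+1}(1 + 2/(1 - e^{-2c}))^{d+1}` — independent of `κ`, `N`, i.e. of the lattice spacing.
[folklore] -/
theorem boxConst_le {κ c : ℝ} (hκ : 0 < κ) (hc : 0 < c) {N : Fin (d + 1) → ℕ} (hN : ∀ i, 1 ≤ N i)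
    (hcN : ∀ i, c ≤ κ / (d + 1) * N i) :
    boxConst κ d N ≤ 2 ^ (d + 1) * (1 + 2 / (1 - Real.exp (-(2 * c)))) ^ (d + 1) := by
  unfold boxConst
  apply mul_le_mul_of_nonneg_left _ (by positivity)
  have hκ' : 0 < κ / (d + 1) := div_pos hκ (by positivity)
  have hc1 : Real.exp (-(2 * c)) < 1 := Real.exp_lt_one_iff.mpr (by linarith)
  calc ∏ i, (1 + 2 / (1 - Real.exp (-(2 * (κ / (d + 1)) * N i))))
      ≤ ∏ _i : Fin (d + 1), (1 + 2 / (1 - Real.exp (-(2 * c)))) := by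
        refine Finset.prod_le_prod (fun i _ => (one_add_two_div_pos hκ' (hN i)).le) (fun i _ => ?_)
        have hle : Real.exp (-(2 * (κ / (d + 1)) * N i)) ≤ Real.exp (-(2 * c)) :=
          Real.exp_le_exp.mpr (by nlinarith [hcN i])
        have hpos : 0 < 1 - Real.exp (-(2 * c)) := by linarith
        have hle' : 1 - Real.exp (-(2 * c)) ≤ 1 - Real.exp (-(2 * (κ / (d + 1)) * N i)) := by linarith
        have := div_le_div_of_nonneg_left (by norm_num : (0 : ℝ) ≤ 2) hpos hle'
        linarith
    _ = (1 + 2 / (1 - Real.exp (-(2 * c)))) ^ (d + 1) := by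
        rw [Finset.prod_const, Finset.card_univ, Fintype.card_fin]

/-- ONE REFLECTION PATTERN, UNIFORM CONSTANT: for box points `x, x'` and fixed `ε`,
`Σ_m e^{-κ|x - r_{ε,m}(x')|_∞} ≤ Π_μ(1 + 2/(1 - e^{-2κ'N_μ})) · e^{-κ'|x - x'|_∞}` (factorise with
`e^{-κ|y|_∞} ≤ Π_μ e^{-κ'|y_μ|}`, Fubini `summable_prod_pi`, the 1-D sums, and `|x - x'|_∞ ≤ Σ_μ |x_μ - x'_μ|`).
[folklore] -/
theorem tsum_exp_reflBox_unif {N : Fin (d + 1) → ℕ} (hN : ∀ i, 1 ≤ N i) {κ : ℝ} (hκ : 0 < κ)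
    {x x' : Fin (d + 1) → ℤ} (hx : x ∈ boxDom N) (hx' : x' ∈ boxDom N) (ε : Fin (d + 1) → Bool) :
    Summable (fun m : Fin (d + 1) → ℤ => Real.exp (-(κ * supNorm (x - reflBox N ε m x')))) ∧
      ∑' m : Fin (d + 1) → ℤ, Real.exp (-(κ * supNorm (x - reflBox N ε m x')))
        ≤ (∏ i, (1 + 2 / (1 - Real.exp (-(2 * (κ / (d + 1)) * N i)))))
          * Real.exp (-(κ / (d + 1) * supNorm (x - x'))) := by
  have hκ'pos : 0 < κ / (d + 1) := div_pos hκ (by positivity)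
  rw [mem_boxDom] at hx hx'
  have h0 : ∀ (i : Fin (d + 1)) (j : ℤ),
      0 ≤ Real.exp (-(κ / (d + 1) * |((x i - refl1Fun (N i) (ε i) j (x' i) : ℤ) : ℝ)|)) :=
    fun i j => (Real.exp_pos _).le
  have h1 := fun i => tsum_exp_refl1_le (hN i) hκ'pos (hx i) (hx' i) (ε i)
  obtain ⟨hps, hpe⟩ := summable_prod_pi
    (fun i j => Real.exp (-(κ / (d + 1) * |((x i - refl1Fun (N i) (ε i) j (x' i) : ℤ) : ℝ)|))) h0
    (fun i => (h1 i).1)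
  have hterm : ∀ m : Fin (d + 1) → ℤ, Real.exp (-(κ * supNorm (x - reflBox N ε m x')))
      ≤ ∏ i, Real.exp (-(κ / (d + 1) * |((x i - refl1Fun (N i) (ε i) (m i) (x' i) : ℤ) : ℝ)|)) := by
    intro m
    refine le_trans (exp_supNorm_le_prod hκ.le (x - reflBox N ε m x')) (le_of_eq ?_)
    refine Finset.prod_congr rfl (fun i _ => ?_)
    simp only [Pi.sub_apply, reflBox_apply]
  have hs : Summable (fun m : Fin (d + 1) → ℤ => Real.exp (-(κ * supNorm (x - reflBox N ε m x')))) :=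
    Summable.of_nonneg_of_le (fun m => (Real.exp_pos _).le) hterm hps
  refine ⟨hs, ?_⟩
  have hsum : supNorm (x - x') ≤ ∑ i, |((x i - x' i : ℤ) : ℝ)| := by
    obtain ⟨i, hi⟩ := exists_supNorm_eq (x - x')
    rw [hi]
    have e : ((|(x - x') i| : ℤ) : ℝ) = |((x i - x' i : ℤ) : ℝ)| := by simp [Int.cast_abs, Pi.sub_apply]
    rw [e]
    exact Finset.single_le_sum (f := fun i => |((x i - x' i : ℤ) : ℝ)|) (fun i _ => abs_nonneg _)
      (Finset.mem_univ i)
  calc ∑' m : Fin (d + 1) → ℤ, Real.exp (-(κ * supNorm (x - reflBox N ε m x')))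
      ≤ ∑' m : Fin (d + 1) → ℤ,
          ∏ i, Real.exp (-(κ / (d + 1) * |((x i - refl1Fun (N i) (ε i) (m i) (x' i) : ℤ) : ℝ)|)) :=
        Summable.tsum_le_tsum hterm hs hps
    _ = ∏ i, ∑' j : ℤ, Real.exp (-(κ / (d + 1) * |((x i - refl1Fun (N i) (ε i) j (x' i) : ℤ) : ℝ)|)) := hpe
    _ ≤ ∏ i, ((1 + 2 / (1 - Real.exp (-(2 * (κ / (d + 1)) * N i))))
          * Real.exp (-(κ / (d + 1) * |((x i - x' i : ℤ) : ℝ)|))) :=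
        Finset.prod_le_prod (fun i _ => tsum_nonneg (h0 i)) (fun i _ => (h1 i).2)
    _ = (∏ i, (1 + 2 / (1 - Real.exp (-(2 * (κ / (d + 1)) * N i)))))
          * ∏ i, Real.exp (-(κ / (d + 1) * |((x i - x' i : ℤ) : ℝ)|)) := Finset.prod_mul_distrib
    _ ≤ (∏ i, (1 + 2 / (1 - Real.exp (-(2 * (κ / (d + 1)) * N i)))))
          * Real.exp (-(κ / (d + 1) * supNorm (x - x'))) := by
        apply mul_le_mul_of_nonneg_left _ (Finset.prod_nonneg fun i _ => (one_add_two_div_pos hκ'pos (hN i)).le)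
        rw [← Real.exp_sum]
        apply Real.exp_le_exp.mpr
        rw [Finset.sum_neg_distrib, ← Finset.mul_sum, neg_le_neg_iff]
        exact mul_le_mul_of_nonneg_left hsum hκ'pos.le

/-- ALL IMAGES, UNIFORM CONSTANT: `Σ_{(ε,m)} ‖K(x, r_{ε,m}(x'))‖ ≤ M · boxConst κ d N · e^{-κ'|x - x'|_∞}` for box points.
[folklore] -/
theorem summable_norm_images_unif {N : Fin (d + 1) → ℕ} (hN : ∀ i, 1 ≤ N i)
    {K : (Fin (d + 1) → ℤ) → (Fin (d + 1) → ℤ) → ℂ} {κ M : ℝ} (hκ : 0 < κ) (hM : 0 ≤ M)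
    (hK : ∀ u w, ‖K u w‖ ≤ M * Real.exp (-(κ * supNorm (u - w))))
    {x x' : Fin (d + 1) → ℤ} (hx : x ∈ boxDom N) (hx' : x' ∈ boxDom N) :
    Summable (fun p : (Fin (d + 1) → Bool) × (Fin (d + 1) → ℤ) => ‖K x (reflBox N p.1 p.2 x')‖) ∧
      ∑' p : (Fin (d + 1) → Bool) × (Fin (d + 1) → ℤ), ‖K x (reflBox N p.1 p.2 x')‖
        ≤ M * boxConst κ d N * Real.exp (-(κ / (d + 1) * supNorm (x - x'))) := by
  set P : ℝ := ∏ i, (1 + 2 / (1 - Real.exp (-(2 * (κ / (d + 1)) * N i)))) with hP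
  have hone : ∀ ε, Summable (fun m : Fin (d + 1) → ℤ => ‖K x (reflBox N ε m x')‖) ∧
      ∑' m : Fin (d + 1) → ℤ, ‖K x (reflBox N ε m x')‖ ≤ M * P * Real.exp (-(κ / (d + 1) * supNorm (x - x'))) := by
    intro ε
    obtain ⟨hs, hb⟩ := tsum_exp_reflBox_unif hN hκ hx hx' ε
    have hle : ∀ m : Fin (d + 1) → ℤ,
        ‖K x (reflBox N ε m x')‖ ≤ M * Real.exp (-(κ * supNorm (x - reflBox N ε m x'))) := fun m => hK _ _
    have hmaj : Summable (fun m : Fin (d + 1) → ℤ => M * Real.exp (-(κ * supNorm (x - reflBox N ε m x')))) :=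
      hs.mul_left M
    have hs' : Summable (fun m : Fin (d + 1) → ℤ => ‖K x (reflBox N ε m x')‖) :=
      Summable.of_nonneg_of_le (fun m => norm_nonneg _) hle hmaj
    refine ⟨hs', ?_⟩
    calc ∑' m : Fin (d + 1) → ℤ, ‖K x (reflBox N ε m x')‖
        ≤ ∑' m : Fin (d + 1) → ℤ, M * Real.exp (-(κ * supNorm (x - reflBox N ε m x'))) :=
          Summable.tsum_le_tsum hle hs' hmaj
      _ = M * ∑' m : Fin (d + 1) → ℤ, Real.exp (-(κ * supNorm (x - reflBox N ε m x'))) := tsum_mul_left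
      _ ≤ M * (P * Real.exp (-(κ / (d + 1) * supNorm (x - x')))) := mul_le_mul_of_nonneg_left hb hM
      _ = M * P * Real.exp (-(κ / (d + 1) * supNorm (x - x'))) := by ring
  have hprod : Summable (fun p : (Fin (d + 1) → Bool) × (Fin (d + 1) → ℤ) => ‖K x (reflBox N p.1 p.2 x')‖) := by
    refine (summable_prod_of_nonneg fun p => norm_nonneg _).2 ⟨fun ε => (hone ε).1, ?_⟩
    exact Summable.of_finite
  refine ⟨hprod, ?_⟩
  rw [hprod.tsum_prod' (fun ε => (hone ε).1), tsum_fintype]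
  calc ∑ ε : Fin (d + 1) → Bool, ∑' m : Fin (d + 1) → ℤ, ‖K x (reflBox N ε m x')‖
      ≤ ∑ ε : Fin (d + 1) → Bool, M * P * Real.exp (-(κ / (d + 1) * supNorm (x - x'))) :=
        Finset.sum_le_sum fun ε _ => (hone ε).2
    _ = M * boxConst κ d N * Real.exp (-(κ / (d + 1) * supNorm (x - x'))) := by
        rw [Finset.sum_const, Finset.card_univ, Fintype.card_fun, Fintype.card_bool, Fintype.card_fin, nsmul_eq_mul,
          boxConst, ← hP]
        push_cast
        ring

/-- IMAGE KERNEL DECAY WITH THE UNIFORM CONSTANT: `‖K_□(x, x')‖ ≤ M · boxConst κ d N · e^{-(κ/(d+1))|x - x'|_∞}` for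
box points — with `boxConst_le` this is B4's uniformity in the lattice spacing. [folklore] -/
theorem norm_imK_box_le_unif {N : Fin (d + 1) → ℕ} (hN : ∀ i, 1 ≤ N i)
    {K : (Fin (d + 1) → ℤ) → (Fin (d + 1) → ℤ) → ℂ} {κ M : ℝ} (hκ : 0 < κ) (hM : 0 ≤ M)
    (hK : ∀ u w, ‖K u w‖ ≤ M * Real.exp (-(κ * supNorm (u - w))))
    {x x' : Fin (d + 1) → ℤ} (hx : x ∈ boxDom N) (hx' : x' ∈ boxDom N) :
    ‖(box N hN).imK K x x'‖ ≤ M * boxConst κ d N * Real.exp (-(κ / (d + 1) * supNorm (x - x'))) := by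
  have hfx' : foldBox N x' = x' := (mem_boxDom_iff_fold hN x').1 hx'
  obtain ⟨hs, hb⟩ := summable_norm_images_unif hN hκ hM hK hx hx'
  refine le_trans ?_ hb
  unfold ImageSystem.imK
  rw [← (fibParam hN hfx').tsum_eq (fun w : (box N hN).Fib x' => K x w.1)]
  simp only [fibParam_apply_coe]
  exact norm_tsum_le_tsum_norm hs

/-- the real majorant sum over a fibre with the uniform constant. [folklore] -/
theorem tsum_fib_majorant_unif {N : Fin (d + 1) → ℕ} (hN : ∀ i, 1 ≤ N i) {κ M : ℝ} (hκ : 0 < κ) (hM : 0 ≤ M)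
    {x x' : Fin (d + 1) → ℤ} (hx : x ∈ boxDom N) (hx' : x' ∈ boxDom N) :
    Summable (fun w : (box N hN).Fib x' => M * Real.exp (-(κ * supNorm (x - w.1)))) ∧
      ∑' w : (box N hN).Fib x', M * Real.exp (-(κ * supNorm (x - w.1)))
        ≤ M * boxConst κ d N * Real.exp (-(κ / (d + 1) * supNorm (x - x'))) := by
  have hfx' : foldBox N x' = x' := (mem_boxDom_iff_fold hN x').1 hx'
  set K₀ : (Fin (d + 1) → ℤ) → (Fin (d + 1) → ℤ) → ℂ :=
    fun u w => ((M * Real.exp (-(κ * supNorm (u - w))) : ℝ) : ℂ) with hK₀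
  have hnorm : ∀ u w, ‖K₀ u w‖ = M * Real.exp (-(κ * supNorm (u - w))) := fun u w => by
    rw [hK₀, Complex.norm_real, Real.norm_eq_abs, abs_of_nonneg (by positivity)]
  obtain ⟨hs, hb⟩ := summable_norm_images_unif hN hκ hM (fun u w => (hnorm u w).le) hx hx'
  simp only [hnorm] at hs hb
  have e : (fun w : (box N hN).Fib x' => M * Real.exp (-(κ * supNorm (x - w.1)))) ∘ (fibParam hN hfx')
      = fun p => M * Real.exp (-(κ * supNorm (x - reflBox N p.1 p.2 x'))) := by
    funext p; simp only [Function.comp_apply, fibParam_apply_coe]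
  refine ⟨(Equiv.summable_iff (fibParam hN hfx')).1 (e ▸ hs), ?_⟩
  rw [← (fibParam hN hfx').tsum_eq (fun w : (box N hN).Fib x' => M * Real.exp (-(κ * supNorm (x - w.1))))]
  simp only [fibParam_apply_coe]
  exact hb

/-- **(2.35) FOR THE BOX, ZEROTH ORDER, UNIFORM CONSTANT**: under the hypotheses of `greenBox_images`,
`‖G_j(□)(x,x')‖ ≤ M · boxConst κ d N · e^{-(κ/(d+1))|x - x'|_∞}`, and `boxConst κ d N ≤ 2^{d+1}(1+2/(1-e^{-2c}))^{d+1}`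
whenever `κN_μ/(d+1) ≥ c` (`boxConst_le`) — uniform in the box AND in the lattice spacing in B4's regime.
[cite: Balaban1983RegularityDecay, p. 584 l. 13–14 with (2.35), dictionary] -/
theorem greenBox_decay_unif {N : Fin (d + 1) → ℕ} (hN : ∀ i, 1 ≤ N i) {b : ℕ} (hb : 1 ≤ b)
    (hbN : ∀ i, (b : ℤ) ∣ (N i : ℤ)) (c₁ msq a : ℂ) {G : (Fin (d + 1) → ℤ) → (Fin (d + 1) → ℤ) → ℂ} {κ M : ℝ}
    (hκ : 0 < κ) (hM : 0 ≤ M)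
    (hGdec : ∀ u w, ‖G u w‖ ≤ M * Real.exp (-(κ * supNorm (u - w))))
    (hGsym : ∀ (ε : Fin (d + 1) → Bool) (m u w : Fin (d + 1) → ℤ), G (reflBox N ε m u) (reflBox N ε m w) = G u w)
    (hGreen : ∀ x x', ∑ z ∈ opSupp b x, opK c₁ msq a b x z * G z x' = if x = x' then 1 else 0)
    (GB : Matrix ↥(boxDom N) ↥(boxDom N) ℂ)
    (hGB : (Matrix.of fun x y : ↥(boxDom N) => opBoxK c₁ msq a b N x.1 y.1) * GB = 1)
    (x x' : ↥(boxDom N)) :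
    ‖GB x x'‖ ≤ M * boxConst κ d N * Real.exp (-(κ / (d + 1) * supNorm (x.1 - x'.1))) := by
  rw [greenBox_unique hN hb hbN c₁ msq a hκ hM hGdec hGsym hGreen GB hGB]
  exact norm_imK_box_le_unif hN hκ hM hGdec x.2 x'.2

/-- **FIRST-ORDER TRANSFER, UNIFORM CONSTANT** (cf. `greenBox_deriv_decay`).
[cite: Balaban1983RegularityDecay, p. 584 l. 13–14 with (2.35), dictionary] -/
theorem greenBox_deriv_decay_unif {N : Fin (d + 1) → ℕ} (hN : ∀ i, 1 ≤ N i) {b : ℕ} (hb : 1 ≤ b)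
    (hbN : ∀ i, (b : ℤ) ∣ (N i : ℤ)) (c₁ msq a : ℂ) {G : (Fin (d + 1) → ℤ) → (Fin (d + 1) → ℤ) → ℂ} {κ M M₁ : ℝ}
    (hκ : 0 < κ) (hM : 0 ≤ M) (hM₁ : 0 ≤ M₁)
    (hGdec : ∀ u w, ‖G u w‖ ≤ M * Real.exp (-(κ * supNorm (u - w))))
    (hGsym : ∀ (ε : Fin (d + 1) → Bool) (m u w : Fin (d + 1) → ℤ), G (reflBox N ε m u) (reflBox N ε m w) = G u w)
    (hGreen : ∀ x x', ∑ z ∈ opSupp b x, opK c₁ msq a b x z * G z x' = if x = x' then 1 else 0)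
    (e : Fin (d + 1) → ℤ) (hGder : ∀ u w, ‖G (u + e) w - G u w‖ ≤ M₁ * Real.exp (-(κ * supNorm (u - w))))
    (GB : Matrix ↥(boxDom N) ↥(boxDom N) ℂ)
    (hGB : (Matrix.of fun x y : ↥(boxDom N) => opBoxK c₁ msq a b N x.1 y.1) * GB = 1)
    (x xe x' : ↥(boxDom N)) (hxe : xe.1 = x.1 + e) :
    ‖GB xe x' - GB x x'‖ ≤ M₁ * boxConst κ d N * Real.exp (-(κ / (d + 1) * supNorm (x.1 - x'.1))) := by
  rw [greenBox_unique hN hb hbN c₁ msq a hκ hM hGdec hGsym hGreen GB hGB]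
  simp only [Matrix.of_apply]
  have hs1 := summable_fib_box hN hκ hM hGdec xe.1 x'.1
  have hs2 := summable_fib_box hN hκ hM hGdec x.1 x'.1
  unfold ImageSystem.imK
  rw [← hs1.tsum_sub hs2, hxe]
  have h := norm_imK_box_le_unif hN hκ hM₁ (K := fun u w => G (u + e) w - G u w) hGder x.2 x'.2
  unfold ImageSystem.imK at h
  exact h

/-- **HÖLDER TRANSFER, UNIFORM CONSTANT** (cf. `greenBox_holder_decay`).
[cite: Balaban1983RegularityDecay, p. 584 l. 13–14 with (2.36), dictionary] -/
theorem greenBox_holder_decay_unif {N : Fin (d + 1) → ℕ} (hN : ∀ i, 1 ≤ N i) {b : ℕ} (hb : 1 ≤ b)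
    (hbN : ∀ i, (b : ℤ) ∣ (N i : ℤ)) (c₁ msq a : ℂ) {G : (Fin (d + 1) → ℤ) → (Fin (d + 1) → ℤ) → ℂ} {κ M : ℝ}
    (hκ : 0 < κ) (hM : 0 ≤ M)
    (hGdec : ∀ u w, ‖G u w‖ ≤ M * Real.exp (-(κ * supNorm (u - w))))
    (hGsym : ∀ (ε : Fin (d + 1) → Bool) (m u w : Fin (d + 1) → ℤ), G (reflBox N ε m u) (reflBox N ε m w) = G u w)
    (hGreen : ∀ x x', ∑ z ∈ opSupp b x, opK c₁ msq a b x z * G z x' = if x = x' then 1 else 0)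
    (e : Fin (d + 1) → ℤ) (H : (Fin (d + 1) → ℤ) → (Fin (d + 1) → ℤ) → ℝ) (hH : ∀ u u', 0 ≤ H u u')
    (hGhol : ∀ u u' w, ‖(G (u + e) w - G u w) - (G (u' + e) w - G u' w)‖
      ≤ H u u' * (Real.exp (-(κ * supNorm (u - w))) + Real.exp (-(κ * supNorm (u' - w)))))
    (GB : Matrix ↥(boxDom N) ↥(boxDom N) ℂ)
    (hGB : (Matrix.of fun x y : ↥(boxDom N) => opBoxK c₁ msq a b N x.1 y.1) * GB = 1)
    (x xe y ye x' : ↥(boxDom N)) (hxe : xe.1 = x.1 + e) (hye : ye.1 = y.1 + e) :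
    ‖(GB xe x' - GB x x') - (GB ye x' - GB y x')‖
      ≤ H x.1 y.1 * boxConst κ d N
        * (Real.exp (-(κ / (d + 1) * supNorm (x.1 - x'.1))) + Real.exp (-(κ / (d + 1) * supNorm (y.1 - x'.1)))) := by
  rw [greenBox_unique hN hb hbN c₁ msq a hκ hM hGdec hGsym hGreen GB hGB]
  simp only [Matrix.of_apply]
  have hs1 := summable_fib_box hN hκ hM hGdec xe.1 x'.1
  have hs2 := summable_fib_box hN hκ hM hGdec x.1 x'.1
  have hs3 := summable_fib_box hN hκ hM hGdec ye.1 x'.1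
  have hs4 := summable_fib_box hN hκ hM hGdec y.1 x'.1
  unfold ImageSystem.imK
  rw [← hs1.tsum_sub hs2, ← hs3.tsum_sub hs4, ← (hs1.sub hs2).tsum_sub (hs3.sub hs4), hxe, hye]
  set F : (box N hN).Fib x'.1 → ℂ := fun w => (G (x.1 + e) w.1 - G x.1 w.1) - (G (y.1 + e) w.1 - G y.1 w.1) with hF
  set mx : (box N hN).Fib x'.1 → ℝ := fun w => H x.1 y.1 * Real.exp (-(κ * supNorm (x.1 - w.1))) with hmx
  set my : (box N hN).Fib x'.1 → ℝ := fun w => H x.1 y.1 * Real.exp (-(κ * supNorm (y.1 - w.1))) with hmy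
  obtain ⟨hmxs, hmxb⟩ := tsum_fib_majorant_unif hN hκ (hH x.1 y.1) x.2 x'.2
  obtain ⟨hmys, hmyb⟩ := tsum_fib_majorant_unif hN hκ (hH x.1 y.1) y.2 x'.2
  have hle : ∀ w, ‖F w‖ ≤ mx w + my w := fun w => by
    rw [hF, hmx, hmy]; simp only []
    rw [← mul_add]; exact hGhol _ _ _
  have hFn : Summable (fun w => ‖F w‖) :=
    Summable.of_nonneg_of_le (fun w => norm_nonneg _) hle (hmxs.add hmys)
  show ‖∑' w, F w‖ ≤ _
  calc ‖∑' w, F w‖ ≤ ∑' w, ‖F w‖ := norm_tsum_le_tsum_norm hFn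
    _ ≤ ∑' w, (mx w + my w) := Summable.tsum_le_tsum hle hFn (hmxs.add hmys)
    _ = ∑' w, mx w + ∑' w, my w := hmxs.tsum_add hmys
    _ ≤ H x.1 y.1 * boxConst κ d N * Real.exp (-(κ / (d + 1) * supNorm (x.1 - x'.1)))
        + H x.1 y.1 * boxConst κ d N * Real.exp (-(κ / (d + 1) * supNorm (y.1 - x'.1))) := add_le_add hmxb hmyb
    _ = _ := by ring

end UniformConstant

/-! ## §7  Reflection covariance of the free operator; DISCHARGE of hypothesis (ii) (v4, append-only)

(2.42) uses that the free propagator `G_j` "commutes with" the reflections in the faces of the box.  In §4–§6 this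
was HYPOTHESIS (ii) `hGsym`.  Here it is DERIVED from (i) — the Green identity, now asked on BOTH sides (or on one
side for a symmetric kernel, `green_right_of_symm`) — and (iii) decay: the free operator `opK` of (2.44) is covariant
under every image map `σ_{ε,m}` as soon as `b ∣ N_μ` (`opK_reflBox`: nearest neighbours, blocks and the support are
carried onto themselves), a two-sided inverse kernel of a finite-range operator with symmetric support is UNIQUE
among kernels whose triple product converges absolutely (`twoSided_inverse_unique` — Fubini on `ℤ^{d+1} × ℤ^{d+1}`,
no `ℓ²` theory), hence `G ∘ (σ × σ) = G` (`green_reflBox_invariant`), and the `hGsym`-free forms of the displays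
follow (`greenBox_images₂`, `greenBox_decay_unif₂`, `greenBox_deriv_decay_unif₂`, `greenBox_holder_decay_unif₂`). -/

section Covariance

open Literature.MathematicalPhysics.QuantumFieldTheory.Balaban1983to89.B4ContourShift
open Literature.MathematicalPhysics.QuantumFieldTheory.Balaban1983to89.B4TorusKernel
  (summable_of_decay supNorm_neg)
open Literature.MathematicalPhysics.QuantumFieldTheory.Balaban1983to89.B4TorusKernel.MultiPeriod

variable {d : ℕ}

/-! ### Uniqueness of a two-sided inverse kernel -/

/-- **UNIQUENESS OF THE TWO-SIDED INVERSE KERNEL.**  Let `A` be a kernel on a set `X` with finite rows supported in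
`S x` and SYMMETRIC support (`z ∈ S x ↔ x ∈ S z`).  If `G₁` is a LEFT inverse (`Σ_{z ∈ S x} A(x,z) G₁(z,x') = δ`), `G₂` a
RIGHT inverse (`Σ_{z ∈ S x'} G₂(x,z) A(z,x') = δ`), and the triple product `Σ_v |G₂(u,v)| Σ_{z ∈ S v} |A(v,z) G₁(z,w)|`
converges, then `G₂ = G₁`: `G₂ = G₂ (A G₁) = (G₂ A) G₁ = G₁`, the re-association being Fubini on `X × X`.  [folklore] -/
theorem twoSided_inverse_unique {X : Type*} [DecidableEq X] (A G₁ G₂ : X → X → ℂ) (S : X → Finset X)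
    (hA : ∀ x z, z ∉ S x → A x z = 0) (hS : ∀ x z, z ∈ S x ↔ x ∈ S z)
    (hL : ∀ x x', ∑ z ∈ S x, A x z * G₁ z x' = if x = x' then 1 else 0)
    (hR : ∀ x x', ∑ z ∈ S x', G₂ x z * A z x' = if x = x' then 1 else 0)
    (hsum : ∀ u w, Summable (fun v => ‖G₂ u v‖ * ∑ z ∈ S v, ‖A v z * G₁ z w‖)) (u w : X) :
    G₂ u w = G₁ u w := by
  classical
  set f : X → X → ℂ := fun v z => G₂ u v * (A v z * G₁ z w) with hf
  have hrow : ∀ v, ∀ z ∉ S v, f v z = 0 := fun v z hz => by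
    simp only [hf, hA v z hz, zero_mul, mul_zero]
  have hcol : ∀ z, ∀ v ∉ S z, f v z = 0 := fun z v hv => by
    have hz : z ∉ S v := fun h => hv ((hS v z).1 h)
    simp only [hf, hA v z hz, zero_mul, mul_zero]
  have hF : Summable (Function.uncurry f) := by
    apply Summable.of_norm
    have h0 : 0 ≤ fun p : X × X => ‖Function.uncurry f p‖ := fun p => norm_nonneg _
    refine (summable_prod_of_nonneg h0).2 ⟨fun v => ?_, ?_⟩
    · exact summable_of_ne_finset_zero (s := S v) (fun z hz => by
        show ‖f v z‖ = 0
        rw [hrow v z hz, norm_zero])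
    · have e : ∀ v, ∑' z, ‖Function.uncurry f (v, z)‖ = ‖G₂ u v‖ * ∑ z ∈ S v, ‖A v z * G₁ z w‖ := by
        intro v
        rw [tsum_eq_sum (s := S v) (fun z hz => by
          show ‖f v z‖ = 0
          rw [hrow v z hz, norm_zero]), Finset.mul_sum]
        refine Finset.sum_congr rfl fun z _ => ?_
        show ‖f v z‖ = _
        rw [hf, norm_mul]
      exact (hsum u w).congr (fun v => (e v).symm)
  calc G₂ u w = ∑' v, G₂ u v * (if v = w then 1 else 0) := by
        rw [tsum_eq_single w (fun v hv => by rw [if_neg hv, mul_zero])]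
        rw [if_pos rfl, mul_one]
    _ = ∑' v, ∑' z, f v z := by
        refine tsum_congr fun v => ?_
        rw [← hL v w, Finset.mul_sum, tsum_eq_sum (s := S v) (hrow v)]
    _ = ∑' z, ∑' v, f v z := hF.tsum_comm.symm
    _ = ∑' z, (if u = z then 1 else 0) * G₁ z w := by
        refine tsum_congr fun z => ?_
        rw [tsum_eq_sum (s := S z) (hcol z), ← hR u z, Finset.sum_mul]
        refine Finset.sum_congr rfl fun v _ => ?_
        simp only [hf]
        ring
    _ = G₁ u w := by
        rw [tsum_eq_single u (fun z hz => by rw [if_neg (Ne.symm hz), zero_mul])]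
        rw [if_pos rfl, one_mul]

/-! ### The sup norm: two elementary facts -/

/-- a coordinatewise bound bounds the sup norm. [folklore] -/
theorem supNorm_le_of_forall {x : Fin (d + 1) → ℤ} {c : ℝ} (h : ∀ i, ((|x i| : ℤ) : ℝ) ≤ c) : supNorm x ≤ c :=
  Finset.sup'_le _ _ fun i _ => h i

/-- triangle inequality for the sup norm. [folklore] -/
theorem supNorm_add_le (x y : Fin (d + 1) → ℤ) : supNorm (x + y) ≤ supNorm x + supNorm y := by
  apply supNorm_le_of_forall
  intro i
  have h1 := abs_le_supNorm x i
  have h2 := abs_le_supNorm y i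
  have h3 : ((|x i + y i| : ℤ) : ℝ) ≤ ((|x i| : ℤ) : ℝ) + ((|y i| : ℤ) : ℝ) := by
    exact_mod_cast abs_add_le (x i) (y i)
  simpa only [Pi.add_apply] using h3.trans (add_le_add h1 h2)

/-! ### The image maps act on differences by sign flips -/

/-- the linear part of `σ_{ε,m}`: sign flip on the reflected coordinates. [folklore] -/
def sflip (ε : Fin (d + 1) → Bool) (v : Fin (d + 1) → ℤ) : Fin (d + 1) → ℤ := fun i => if ε i then -v i else v i

/-- unfolding lemma for `sflip`. [folklore] -/
@[simp] theorem sflip_apply (ε : Fin (d + 1) → Bool) (v : Fin (d + 1) → ℤ) (i : Fin (d + 1)) :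
    sflip ε v i = if ε i then -v i else v i := rfl

/-- `sflip` is an involution. [folklore] -/
theorem sflip_sflip (ε : Fin (d + 1) → Bool) (v : Fin (d + 1) → ℤ) : sflip ε (sflip ε v) = v := by
  funext i
  simp only [sflip_apply]
  split_ifs <;> simp

/-- `sflip` is odd. [folklore] -/
theorem sflip_neg (ε : Fin (d + 1) → Bool) (v : Fin (d + 1) → ℤ) : sflip ε (-v) = -sflip ε v := by
  funext i
  simp only [sflip_apply, Pi.neg_apply]
  split_ifs <;> simp

/-- `sflip` of a coordinate vector is `±` that coordinate vector. [folklore] -/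
theorem sflip_single (ε : Fin (d + 1) → Bool) (i : Fin (d + 1)) (c : ℤ) :
    sflip ε (Pi.single i c) = Pi.single i (if ε i then -c else c) := by
  funext k
  by_cases hk : k = i
  · subst hk; simp only [sflip_apply, Pi.single_eq_same]
  · simp only [sflip_apply, Pi.single_eq_of_ne hk, neg_zero, ite_self]

/-- `σ_{ε,m} z - σ_{ε,m} x = sflip ε (z - x)`: the image maps are affine with linear part `sflip ε`. [folklore] -/
theorem reflBox_sub (N : Fin (d + 1) → ℕ) (ε : Fin (d + 1) → Bool) (m z x : Fin (d + 1) → ℤ) :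
    reflBox N ε m z - reflBox N ε m x = sflip ε (z - x) := by
  funext i
  simp only [Pi.sub_apply, reflBox_apply, refl1Fun, sflip_apply]
  split_ifs <;> ring

/-- the image maps are ISOMETRIES of the sup norm: `|σ z - σ x|_∞ = |z - x|_∞`. [folklore] -/
theorem supNorm_reflBox_sub (N : Fin (d + 1) → ℕ) (ε : Fin (d + 1) → Bool) (m z x : Fin (d + 1) → ℤ) :
    supNorm (reflBox N ε m z - reflBox N ε m x) = supNorm (z - x) := by
  rw [reflBox_sub]
  unfold supNorm
  congr 1
  funext i
  simp only [sflip_apply]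
  split_ifs
  · rw [abs_neg]
  · rfl

/-! ### Nearest neighbours, blocks and the support are carried onto themselves -/

/-- `z` is a nearest neighbour of `x` iff `z - x = ±e_i`. [folklore] -/
theorem mem_nbrs_iff_sub {x z : Fin (d + 1) → ℤ} :
    z ∈ nbrs x ↔ ∃ i, z - x = Pi.single i 1 ∨ z - x = -Pi.single i 1 := by
  rw [mem_nbrs]
  refine exists_congr fun i => ?_
  rw [sub_eq_iff_eq_add', sub_eq_iff_eq_add', ← sub_eq_add_neg]

/-- `sflip` permutes the set `{±e_i}`. [folklore] -/
theorem unitVec_sflip_iff (ε : Fin (d + 1) → Bool) (v : Fin (d + 1) → ℤ) :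
    (∃ i, sflip ε v = Pi.single i 1 ∨ sflip ε v = -Pi.single i 1) ↔
      (∃ i, v = Pi.single i 1 ∨ v = -Pi.single i 1) := by
  have key : ∀ (u : Fin (d + 1) → ℤ) (i : Fin (d + 1)), (u = Pi.single i 1 ∨ u = -Pi.single i 1) →
      (sflip ε u = Pi.single i 1 ∨ sflip ε u = -Pi.single i 1) := by
    intro u i h
    rcases h with rfl | rfl
    · rw [sflip_single]
      rcases Bool.eq_false_or_eq_true (ε i) with h | h
      · right; rw [if_pos h, Pi.single_neg]
      · left; rw [if_neg (by simp [h])]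
    · rw [sflip_neg, sflip_single]
      rcases Bool.eq_false_or_eq_true (ε i) with h | h
      · left; rw [if_pos h, Pi.single_neg, neg_neg]
      · right; rw [if_neg (by simp [h])]
  constructor
  · rintro ⟨i, hi⟩
    have h := key (sflip ε v) i hi
    rw [sflip_sflip] at h
    exact ⟨i, h⟩
  · rintro ⟨i, hi⟩
    exact ⟨i, key v i hi⟩

/-- the image maps carry nearest-neighbour pairs to nearest-neighbour pairs. [folklore] -/
theorem mem_nbrs_reflBox_iff (N : Fin (d + 1) → ℕ) (ε : Fin (d + 1) → Bool) (m : Fin (d + 1) → ℤ)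
    {x z : Fin (d + 1) → ℤ} : reflBox N ε m z ∈ nbrs (reflBox N ε m x) ↔ z ∈ nbrs x := by
  rw [mem_nbrs_iff_sub, mem_nbrs_iff_sub, reflBox_sub, unitVec_sflip_iff]

/-- the neighbour relation is symmetric. [folklore] -/
theorem nbrs_comm {x z : Fin (d + 1) → ℤ} : z ∈ nbrs x ↔ x ∈ nbrs z := by
  rw [mem_nbrs_iff_sub, mem_nbrs_iff_sub]
  refine exists_congr fun i => ?_
  rw [← neg_sub z x, neg_inj, neg_eq_iff_eq_neg]
  exact Or.comm

/-- floor division of `-1 - n` by `b > 0`. [folklore] -/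
theorem neg_one_sub_ediv {b : ℤ} (hb : 0 < b) (n : ℤ) : (-1 - n) / b = -(n / b) - 1 := by
  have h1 := Int.emod_def n b
  have h2 := Int.emod_nonneg n hb.ne'
  have h3 := Int.emod_lt_of_pos n hb
  have key : (b - 1 - n % b) + b * (-(n / b) - 1) = -1 - n := by
    have e : b * (-(n / b) - 1) = -(b * (n / b)) - b := by ring
    rw [e]
    linarith
  exact ((Int.ediv_emod_unique hb).2 ⟨key, by linarith, by linarith⟩).1

/-- block index of a 1-D image: for `b ∣ N` the image maps act on block indices by `q ↦ q + 2(N/b)m`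
(translations) and `q ↦ 2(N/b)m - 1 - q` (reflections). [folklore] -/
theorem ediv_refl1Fun {b : ℕ} (hb : 1 ≤ b) {N : ℕ} (hbN : (b : ℤ) ∣ (N : ℤ)) (e : Bool) (m n : ℤ) :
    refl1Fun N e m n / (b : ℤ) =
      if e then 2 * ((N : ℤ) / b) * m - 1 - n / (b : ℤ) else n / (b : ℤ) + 2 * ((N : ℤ) / b) * m := by
  have hb' : (0 : ℤ) < b := by exact_mod_cast hb
  obtain ⟨q, hq⟩ := hbN
  have hq' : (N : ℤ) / b = q := by rw [hq, Int.mul_ediv_cancel_left _ hb'.ne']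
  unfold refl1Fun
  cases e
  · rw [if_neg (by simp), if_neg (by simp), hq', hq,
      show n + 2 * ((b : ℤ) * q) * m = n + (b : ℤ) * (2 * q * m) by ring, Int.add_mul_ediv_left _ _ hb'.ne']
  · rw [if_pos rfl, if_pos rfl, hq', hq,
      show 2 * ((b : ℤ) * q) * m - 1 - n = (-1 - n) + (b : ℤ) * (2 * q * m) by ring,
      Int.add_mul_ediv_left _ _ hb'.ne', neg_one_sub_ediv hb' n]
    ring

/-- the image maps carry blocks to blocks: `blk (σ z) = blk (σ x) ↔ blk z = blk x` when `b ∣ N_μ`. [folklore] -/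
theorem blk_reflBox_eq_iff {b : ℕ} (hb : 1 ≤ b) {N : Fin (d + 1) → ℕ} (hbN : ∀ i, (b : ℤ) ∣ (N i : ℤ))
    (ε : Fin (d + 1) → Bool) (m z x : Fin (d + 1) → ℤ) :
    blk b (reflBox N ε m z) = blk b (reflBox N ε m x) ↔ blk b z = blk b x := by
  simp only [funext_iff, blk, reflBox_apply, ediv_refl1Fun hb (hbN _)]
  refine forall_congr' fun i => ?_
  split_ifs
  · constructor <;> intro h <;> linarith
  · constructor <;> intro h <;> linarith

/-- the image maps carry the block of `x` onto the block of `σ x`. [folklore] -/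
theorem mem_blockOf_reflBox_iff {b : ℕ} (hb : 1 ≤ b) {N : Fin (d + 1) → ℕ} (hbN : ∀ i, (b : ℤ) ∣ (N i : ℤ))
    (ε : Fin (d + 1) → Bool) (m : Fin (d + 1) → ℤ) {x z : Fin (d + 1) → ℤ} :
    reflBox N ε m z ∈ blockOf b (reflBox N ε m x) ↔ z ∈ blockOf b x := by
  rw [mem_blockOf hb, mem_blockOf hb, blk_reflBox_eq_iff hb hbN]

/-- the image maps carry the support `opSupp b x` onto `opSupp b (σ x)` (membership form). [folklore] -/
theorem mem_opSupp_reflBox_iff {b : ℕ} (hb : 1 ≤ b) {N : Fin (d + 1) → ℕ} (hbN : ∀ i, (b : ℤ) ∣ (N i : ℤ))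
    (ε : Fin (d + 1) → Bool) (m : Fin (d + 1) → ℤ) {x z : Fin (d + 1) → ℤ} :
    reflBox N ε m z ∈ opSupp b (reflBox N ε m x) ↔ z ∈ opSupp b x := by
  simp only [opSupp, Finset.mem_union, Finset.mem_insert, (reflBox N ε m).injective.eq_iff,
    mem_nbrs_reflBox_iff, mem_blockOf_reflBox_iff hb hbN]

/-- the image maps carry the support `opSupp b x` onto `opSupp b (σ x)` (as finite sets). [folklore] -/
theorem opSupp_reflBox {b : ℕ} (hb : 1 ≤ b) {N : Fin (d + 1) → ℕ} (hbN : ∀ i, (b : ℤ) ∣ (N i : ℤ))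
    (ε : Fin (d + 1) → Bool) (m x : Fin (d + 1) → ℤ) :
    (opSupp b x).image (reflBox N ε m) = opSupp b (reflBox N ε m x) := by
  classical
  ext z'
  rw [Finset.mem_image]
  constructor
  · rintro ⟨z, hz, rfl⟩
    exact (mem_opSupp_reflBox_iff hb hbN ε m).2 hz
  · intro hz'
    refine ⟨(reflBox N ε m).symm z', ?_, (reflBox N ε m).apply_symm_apply z'⟩
    have h := (mem_opSupp_reflBox_iff hb hbN ε m (x := x) (z := (reflBox N ε m).symm z')).1
    rw [Equiv.apply_symm_apply] at h
    exact h hz'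

/-- the support relation is symmetric: `z ∈ opSupp b x ↔ x ∈ opSupp b z`. [folklore] -/
theorem mem_opSupp_comm {b : ℕ} (hb : 1 ≤ b) {x z : Fin (d + 1) → ℤ} : z ∈ opSupp b x ↔ x ∈ opSupp b z := by
  simp only [opSupp, Finset.mem_union, Finset.mem_insert, mem_blockOf hb]
  constructor
  · rintro ((h | h) | h)
    · exact Or.inl (Or.inl h.symm)
    · exact Or.inl (Or.inr (nbrs_comm.1 h))
    · exact Or.inr h.symm
  · rintro ((h | h) | h)
    · exact Or.inl (Or.inl h.symm)
    · exact Or.inl (Or.inr (nbrs_comm.2 h))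
    · exact Or.inr h.symm

/-! ### Covariance and symmetry of the free operator (2.44) -/

/-- `-Δ` is covariant under the image maps. [folklore] -/
theorem lapK_reflBox (N : Fin (d + 1) → ℕ) (ε : Fin (d + 1) → Bool) (m x z : Fin (d + 1) → ℤ) :
    (lapK (reflBox N ε m x) (reflBox N ε m z) : ℂ) = lapK x z := by
  simp only [lapK, (reflBox N ε m).injective.eq_iff, mem_nbrs_reflBox_iff]

/-- the diagonal kernel is covariant under the image maps. [folklore] -/
theorem diagK_reflBox (N : Fin (d + 1) → ℕ) (ε : Fin (d + 1) → Bool) (m : Fin (d + 1) → ℤ) (c : ℂ)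
    (x z : Fin (d + 1) → ℤ) : diagK c (reflBox N ε m x) (reflBox N ε m z) = diagK c x z := by
  simp only [diagK, (reflBox N ε m).injective.eq_iff]

/-- the block-averaging kernel `a·Q*Q` is covariant under the image maps of a box built of blocks. [folklore] -/
theorem avgK_reflBox {b : ℕ} (hb : 1 ≤ b) {N : Fin (d + 1) → ℕ} (hbN : ∀ i, (b : ℤ) ∣ (N i : ℤ))
    (ε : Fin (d + 1) → Bool) (m : Fin (d + 1) → ℤ) (a : ℂ) (x z : Fin (d + 1) → ℤ) :
    avgK a b (reflBox N ε m x) (reflBox N ε m z) = avgK a b x z := by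
  simp only [avgK, blk_reflBox_eq_iff hb hbN]

/-- **THE FREE OPERATOR OF (2.44) COMMUTES WITH THE REFLECTION GROUP OF THE BOX**:
`opK (σ x) (σ z) = opK x z` for every image map `σ = σ_{ε,m}` of a box `Π_μ [0,N_μ)` built of `b`-blocks.
[cite: Balaban1983RegularityDecay, p. 584 (2.42)–(2.44), dictionary] [folklore] -/
theorem opK_reflBox {b : ℕ} (hb : 1 ≤ b) {N : Fin (d + 1) → ℕ} (hbN : ∀ i, (b : ℤ) ∣ (N i : ℤ))
    (ε : Fin (d + 1) → Bool) (m : Fin (d + 1) → ℤ) (c₁ msq a : ℂ) (x z : Fin (d + 1) → ℤ) :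
    opK c₁ msq a b (reflBox N ε m x) (reflBox N ε m z) = opK c₁ msq a b x z := by
  simp only [opK, lapK_reflBox, diagK_reflBox, avgK_reflBox hb hbN]

/-- the free operator of (2.44) is SYMMETRIC: `opK x z = opK z x`. [folklore] -/
theorem opK_comm (b : ℕ) (c₁ msq a : ℂ) (x z : Fin (d + 1) → ℤ) :
    opK c₁ msq a b x z = opK c₁ msq a b z x := by
  have h2 : (z ∈ nbrs x) ↔ (x ∈ nbrs z) := nbrs_comm
  simp only [opK, lapK, diagK, avgK]
  by_cases h1 : z = x
  · subst h1; rfl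
  · have h1' : ¬ x = z := fun h => h1 h.symm
    by_cases h3 : blk b z = blk b x
    · rw [if_neg h1, if_neg h1', if_neg h1, if_neg h1', if_pos h3, if_pos h3.symm]
      by_cases h4 : z ∈ nbrs x
      · rw [if_pos h4, if_pos (show x ∈ nbrs z from h2.1 h4)]
      · rw [if_neg h4, if_neg (show x ∉ nbrs z from fun h => h4 (h2.2 h))]
    · rw [if_neg h1, if_neg h1', if_neg h1, if_neg h1', if_neg h3,
        if_neg (show ¬ blk b x = blk b z from fun h => h3 h.symm)]
      by_cases h4 : z ∈ nbrs x
      · rw [if_pos h4, if_pos (show x ∈ nbrs z from h2.1 h4)]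
      · rw [if_neg h4, if_neg (show x ∉ nbrs z from fun h => h4 (h2.2 h))]

/-! ### The Green identities transported along an image map -/

/-- the LEFT Green identity is inherited by `G ∘ (σ × σ)`. [folklore] -/
theorem green_left_reflBox {b : ℕ} (hb : 1 ≤ b) {N : Fin (d + 1) → ℕ} (hbN : ∀ i, (b : ℤ) ∣ (N i : ℤ))
    (c₁ msq a : ℂ) {G : (Fin (d + 1) → ℤ) → (Fin (d + 1) → ℤ) → ℂ}
    (hGreen : ∀ x x', ∑ z ∈ opSupp b x, opK c₁ msq a b x z * G z x' = if x = x' then 1 else 0)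
    (ε : Fin (d + 1) → Bool) (m : Fin (d + 1) → ℤ) (x x' : Fin (d + 1) → ℤ) :
    ∑ z ∈ opSupp b x, opK c₁ msq a b x z * G (reflBox N ε m z) (reflBox N ε m x') = if x = x' then 1 else 0 := by
  classical
  have h1 : ∑ z ∈ opSupp b x, opK c₁ msq a b x z * G (reflBox N ε m z) (reflBox N ε m x')
      = ∑ z ∈ opSupp b x, opK c₁ msq a b (reflBox N ε m x) (reflBox N ε m z)
          * G (reflBox N ε m z) (reflBox N ε m x') := by
    refine Finset.sum_congr rfl fun z _ => ?_
    rw [opK_reflBox hb hbN]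
  rw [h1, ← Finset.sum_image (f := fun z' => opK c₁ msq a b (reflBox N ε m x) z' * G z' (reflBox N ε m x'))
    ((reflBox N ε m).injective.injOn), opSupp_reflBox hb hbN, hGreen]
  by_cases hx : x = x'
  · subst hx; rw [if_pos rfl, if_pos rfl]
  · rw [if_neg hx, if_neg (fun h => hx ((reflBox N ε m).injective h))]

/-- the RIGHT Green identity is inherited by `G ∘ (σ × σ)`. [folklore] -/
theorem green_right_reflBox {b : ℕ} (hb : 1 ≤ b) {N : Fin (d + 1) → ℕ} (hbN : ∀ i, (b : ℤ) ∣ (N i : ℤ))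
    (c₁ msq a : ℂ) {G : (Fin (d + 1) → ℤ) → (Fin (d + 1) → ℤ) → ℂ}
    (hGreenR : ∀ x x', ∑ z ∈ opSupp b x', G x z * opK c₁ msq a b z x' = if x = x' then 1 else 0)
    (ε : Fin (d + 1) → Bool) (m : Fin (d + 1) → ℤ) (x x' : Fin (d + 1) → ℤ) :
    ∑ z ∈ opSupp b x', G (reflBox N ε m x) (reflBox N ε m z) * opK c₁ msq a b z x' = if x = x' then 1 else 0 := by
  classical
  have h1 : ∑ z ∈ opSupp b x', G (reflBox N ε m x) (reflBox N ε m z) * opK c₁ msq a b z x'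
      = ∑ z ∈ opSupp b x', G (reflBox N ε m x) (reflBox N ε m z)
          * opK c₁ msq a b (reflBox N ε m z) (reflBox N ε m x') := by
    refine Finset.sum_congr rfl fun z _ => ?_
    rw [opK_reflBox hb hbN]
  rw [h1, ← Finset.sum_image (f := fun z' => G (reflBox N ε m x) z' * opK c₁ msq a b z' (reflBox N ε m x'))
    ((reflBox N ε m).injective.injOn), opSupp_reflBox hb hbN, hGreenR]
  by_cases hx : x = x'
  · subst hx; rw [if_pos rfl, if_pos rfl]
  · rw [if_neg hx, if_neg (fun h => hx ((reflBox N ε m).injective h))]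

/-- for a SYMMETRIC kernel the left Green identity gives the right one. [folklore] -/
theorem green_right_of_symm (b : ℕ) (c₁ msq a : ℂ) {G : (Fin (d + 1) → ℤ) → (Fin (d + 1) → ℤ) → ℂ}
    (hGs : ∀ u w, G u w = G w u)
    (hGreen : ∀ x x', ∑ z ∈ opSupp b x, opK c₁ msq a b x z * G z x' = if x = x' then 1 else 0)
    (x x' : Fin (d + 1) → ℤ) :
    ∑ z ∈ opSupp b x', G x z * opK c₁ msq a b z x' = if x = x' then 1 else 0 := by
  have h := hGreen x' x
  have e : ∑ z ∈ opSupp b x', G x z * opK c₁ msq a b z x' = ∑ z ∈ opSupp b x', opK c₁ msq a b x' z * G z x := by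
    refine Finset.sum_congr rfl fun z _ => ?_
    rw [hGs x z, opK_comm b c₁ msq a z x', mul_comm]
  rw [e, h]
  by_cases hx : x = x'
  · subst hx; rfl
  · rw [if_neg (fun h' => hx h'.symm), if_neg hx]

/-! ### Absolute convergence of the triple product -/

/-- the free operator has bounded entries: `|opK(x,z)| ≤ 2(d+1)|c₁| + |msq| + |a|`. [folklore] -/
theorem norm_opK_le (b : ℕ) (c₁ msq a : ℂ) (x z : Fin (d + 1) → ℤ) :
    ‖opK c₁ msq a b x z‖ ≤ 2 * (d + 1) * ‖c₁‖ + ‖msq‖ + ‖a‖ := by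
  have hl : ‖(lapK x z : ℂ)‖ ≤ 2 * (d + 1) := by
    unfold lapK
    split_ifs
    · rw [Complex.norm_natCast]; push_cast; exact le_refl _
    · rw [norm_neg, norm_one]
      have : (1 : ℝ) ≤ d + 1 := by
        have : (0 : ℝ) ≤ d := by positivity
        linarith
      linarith
    · rw [norm_zero]; positivity
  have hd : ‖diagK msq x z‖ ≤ ‖msq‖ := by
    unfold diagK; split_ifs
    · exact le_refl _
    · rw [norm_zero]; exact norm_nonneg _
  have ha : ‖avgK a b x z‖ ≤ ‖a‖ := by
    unfold avgK; split_ifs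
    · exact le_refl _
    · rw [norm_zero]; exact norm_nonneg _
  unfold opK
  calc ‖c₁ * lapK x z + (diagK msq x z + avgK a b x z)‖
      ≤ ‖c₁ * lapK x z‖ + (‖diagK msq x z‖ + ‖avgK a b x z‖) :=
        (norm_add_le _ _).trans (add_le_add le_rfl (norm_add_le _ _))
    _ ≤ ‖c₁‖ * (2 * (d + 1)) + (‖msq‖ + ‖a‖) := by
        rw [norm_mul]
        exact add_le_add (mul_le_mul_of_nonneg_left hl (norm_nonneg _)) (add_le_add hd ha)
    _ = 2 * (d + 1) * ‖c₁‖ + ‖msq‖ + ‖a‖ := by ring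

/-- points of the support are `b`-close: `z ∈ opSupp b v ⇒ |z - v|_∞ ≤ b`. [folklore] -/
theorem supNorm_sub_le_of_mem_opSupp {b : ℕ} (hb : 1 ≤ b) {v z : Fin (d + 1) → ℤ} (hz : z ∈ opSupp b v) :
    supNorm (z - v) ≤ b := by
  apply supNorm_le_of_forall
  intro i
  have hb' : (0 : ℤ) < b := by exact_mod_cast hb
  have key : |(z - v) i| ≤ (b : ℤ) := by
    simp only [opSupp, Finset.mem_union, Finset.mem_insert] at hz
    rcases hz with (rfl | hz) | hz
    · simp
    · obtain ⟨j, hj | hj⟩ := mem_nbrs_iff_sub.1 hz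
      · rw [hj]
        by_cases hij : i = j
        · subst hij; simp; omega
        · simp [Pi.single_eq_of_ne hij]
      · rw [hj]
        by_cases hij : i = j
        · subst hij; simp; omega
        · simp [Pi.single_eq_of_ne hij]
    · simp only [blockOf, Fintype.mem_piFinset, Finset.mem_Ico] at hz
      obtain ⟨h1, h2⟩ := hz i
      have h3 := Int.emod_def (v i) b
      have h4 := Int.emod_nonneg (v i) hb'.ne'
      have h5 := Int.emod_lt_of_pos (v i) hb'
      rw [Pi.sub_apply, abs_le]
      constructor <;> linarith
  exact_mod_cast key

/-- the support has at most `2(d+1) + 1 + b^{d+1}` points. [folklore] -/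
theorem card_opSupp_le {b : ℕ} (v : Fin (d + 1) → ℤ) : (opSupp b v).card ≤ 2 * (d + 1) + 1 + b ^ (d + 1) := by
  classical
  have h1 : (insert v (nbrs v)).card ≤ 2 * (d + 1) + 1 := by
    have := Finset.card_insert_le v (nbrs v)
    rw [card_nbrs] at this
    exact this
  have h2 : (blockOf b v).card = b ^ (d + 1) := by
    unfold blockOf
    rw [Fintype.card_piFinset]
    simp only [Int.card_Ico, add_sub_cancel_left, Int.toNat_natCast, Finset.prod_const, Finset.card_univ,
      Fintype.card_fin]
  calc (opSupp b v).card ≤ (insert v (nbrs v)).card + (blockOf b v).card := Finset.card_union_le _ _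
    _ ≤ 2 * (d + 1) + 1 + b ^ (d + 1) := by rw [h2]; exact add_le_add h1 le_rfl

/-- `Σ_{v ∈ ℤ^{d+1}} e^{-κ|v - w|_∞} < ∞`. [folklore] -/
theorem summable_exp_supNorm_sub {κ : ℝ} (hκ : 0 < κ) (w : Fin (d + 1) → ℤ) :
    Summable (fun v : Fin (d + 1) → ℤ => Real.exp (-(κ * supNorm (v - w)))) := by
  have h1 : Summable (fun n : Fin (d + 1) → ℤ => ((Real.exp (-(κ * supNorm n)) : ℝ) : ℂ)) :=
    summable_of_decay _ hκ (M := 1) (fun n => by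
      rw [Complex.norm_real, Real.norm_of_nonneg (Real.exp_pos _).le, one_mul])
  have h2 : Summable (fun n : Fin (d + 1) → ℤ => Real.exp (-(κ * supNorm n))) := Complex.summable_ofReal.1 h1
  have h3 := (Equiv.subRight w).summable_iff.2 h2
  exact h3

/-- ABSOLUTE CONVERGENCE OF THE TRIPLE PRODUCT `G₂ · opK · G` for a bounded `G₂` and an exponentially decaying `G`.
[folklore] -/
theorem summable_triple {b : ℕ} (hb : 1 ≤ b) (c₁ msq a : ℂ) {G G₂ : (Fin (d + 1) → ℤ) → (Fin (d + 1) → ℤ) → ℂ}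
    {κ M M₂ : ℝ} (hκ : 0 < κ) (hM : 0 ≤ M)
    (hGdec : ∀ u w, ‖G u w‖ ≤ M * Real.exp (-(κ * supNorm (u - w)))) (hG₂ : ∀ u v, ‖G₂ u v‖ ≤ M₂)
    (u w : Fin (d + 1) → ℤ) :
    Summable (fun v => ‖G₂ u v‖ * ∑ z ∈ opSupp b v, ‖opK c₁ msq a b v z * G z w‖) := by
  set A₀ : ℝ := 2 * (d + 1) * ‖c₁‖ + ‖msq‖ + ‖a‖ with hA₀
  set C : ℝ := M₂ * ((2 * (d + 1) + 1 + b ^ (d + 1) : ℕ) * (A₀ * (M * Real.exp (κ * b)))) with hC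
  have hA₀0 : 0 ≤ A₀ := by rw [hA₀]; positivity
  have hM₂ : 0 ≤ M₂ := le_trans (norm_nonneg _) (hG₂ u u)
  have hterm : ∀ v, ∀ z ∈ opSupp b v,
      ‖opK c₁ msq a b v z * G z w‖ ≤ A₀ * (M * Real.exp (κ * b) * Real.exp (-(κ * supNorm (v - w)))) := by
    intro v z hz
    rw [norm_mul]
    have hzv := supNorm_sub_le_of_mem_opSupp hb hz
    have htri : supNorm (v - w) ≤ supNorm (z - v) + supNorm (z - w) := by
      have e : v - w = -(z - v) + (z - w) := by abel
      rw [e]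
      exact (supNorm_add_le _ _).trans (by rw [supNorm_neg])
    have hG : ‖G z w‖ ≤ M * Real.exp (κ * b) * Real.exp (-(κ * supNorm (v - w))) := by
      calc ‖G z w‖ ≤ M * Real.exp (-(κ * supNorm (z - w))) := hGdec z w
        _ ≤ M * (Real.exp (κ * b) * Real.exp (-(κ * supNorm (v - w)))) := by
            apply mul_le_mul_of_nonneg_left _ hM
            rw [← Real.exp_add]
            apply Real.exp_le_exp.mpr
            nlinarith [hκ.le]
        _ = _ := by ring
    exact mul_le_mul (norm_opK_le b c₁ msq a v z) hG (norm_nonneg _) hA₀0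
  have hinner : ∀ v, ∑ z ∈ opSupp b v, ‖opK c₁ msq a b v z * G z w‖
      ≤ (2 * (d + 1) + 1 + b ^ (d + 1) : ℕ) * (A₀ * (M * Real.exp (κ * b) * Real.exp (-(κ * supNorm (v - w))))) := by
    intro v
    have h := Finset.sum_le_card_nsmul _ _ _ (hterm v)
    rw [nsmul_eq_mul] at h
    refine h.trans ?_
    apply mul_le_mul_of_nonneg_right _ (by positivity)
    exact_mod_cast card_opSupp_le v
  refine Summable.of_nonneg_of_le (fun v => by positivity)
    (fun v => ?_) ((summable_exp_supNorm_sub hκ w).mul_left C)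
  calc ‖G₂ u v‖ * ∑ z ∈ opSupp b v, ‖opK c₁ msq a b v z * G z w‖
      ≤ M₂ * ((2 * (d + 1) + 1 + b ^ (d + 1) : ℕ)
          * (A₀ * (M * Real.exp (κ * b) * Real.exp (-(κ * supNorm (v - w)))))) :=
        mul_le_mul (hG₂ u v) (hinner v) (Finset.sum_nonneg fun z _ => norm_nonneg _) hM₂
    _ = C * Real.exp (-(κ * supNorm (v - w))) := by rw [hC]; ring

/-! ### The discharge of hypothesis (ii) and the `hGsym`-free displays -/

/-- **THE FREE PROPAGATOR IS INVARIANT UNDER THE REFLECTION GROUP OF THE BOX** — hypothesis (ii) `hGsym` of §4–§6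
DISCHARGED: if `G` decays exponentially and is a two-sided inverse of the free operator (2.44) (`hGreen`, `hGreenR`;
for a symmetric `G` the second follows from the first, `green_right_of_symm`), then `G(σu, σw) = G(u, w)` for every
image map `σ = σ_{ε,m}` of a box built of `b`-blocks.  Proof: `G ∘ (σ × σ)` is again a two-sided inverse
(`opK_reflBox`), and two-sided inverses are unique (`twoSided_inverse_unique`).
[cite: Balaban1983RegularityDecay, p. 584 (2.42), dictionary] [folklore] -/
theorem green_reflBox_invariant {b : ℕ} (hb : 1 ≤ b) {N : Fin (d + 1) → ℕ} (hbN : ∀ i, (b : ℤ) ∣ (N i : ℤ))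
    (c₁ msq a : ℂ) {G : (Fin (d + 1) → ℤ) → (Fin (d + 1) → ℤ) → ℂ} {κ M : ℝ} (hκ : 0 < κ) (hM : 0 ≤ M)
    (hGdec : ∀ u w, ‖G u w‖ ≤ M * Real.exp (-(κ * supNorm (u - w))))
    (hGreen : ∀ x x', ∑ z ∈ opSupp b x, opK c₁ msq a b x z * G z x' = if x = x' then 1 else 0)
    (hGreenR : ∀ x x', ∑ z ∈ opSupp b x', G x z * opK c₁ msq a b z x' = if x = x' then 1 else 0)
    (ε : Fin (d + 1) → Bool) (m u w : Fin (d + 1) → ℤ) :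
    G (reflBox N ε m u) (reflBox N ε m w) = G u w := by
  classical
  have hG₂ : ∀ u v, ‖G (reflBox N ε m u) (reflBox N ε m v)‖ ≤ M := fun u v =>
    (hGdec _ _).trans (mul_le_of_le_one_right hM (Real.exp_le_one_iff.mpr (by
      have := supNorm_nonneg (reflBox N ε m u - reflBox N ε m v)
      nlinarith [hκ.le])))
  exact twoSided_inverse_unique (opK c₁ msq a b) G (fun u w => G (reflBox N ε m u) (reflBox N ε m w))
    (opSupp b) (fun x z hz => opK_eq_zero_of_not_mem hb c₁ msq a hz) (fun x z => mem_opSupp_comm hb) hGreen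
    (fun x x' => green_right_reflBox hb hbN c₁ msq a hGreenR ε m x x')
    (summable_triple hb c₁ msq a hκ hM hGdec hG₂) u w

/-- **(2.42)/(2.44) WITHOUT HYPOTHESIS (ii)**: the image sum of a decaying two-sided inverse of the free operator is
THE two-sided inverse of the Neumann box operator (cf. `greenBox_images`).
[cite: Balaban1983RegularityDecay, p. 584 (2.42), (2.44), dictionary] -/
theorem greenBox_images₂ {N : Fin (d + 1) → ℕ} (hN : ∀ i, 1 ≤ N i) {b : ℕ} (hb : 1 ≤ b)
    (hbN : ∀ i, (b : ℤ) ∣ (N i : ℤ)) (c₁ msq a : ℂ) {G : (Fin (d + 1) → ℤ) → (Fin (d + 1) → ℤ) → ℂ} {κ M : ℝ}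
    (hκ : 0 < κ) (hM : 0 ≤ M)
    (hGdec : ∀ u w, ‖G u w‖ ≤ M * Real.exp (-(κ * supNorm (u - w))))
    (hGreen : ∀ x x', ∑ z ∈ opSupp b x, opK c₁ msq a b x z * G z x' = if x = x' then 1 else 0)
    (hGreenR : ∀ x x', ∑ z ∈ opSupp b x', G x z * opK c₁ msq a b z x' = if x = x' then 1 else 0) :
    (Matrix.of fun x y : ↥(boxDom N) => opBoxK c₁ msq a b N x.1 y.1)
        * (Matrix.of fun y x' : ↥(boxDom N) => (box N hN).imK G y.1 x'.1) = 1 ∧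
      (Matrix.of fun y x' : ↥(boxDom N) => (box N hN).imK G y.1 x'.1)
        * (Matrix.of fun x y : ↥(boxDom N) => opBoxK c₁ msq a b N x.1 y.1) = 1 :=
  greenBox_images hN hb hbN c₁ msq a hκ hM hGdec
    (green_reflBox_invariant hb hbN c₁ msq a hκ hM hGdec hGreen hGreenR) hGreen

/-- **(2.35) FOR THE BOX, ZEROTH ORDER, UNIFORM CONSTANT, WITHOUT HYPOTHESIS (ii)** (cf. `greenBox_decay_unif`).
[cite: Balaban1983RegularityDecay, p. 584 l. 13–14 with (2.35), dictionary] -/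
theorem greenBox_decay_unif₂ {N : Fin (d + 1) → ℕ} (hN : ∀ i, 1 ≤ N i) {b : ℕ} (hb : 1 ≤ b)
    (hbN : ∀ i, (b : ℤ) ∣ (N i : ℤ)) (c₁ msq a : ℂ) {G : (Fin (d + 1) → ℤ) → (Fin (d + 1) → ℤ) → ℂ} {κ M : ℝ}
    (hκ : 0 < κ) (hM : 0 ≤ M)
    (hGdec : ∀ u w, ‖G u w‖ ≤ M * Real.exp (-(κ * supNorm (u - w))))
    (hGreen : ∀ x x', ∑ z ∈ opSupp b x, opK c₁ msq a b x z * G z x' = if x = x' then 1 else 0)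
    (hGreenR : ∀ x x', ∑ z ∈ opSupp b x', G x z * opK c₁ msq a b z x' = if x = x' then 1 else 0)
    (GB : Matrix ↥(boxDom N) ↥(boxDom N) ℂ)
    (hGB : (Matrix.of fun x y : ↥(boxDom N) => opBoxK c₁ msq a b N x.1 y.1) * GB = 1)
    (x x' : ↥(boxDom N)) :
    ‖GB x x'‖ ≤ M * boxConst κ d N * Real.exp (-(κ / (d + 1) * supNorm (x.1 - x'.1))) :=
  greenBox_decay_unif hN hb hbN c₁ msq a hκ hM hGdec
    (green_reflBox_invariant hb hbN c₁ msq a hκ hM hGdec hGreen hGreenR) hGreen GB hGB x x'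

/-- **FIRST-ORDER TRANSFER, UNIFORM CONSTANT, WITHOUT HYPOTHESIS (ii)** (cf. `greenBox_deriv_decay_unif`).
[cite: Balaban1983RegularityDecay, p. 584 l. 13–14 with (2.35), dictionary] -/
theorem greenBox_deriv_decay_unif₂ {N : Fin (d + 1) → ℕ} (hN : ∀ i, 1 ≤ N i) {b : ℕ} (hb : 1 ≤ b)
    (hbN : ∀ i, (b : ℤ) ∣ (N i : ℤ)) (c₁ msq a : ℂ) {G : (Fin (d + 1) → ℤ) → (Fin (d + 1) → ℤ) → ℂ} {κ M M₁ : ℝ}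
    (hκ : 0 < κ) (hM : 0 ≤ M) (hM₁ : 0 ≤ M₁)
    (hGdec : ∀ u w, ‖G u w‖ ≤ M * Real.exp (-(κ * supNorm (u - w))))
    (hGreen : ∀ x x', ∑ z ∈ opSupp b x, opK c₁ msq a b x z * G z x' = if x = x' then 1 else 0)
    (hGreenR : ∀ x x', ∑ z ∈ opSupp b x', G x z * opK c₁ msq a b z x' = if x = x' then 1 else 0)
    (e : Fin (d + 1) → ℤ) (hGder : ∀ u w, ‖G (u + e) w - G u w‖ ≤ M₁ * Real.exp (-(κ * supNorm (u - w))))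
    (GB : Matrix ↥(boxDom N) ↥(boxDom N) ℂ)
    (hGB : (Matrix.of fun x y : ↥(boxDom N) => opBoxK c₁ msq a b N x.1 y.1) * GB = 1)
    (x xe x' : ↥(boxDom N)) (hxe : xe.1 = x.1 + e) :
    ‖GB xe x' - GB x x'‖ ≤ M₁ * boxConst κ d N * Real.exp (-(κ / (d + 1) * supNorm (x.1 - x'.1))) :=
  greenBox_deriv_decay_unif hN hb hbN c₁ msq a hκ hM hM₁ hGdec
    (green_reflBox_invariant hb hbN c₁ msq a hκ hM hGdec hGreen hGreenR) hGreen e hGder GB hGB x xe x' hxe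

/-- **HÖLDER TRANSFER, UNIFORM CONSTANT, WITHOUT HYPOTHESIS (ii)** (cf. `greenBox_holder_decay_unif`).
[cite: Balaban1983RegularityDecay, p. 584 l. 13–14 with (2.36), dictionary] -/
theorem greenBox_holder_decay_unif₂ {N : Fin (d + 1) → ℕ} (hN : ∀ i, 1 ≤ N i) {b : ℕ} (hb : 1 ≤ b)
    (hbN : ∀ i, (b : ℤ) ∣ (N i : ℤ)) (c₁ msq a : ℂ) {G : (Fin (d + 1) → ℤ) → (Fin (d + 1) → ℤ) → ℂ} {κ M : ℝ}
    (hκ : 0 < κ) (hM : 0 ≤ M)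
    (hGdec : ∀ u w, ‖G u w‖ ≤ M * Real.exp (-(κ * supNorm (u - w))))
    (hGreen : ∀ x x', ∑ z ∈ opSupp b x, opK c₁ msq a b x z * G z x' = if x = x' then 1 else 0)
    (hGreenR : ∀ x x', ∑ z ∈ opSupp b x', G x z * opK c₁ msq a b z x' = if x = x' then 1 else 0)
    (e : Fin (d + 1) → ℤ) (H : (Fin (d + 1) → ℤ) → (Fin (d + 1) → ℤ) → ℝ) (hH : ∀ u u', 0 ≤ H u u')
    (hGhol : ∀ u u' w, ‖(G (u + e) w - G u w) - (G (u' + e) w - G u' w)‖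
      ≤ H u u' * (Real.exp (-(κ * supNorm (u - w))) + Real.exp (-(κ * supNorm (u' - w)))))
    (GB : Matrix ↥(boxDom N) ↥(boxDom N) ℂ)
    (hGB : (Matrix.of fun x y : ↥(boxDom N) => opBoxK c₁ msq a b N x.1 y.1) * GB = 1)
    (x xe y ye x' : ↥(boxDom N)) (hxe : xe.1 = x.1 + e) (hye : ye.1 = y.1 + e) :
    ‖(GB xe x' - GB x x') - (GB ye x' - GB y x')‖
      ≤ H x.1 y.1 * boxConst κ d N
        * (Real.exp (-(κ / (d + 1) * supNorm (x.1 - x'.1))) + Real.exp (-(κ / (d + 1) * supNorm (y.1 - x'.1)))) :=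
  greenBox_holder_decay_unif hN hb hbN c₁ msq a hκ hM hGdec
    (green_reflBox_invariant hb hbN c₁ msq a hκ hM hGdec hGreen hGreenR) hGreen e H hH hGhol GB hGB
    x xe y ye x' hxe hye

end Covariance


/-! ## §8  The method of images commutes with `Q_j^*`: (2.35), first two quantities, for `G_j(□)Q_j^*` (v5, append-only)

Lemma 2.4 is stated for the kernels of `G_j(□)Q_j^*` and `∂^ξ_μ G_j(□)Q_j^*` (`x ∈ □` a fine point, `y ∈ □^{(j)} = □ ∩ ℤ^d`
a unit-lattice point), i.e. for the BLOCK SUMS `Σ_{x' ∈ B(y)} G_j(□)(x,x')` of the box kernel over the unit block with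
label `y` (B4 (1.4): `Q_j^*g` is constant on blocks; the `ξ^d`-weights of the inner products are constants absorbed in
`c₀`).  For a box of `N_μ = b·M_μ` fine sites (`M_μ` unit blocks of `b = L^j` sites) the image maps act on block LABELS
by the image maps of the unit box `Π_μ [0,M_μ)`: `blk ∘ σ_{ε,m} = σ̃_{ε,m} ∘ blk` (`blk_reflBox_mul`), so the block
sum of the image sum is the image sum — over the UNIT-LATTICE reflection group — of the block-summed free kernel
`K(x,y') = Σ_{w : blk w = y'} G(x,w)` (`= (G_jQ_j^*)(x,y')` on `ξZ^d`): `Σ_{x' ∈ B(y)} G_□(x,x') = Σ_{(ε,m)} K(x, σ̃_{ε,m}y)`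
(`blockSum_imK_eq`).  Consequently a decay bound for `K` at UNIT rate `κ₀` in `|blk x - y'|_∞` — the shape in which
(2.35) for `G_jQ_j^*` on the infinite lattice is naturally stated and certified — gives (2.35) for `G_j(□)Q_j^*` with the
constant `boxConst κ₀ d M ≤ 2^{d+1}(1 + 2/(1 - e^{-2κ₀/(d+1)}))^{d+1}` (`boxConst_le_one`) and rate `κ₀/(d+1)`, uniformly
in `j` and `□` with no `κ = δ₀ξ` bookkeeping at all (`greenBoxQ_decay_unif`; first differences `greenBoxQ_deriv_decay_unif`). -/

section QStar

open Literature.MathematicalPhysics.QuantumFieldTheory.Balaban1983to89.B4ContourShift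
open Literature.MathematicalPhysics.QuantumFieldTheory.Balaban1983to89.B4TorusKernel.MultiPeriod

variable {d : ℕ}

/-! ### Blocks by label; the image maps act on labels -/

/-- the unit block with LABEL `y`: `{z | blk b z = y} = Π_μ [b y_μ, b y_μ + b)`. [cite: Balaban1983RegularityDecay,
p. 572 (1.4), dictionary] -/
noncomputable def blockL (b : ℕ) (y : Fin (d + 1) → ℤ) : Finset (Fin (d + 1) → ℤ) :=
  Fintype.piFinset fun i => Finset.Ico ((b : ℤ) * y i) ((b : ℤ) * y i + b)

/-- the label of the corner `b·y` is `y`. [folklore] -/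
theorem blk_mul {b : ℕ} (hb : 1 ≤ b) (y : Fin (d + 1) → ℤ) : blk b (fun i => (b : ℤ) * y i) = y := by
  have hb' : (0 : ℤ) < b := by exact_mod_cast hb
  funext i
  simp only [blk]
  exact Int.mul_ediv_cancel_left _ hb'.ne'

/-- `blockOf b x` is the block with label `blk b x`. [folklore] -/
theorem blockOf_eq_blockL (b : ℕ) (x : Fin (d + 1) → ℤ) : blockOf b x = blockL b (blk b x) := rfl

/-- membership in the block with label `y`. [folklore] -/
theorem mem_blockL {b : ℕ} (hb : 1 ≤ b) {y z : Fin (d + 1) → ℤ} : z ∈ blockL b y ↔ blk b z = y := by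
  have h := mem_blockOf hb (x := fun i => (b : ℤ) * y i) (z := z)
  rw [blockOf_eq_blockL, blk_mul hb] at h
  exact h

/-- **THE IMAGE MAPS ACT ON BLOCK LABELS BY THE IMAGE MAPS OF THE UNIT BOX**: for the box of `N_μ = b·M_μ` fine sites,
`blk (σ_{ε,m} z) = σ̃_{ε,m} (blk z)` with `σ̃` the image map of `Π_μ [0,M_μ)` on the unit lattice. [folklore] -/
theorem blk_reflBox_mul {b : ℕ} (hb : 1 ≤ b) (M : Fin (d + 1) → ℕ) (ε : Fin (d + 1) → Bool)
    (m z : Fin (d + 1) → ℤ) : blk b (reflBox (fun i => b * M i) ε m z) = reflBox M ε m (blk b z) := by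
  have hb' : (0 : ℤ) < b := by exact_mod_cast hb
  funext i
  have hbN : (b : ℤ) ∣ ((b * M i : ℕ) : ℤ) := ⟨M i, by push_cast; ring⟩
  have hq : ((b * M i : ℕ) : ℤ) / (b : ℤ) = (M i : ℤ) := by
    push_cast
    exact Int.mul_ediv_cancel_left _ hb'.ne'
  simp only [blk, reflBox_apply]
  rw [ediv_refl1Fun hb hbN, hq]
  simp only [refl1Fun]

/-- the image maps carry the block with label `y` onto the block with label `σ̃ y`. [folklore] -/
theorem blockL_image_reflBox {b : ℕ} (hb : 1 ≤ b) (M : Fin (d + 1) → ℕ) (ε : Fin (d + 1) → Bool)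
    (m y : Fin (d + 1) → ℤ) :
    (blockL b y).image (reflBox (fun i => b * M i) ε m) = blockL b (reflBox M ε m y) := by
  classical
  ext w
  simp only [Finset.mem_image, mem_blockL hb]
  constructor
  · rintro ⟨z, hz, rfl⟩
    rw [blk_reflBox_mul hb, hz]
  · intro hw
    refine ⟨(reflBox (fun i => b * M i) ε m).symm w, ?_, Equiv.apply_symm_apply _ _⟩
    have h := blk_reflBox_mul hb M ε m ((reflBox (fun i => b * M i) ε m).symm w)
    rw [Equiv.apply_symm_apply, hw] at h
    exact ((reflBox M ε m).injective h).symm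

/-- blocks with labels in the unit box lie in the fine box. [folklore] -/
theorem blockL_subset_boxDom {b : ℕ} (hb : 1 ≤ b) {M : Fin (d + 1) → ℕ} {y : Fin (d + 1) → ℤ}
    (hy : y ∈ boxDom M) : blockL b y ⊆ boxDom (fun i => b * M i) := by
  have hb' : (0 : ℤ) < b := by exact_mod_cast hb
  intro z hz
  rw [mem_boxDom] at hy ⊢
  simp only [blockL, Fintype.mem_piFinset, Finset.mem_Ico] at hz
  intro i
  obtain ⟨h1, h2⟩ := hz i
  obtain ⟨h3, h4⟩ := hy i
  refine ⟨?_, ?_⟩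
  · nlinarith
  · have h5 : y i + 1 ≤ M i := by omega
    push_cast
    nlinarith

/-- the label of a fine box point lies in the unit box. [folklore] -/
theorem blk_mem_boxDom {b : ℕ} (hb : 1 ≤ b) {M : Fin (d + 1) → ℕ} {x : Fin (d + 1) → ℤ}
    (hx : x ∈ boxDom (fun i => b * M i)) : blk b x ∈ boxDom M := by
  have hb' : (0 : ℤ) < b := by exact_mod_cast hb
  rw [mem_boxDom] at hx ⊢
  intro i
  obtain ⟨h1, h2⟩ := hx i
  simp only [blk]
  refine ⟨Int.ediv_nonneg h1 hb'.le, ?_⟩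
  rw [Int.ediv_lt_iff_lt_mul hb']
  push_cast at h2
  linarith

/-! ### The block sum of the image sum is the image sum of the block sum -/

/-- the image sum over the fibre of a box point, written over the parameters `(ε, m)`. [folklore] -/
theorem imK_box_eq_tsum {N : Fin (d + 1) → ℕ} (hN : ∀ i, 1 ≤ N i) (K : (Fin (d + 1) → ℤ) → (Fin (d + 1) → ℤ) → ℂ)
    (x : Fin (d + 1) → ℤ) {x' : Fin (d + 1) → ℤ} (hx' : x' ∈ boxDom N) :
    (box N hN).imK K x x' = ∑' p : (Fin (d + 1) → Bool) × (Fin (d + 1) → ℤ), K x (reflBox N p.1 p.2 x') := by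
  have hfx' : foldBox N x' = x' := (mem_boxDom_iff_fold hN x').1 hx'
  unfold ImageSystem.imK
  rw [← (fibParam hN hfx').tsum_eq (fun w : (box N hN).Fib x' => K x w.1)]
  simp only [fibParam_apply_coe]

/-- **THE METHOD OF IMAGES COMMUTES WITH `Q_j^*`**: for the box of `N_μ = b·M_μ` fine sites, `x` a fine box point and
`y` a label in the unit box, `Σ_{x' ∈ B(y)} G_□(x,x') = Σ_{(ε,m)} K(x, σ̃_{ε,m} y)` where `G_□ = imK G` is the image
sum of `G` (the box propagator, `greenBox_unique`) and `K(x,y') = Σ_{w ∈ B(y')} G(x,w)` its block sum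
(`(G_jQ_j^*)(x,y')` on `ξZ^d`).  [cite: Balaban1983RegularityDecay, p. 584 (2.42) with p. 582 (2.35), dictionary]
[folklore] -/
theorem blockSum_imK_eq {b : ℕ} (hb : 1 ≤ b) {M : Fin (d + 1) → ℕ} (hM : ∀ i, 1 ≤ M i)
    (hN : ∀ i, 1 ≤ (fun i => b * M i) i) {G : (Fin (d + 1) → ℤ) → (Fin (d + 1) → ℤ) → ℂ} {κ MG : ℝ}
    (hκ : 0 < κ) (hMG : 0 ≤ MG) (hGdec : ∀ u w, ‖G u w‖ ≤ MG * Real.exp (-(κ * supNorm (u - w))))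
    {x : Fin (d + 1) → ℤ} (hx : x ∈ boxDom (fun i => b * M i)) {y : Fin (d + 1) → ℤ} (hy : y ∈ boxDom M) :
    ∑ x' ∈ blockL b y, (box (fun i => b * M i) hN).imK G x x'
      = (box M hM).imK (fun u w => ∑ z ∈ blockL b w, G u z) x y := by
  classical
  have hsub := blockL_subset_boxDom hb hy
  have h1 : ∑ x' ∈ blockL b y, (box (fun i => b * M i) hN).imK G x x'
      = ∑ x' ∈ blockL b y, ∑' p : (Fin (d + 1) → Bool) × (Fin (d + 1) → ℤ),
          G x (reflBox (fun i => b * M i) p.1 p.2 x') :=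
    Finset.sum_congr rfl fun x' hx' => imK_box_eq_tsum hN G x (hsub hx')
  have h2 : ∀ x' ∈ blockL b y, Summable (fun p : (Fin (d + 1) → Bool) × (Fin (d + 1) → ℤ) =>
      G x (reflBox (fun i => b * M i) p.1 p.2 x')) := fun x' hx' =>
    Summable.of_norm (summable_norm_images_unif hN hκ hMG hGdec hx (hsub hx')).1
  have h3 : ∀ p : (Fin (d + 1) → Bool) × (Fin (d + 1) → ℤ),
      ∑ x' ∈ blockL b y, G x (reflBox (fun i => b * M i) p.1 p.2 x')
        = ∑ z ∈ blockL b (reflBox M p.1 p.2 y), G x z := by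
    intro p
    rw [← blockL_image_reflBox hb M p.1 p.2 y,
      Finset.sum_image ((reflBox (fun i => b * M i) p.1 p.2).injective.injOn)]
  rw [h1, ← Summable.tsum_finsetSum h2, imK_box_eq_tsum hM _ x hy]
  exact tsum_congr h3

/-! ### (2.35) for `G_j(□)Q_j^*` from a unit-rate bound on the block-summed free kernel -/

/-- the image sum, over the unit box, of a kernel decaying at unit rate `κ₀` in `|blk x - y'|_∞` obeys the box bound with
constant `boxConst κ₀ d M` and rate `κ₀/(d+1)`. [folklore] -/
theorem norm_imK_label_le {b : ℕ} {M : Fin (d + 1) → ℕ} (hM : ∀ i, 1 ≤ M i)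
    {K : (Fin (d + 1) → ℤ) → (Fin (d + 1) → ℤ) → ℂ} {κ₀ MK : ℝ} (hκ₀ : 0 < κ₀) (hMK : 0 ≤ MK)
    (x : Fin (d + 1) → ℤ) (hKdec : ∀ w, ‖K x w‖ ≤ MK * Real.exp (-(κ₀ * supNorm (blk b x - w))))
    (hx : blk b x ∈ boxDom M) {y : Fin (d + 1) → ℤ} (hy : y ∈ boxDom M) :
    Summable (fun w : (box M hM).Fib y => ‖K x w.1‖) ∧
      ‖(box M hM).imK K x y‖ ≤ MK * boxConst κ₀ d M * Real.exp (-(κ₀ / (d + 1) * supNorm (blk b x - y))) := by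
  obtain ⟨hs, hle⟩ := tsum_fib_majorant_unif hM hκ₀ hMK hx hy
  have h1 : ∀ w : (box M hM).Fib y, ‖K x w.1‖ ≤ MK * Real.exp (-(κ₀ * supNorm (blk b x - w.1))) :=
    fun w => hKdec w.1
  have hs' : Summable (fun w : (box M hM).Fib y => ‖K x w.1‖) :=
    Summable.of_nonneg_of_le (fun _ => norm_nonneg _) h1 hs
  refine ⟨hs', ?_⟩
  unfold ImageSystem.imK
  calc ‖∑' w : (box M hM).Fib y, K x w.1‖ ≤ ∑' w : (box M hM).Fib y, ‖K x w.1‖ := norm_tsum_le_tsum_norm hs'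
    _ ≤ ∑' w : (box M hM).Fib y, MK * Real.exp (-(κ₀ * supNorm (blk b x - w.1))) :=
        Summable.tsum_le_tsum h1 hs' hs
    _ ≤ _ := hle

/-- the box constant at unit rate is uniform in the box: `boxConst κ₀ d M ≤ 2^{d+1}(1 + 2/(1 - e^{-2κ₀/(d+1)}))^{d+1}`
for every unit box (`M_μ ≥ 1`). [folklore] -/
theorem boxConst_le_one {κ₀ : ℝ} (hκ₀ : 0 < κ₀) {M : Fin (d + 1) → ℕ} (hM : ∀ i, 1 ≤ M i) :
    boxConst κ₀ d M ≤ 2 ^ (d + 1) * (1 + 2 / (1 - Real.exp (-(2 * (κ₀ / (d + 1)))))) ^ (d + 1) := by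
  have hc : 0 < κ₀ / (d + 1) := by positivity
  refine boxConst_le hκ₀ hc hM fun i => ?_
  have h1 : (1 : ℝ) ≤ M i := by exact_mod_cast hM i
  nlinarith

/-- the block sum over the box, `Σ_{x' ∈ □, blk x' = y}`, is the block sum over `B(y)` for labels in the unit box.
[folklore] -/
theorem sum_boxDom_ite_blk_eq {b : ℕ} (hb : 1 ≤ b) {M : Fin (d + 1) → ℕ}
    (f : (Fin (d + 1) → ℤ) → ℂ) {y : Fin (d + 1) → ℤ} (hy : y ∈ boxDom M) :
    ∑ x' : ↥(boxDom (fun i => b * M i)), (if blk b x'.1 = y then f x'.1 else 0) = ∑ z ∈ blockL b y, f z := by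
  classical
  rw [Finset.univ_eq_attach, Finset.sum_attach (boxDom (fun i => b * M i)) (fun z => if blk b z = y then f z else 0),
    ← Finset.sum_filter]
  refine Finset.sum_congr ?_ fun _ _ => rfl
  ext z
  simp only [Finset.mem_filter, mem_blockL hb]
  constructor
  · rintro ⟨_, hz⟩; exact hz
  · intro hz; exact ⟨blockL_subset_boxDom hb hy ((mem_blockL hb).2 hz), hz⟩

/-- **(2.35), FIRST QUANTITY, FOR `G_j(□)Q_j^*`, UNIFORMLY IN `j` AND `□`.**  Box of `N_μ = b·M_μ` fine sites; `G` the
free propagator on the fine lattice: (i) two-sided inverse of the free operator (2.44) (`hGreen`, `hGreenR`), (iii)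
exponential decay at some fine rate `κ > 0` (used qualitatively: summability and uniqueness), and (iii-Q) ITS BLOCK
SUM `K(u,w) = Σ_{z ∈ B(w)} G(u,z)` (`= (G_jQ_j^*)(u,w)`) DECAYS AT UNIT RATE: `‖K(u,w)‖ ≤ M_K e^{-κ₀|blk u - w|_∞}`.
Then for the (unique) inverse `GB` of the Neumann box operator, every fine box point `x` and every label `y` of the
unit box: `‖Σ_{x' ∈ □, blk x' = y} GB(x,x')‖ ≤ M_K · boxConst κ₀ d M · e^{-(κ₀/(d+1))|blk x - y|_∞}`, and
`boxConst κ₀ d M ≤ 2^{d+1}(1 + 2/(1 - e^{-2κ₀/(d+1)}))^{d+1}` (`boxConst_le_one`) — constants independent of the box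
and of `b = L^j`.  [cite: Balaban1983RegularityDecay, p. 582 Lemma 2.4 (2.35) first quantity, p. 584 (2.42),
dictionary] -/
theorem greenBoxQ_decay_unif {b : ℕ} (hb : 1 ≤ b) {M : Fin (d + 1) → ℕ} (hM : ∀ i, 1 ≤ M i)
    (hN : ∀ i, 1 ≤ (fun i => b * M i) i) (c₁ msq a : ℂ) {G : (Fin (d + 1) → ℤ) → (Fin (d + 1) → ℤ) → ℂ}
    {κ MG : ℝ} (hκ : 0 < κ) (hMG : 0 ≤ MG) (hGdec : ∀ u w, ‖G u w‖ ≤ MG * Real.exp (-(κ * supNorm (u - w))))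
    (hGreen : ∀ x x', ∑ z ∈ opSupp b x, opK c₁ msq a b x z * G z x' = if x = x' then 1 else 0)
    (hGreenR : ∀ x x', ∑ z ∈ opSupp b x', G x z * opK c₁ msq a b z x' = if x = x' then 1 else 0)
    {κ₀ MK : ℝ} (hκ₀ : 0 < κ₀) (hMK : 0 ≤ MK)
    (hKdec : ∀ u w, ‖∑ z ∈ blockL b w, G u z‖ ≤ MK * Real.exp (-(κ₀ * supNorm (blk b u - w))))
    (GB : Matrix ↥(boxDom (fun i => b * M i)) ↥(boxDom (fun i => b * M i)) ℂ)
    (hGB : (Matrix.of fun x y : ↥(boxDom (fun i => b * M i)) => opBoxK c₁ msq a b (fun i => b * M i) x.1 y.1) * GB = 1)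
    (x : ↥(boxDom (fun i => b * M i))) {y : Fin (d + 1) → ℤ} (hy : y ∈ boxDom M) :
    ‖∑ x' : ↥(boxDom (fun i => b * M i)), (if blk b x'.1 = y then GB x x' else 0)‖
      ≤ MK * boxConst κ₀ d M * Real.exp (-(κ₀ / (d + 1) * supNorm (blk b x.1 - y))) := by
  classical
  have hbN : ∀ i, (b : ℤ) ∣ (((fun i => b * M i) i : ℕ) : ℤ) := fun i => ⟨M i, by push_cast; ring⟩
  rw [greenBox_unique hN hb hbN c₁ msq a hκ hMG hGdec
    (green_reflBox_invariant hb hbN c₁ msq a hκ hMG hGdec hGreen hGreenR) hGreen GB hGB]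
  simp only [Matrix.of_apply]
  rw [sum_boxDom_ite_blk_eq hb (fun z => (box (fun i => b * M i) hN).imK G x.1 z) hy,
    blockSum_imK_eq hb hM hN hκ hMG hGdec x.2 hy]
  exact (norm_imK_label_le hM hκ₀ hMK x.1 (hKdec x.1) (blk_mem_boxDom hb x.2) hy).2

/-- **(2.35), SECOND QUANTITY (first differences), FOR `G_j(□)Q_j^*`, UNIFORMLY IN `j` AND `□`**: if moreover (iv-Q)
`‖K(u+e,w) - K(u,w)‖ ≤ M₁ e^{-κ₀|blk u - w|_∞}` for a lattice vector `e`, then for fine box points `x`, `x + e` and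
every label `y` of the unit box `‖Σ_{x' ∈ □, blk x' = y} (GB(x+e,x') - GB(x,x'))‖ ≤ M₁ · boxConst κ₀ d M ·
e^{-(κ₀/(d+1))|blk x - y|_∞}`.  [cite: Balaban1983RegularityDecay, p. 582 Lemma 2.4 (2.35) second quantity, p. 584
(2.42), dictionary] -/
theorem greenBoxQ_deriv_decay_unif {b : ℕ} (hb : 1 ≤ b) {M : Fin (d + 1) → ℕ} (hM : ∀ i, 1 ≤ M i)
    (hN : ∀ i, 1 ≤ (fun i => b * M i) i) (c₁ msq a : ℂ) {G : (Fin (d + 1) → ℤ) → (Fin (d + 1) → ℤ) → ℂ}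
    {κ MG : ℝ} (hκ : 0 < κ) (hMG : 0 ≤ MG) (hGdec : ∀ u w, ‖G u w‖ ≤ MG * Real.exp (-(κ * supNorm (u - w))))
    (hGreen : ∀ x x', ∑ z ∈ opSupp b x, opK c₁ msq a b x z * G z x' = if x = x' then 1 else 0)
    (hGreenR : ∀ x x', ∑ z ∈ opSupp b x', G x z * opK c₁ msq a b z x' = if x = x' then 1 else 0)
    {κ₀ MK M₁ : ℝ} (hκ₀ : 0 < κ₀) (hMK : 0 ≤ MK) (hM₁ : 0 ≤ M₁)
    (hKdec : ∀ u w, ‖∑ z ∈ blockL b w, G u z‖ ≤ MK * Real.exp (-(κ₀ * supNorm (blk b u - w))))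
    (e : Fin (d + 1) → ℤ)
    (hKder : ∀ u w, ‖∑ z ∈ blockL b w, G (u + e) z - ∑ z ∈ blockL b w, G u z‖
      ≤ M₁ * Real.exp (-(κ₀ * supNorm (blk b u - w))))
    (GB : Matrix ↥(boxDom (fun i => b * M i)) ↥(boxDom (fun i => b * M i)) ℂ)
    (hGB : (Matrix.of fun x y : ↥(boxDom (fun i => b * M i)) => opBoxK c₁ msq a b (fun i => b * M i) x.1 y.1) * GB = 1)
    (x xe : ↥(boxDom (fun i => b * M i))) (hxe : xe.1 = x.1 + e) {y : Fin (d + 1) → ℤ} (hy : y ∈ boxDom M) :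
    ‖∑ x' : ↥(boxDom (fun i => b * M i)), (if blk b x'.1 = y then GB xe x' - GB x x' else 0)‖
      ≤ M₁ * boxConst κ₀ d M * Real.exp (-(κ₀ / (d + 1) * supNorm (blk b x.1 - y))) := by
  classical
  have hbN : ∀ i, (b : ℤ) ∣ (((fun i => b * M i) i : ℕ) : ℤ) := fun i => ⟨M i, by push_cast; ring⟩
  set K : (Fin (d + 1) → ℤ) → (Fin (d + 1) → ℤ) → ℂ := fun u w => ∑ z ∈ blockL b w, G u z with hK
  have hsplit : ∑ x' : ↥(boxDom (fun i => b * M i)), (if blk b x'.1 = y then GB xe x' - GB x x' else 0)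
      = ∑ x' : ↥(boxDom (fun i => b * M i)), (if blk b x'.1 = y then GB xe x' else 0)
        - ∑ x' : ↥(boxDom (fun i => b * M i)), (if blk b x'.1 = y then GB x x' else 0) := by
    rw [← Finset.sum_sub_distrib]
    refine Finset.sum_congr rfl fun x' _ => ?_
    split_ifs <;> simp
  rw [hsplit, greenBox_unique hN hb hbN c₁ msq a hκ hMG hGdec
    (green_reflBox_invariant hb hbN c₁ msq a hκ hMG hGdec hGreen hGreenR) hGreen GB hGB]
  simp only [Matrix.of_apply]
  rw [sum_boxDom_ite_blk_eq hb (fun z => (box (fun i => b * M i) hN).imK G xe.1 z) hy,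
    sum_boxDom_ite_blk_eq hb (fun z => (box (fun i => b * M i) hN).imK G x.1 z) hy,
    blockSum_imK_eq hb hM hN hκ hMG hGdec xe.2 hy, blockSum_imK_eq hb hM hN hκ hMG hGdec x.2 hy]
  -- both image sums converge absolutely; their difference is the image sum of the difference kernel
  have hxeM : blk b xe.1 ∈ boxDom M := blk_mem_boxDom hb xe.2
  have hxM : blk b x.1 ∈ boxDom M := blk_mem_boxDom hb x.2
  have hK1 : ∀ w, ‖K xe.1 w‖ ≤ MK * Real.exp (-(κ₀ * supNorm (blk b xe.1 - w))) :=
    fun w => by simpa only [hK] using hKdec xe.1 w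
  have hK2 : ∀ w, ‖K x.1 w‖ ≤ MK * Real.exp (-(κ₀ * supNorm (blk b x.1 - w))) :=
    fun w => by simpa only [hK] using hKdec x.1 w
  have hs1 := (norm_imK_label_le hM hκ₀ hMK xe.1 hK1 hxeM hy).1
  have hs2 := (norm_imK_label_le hM hκ₀ hMK x.1 hK2 hxM hy).1
  have hD : ∀ w, ‖(fun u w => K (u + e) w - K u w) x.1 w‖ ≤ M₁ * Real.exp (-(κ₀ * supNorm (blk b x.1 - w))) :=
    fun w => by simpa only [hK] using hKder x.1 w
  have h3 := norm_imK_label_le (K := fun u w => K (u + e) w - K u w) hM hκ₀ hM₁ x.1 hD hxM hy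
  have hdiff : (box M hM).imK K xe.1 y - (box M hM).imK K x.1 y
      = (box M hM).imK (fun u w => K (u + e) w - K u w) x.1 y := by
    unfold ImageSystem.imK
    rw [← Summable.tsum_sub (Summable.of_norm hs1) (Summable.of_norm hs2)]
    refine tsum_congr fun w => ?_
    rw [hxe]
  rw [hdiff]
  exact h3.2

end QStar


/-! ## §9  Images on the SOURCE variable: (2.42) for `G_j(□)Q_j^*` straight from the infinite-volume identity
`(-Δ^ξ + m² + aQ^*Q) K(·,y) = Q^*δ_y` and the decay of `K = G_jQ_j^*` — no fine `G_j` needed (v6, append-only)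

§8 wrote `(G_j(□)Q_j^*)(x,y) = Σ_{x' ∈ B(y)} G_□(x,x')` as the unit-lattice image sum of the block-summed FREE
kernel and therefore needed the free fine propagator `G` ((i) two-sided, (iii)).  Here the images are put on the
SOURCE variable instead: `Σ_{x' ∈ B(y)} G_□(x,x') = Σ_{(ε,m)} K(σ_{ε,m} x, y)` for ANY kernel `K(u,y)` (`u` fine, `y`
a unit label) which (α) solves the basic equation (2.44) with right-hand side `Q_j^*δ_y` on the whole fine lattice,
`Σ_{z} opK(u,z) K(z,y) = 1_{blk u = y}` — the shape of `B4Green244.green244`, PROVED there for the kernel (2.48) —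
and (β) has a summable image series (e.g. decays at unit rate in `|blk u - y|_∞`, the shape of `B4Green244.K_decay`),
and for ANY inverse `GB` of the Neumann box operator (`opBox_mul_srcImages`, `greenBoxQ_srcImages`).  Ingredients:
the image maps form a GROUP acting on the parameters (`reflBox_comp`, `compParam`) — so the source image series is
the same at all points of a fibre (`srcImages_reflBox`) —, the covariance `opK ∘ (σ×σ) = opK` of §7 and
`σ(opSupp u) = opSupp (σu)`, and the fibre count `#{(ε,m) | σ_{ε,m}x ∈ B(y)} = 1_{blk x = y}` for `x ∈ □`,
`B(y) ⊆ □`.  With (β) at unit rate `κ₀`: (2.35), first quantity, for `G_j(□)Q_j^*` (`greenBoxQ_decay_src`), and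
with the `±e_μ` first-difference bound on `K` the second quantity (`greenBoxQ_deriv_decay_src`; a reflection may
flip `e_μ`), constants `boxConst κ₀ d M ≤ 2^{d+1}(1 + 2/(1 - e^{-2κ₀/(d+1)}))^{d+1}`, rate `κ₀/(d+1)` — the box
transfer of Lemma 2.4 for `G_j(□)Q_j^*` from EXACTLY the two properties of `G_jQ_j^*` certified in the b04 lineage
(modulo the finite-sum dictionary `opD ↔ opK`, not made in this file). -/

section SourceImages

open Literature.MathematicalPhysics.QuantumFieldTheory.Balaban1983to89.B4ContourShift
open Literature.MathematicalPhysics.QuantumFieldTheory.Balaban1983to89.B4TorusKernel.MultiPeriod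

variable {d : ℕ}

/-! ### The image maps form a group: composition and inversion on the parameters -/

/-- reflection bit of a composite: exclusive or. [folklore] -/
def compBit (b b₀ : Bool) : Bool := if b then !b₀ else b₀

/-- translation part of a composite. [folklore] -/
def compMul (b : Bool) (m m₀ : ℤ) : ℤ := if b then m - m₀ else m + m₀

/-- COMPOSITION OF 1-D IMAGE MAPS: `r_{b,m} ∘ r_{b₀,m₀} = r_{b ⊻ b₀, m ∓ m₀}`. [folklore] -/
theorem refl1Fun_comp (N : ℕ) (b b₀ : Bool) (m m₀ n : ℤ) :
    refl1Fun N b m (refl1Fun N b₀ m₀ n) = refl1Fun N (compBit b b₀) (compMul b m m₀) n := by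
  cases b <;> cases b₀ <;> simp [refl1Fun, compBit, compMul] <;> ring

/-- the identity image map: `r_{false,0} = id`. [folklore] -/
theorem reflBox_id (N : Fin (d + 1) → ℕ) (x : Fin (d + 1) → ℤ) :
    reflBox N (fun _ => false) (fun _ => 0) x = x := by
  funext i
  simp [reflBox_apply, refl1Fun]

/-- right multiplication by `σ_{ε₀,m₀}` on the parameter set `(ℤ/2)^{d+1} × ℤ^{d+1}` (a bijection). [folklore] -/
def compParam (ε₀ : Fin (d + 1) → Bool) (m₀ : Fin (d + 1) → ℤ) :
    ((Fin (d + 1) → Bool) × (Fin (d + 1) → ℤ)) ≃ ((Fin (d + 1) → Bool) × (Fin (d + 1) → ℤ)) where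
  toFun p := (fun i => compBit (p.1 i) (ε₀ i), fun i => compMul (p.1 i) (p.2 i) (m₀ i))
  invFun q := (fun i => compBit (q.1 i) (ε₀ i), fun i => if compBit (q.1 i) (ε₀ i) then q.2 i + m₀ i else q.2 i - m₀ i)
  left_inv p := by
    obtain ⟨ε, m⟩ := p
    simp only [Prod.mk.injEq]
    refine ⟨funext fun i => ?_, funext fun i => ?_⟩
    · rcases Bool.eq_false_or_eq_true (ε i) with h | h <;>
        rcases Bool.eq_false_or_eq_true (ε₀ i) with h₀ | h₀ <;> simp [compBit, h, h₀]
    · rcases Bool.eq_false_or_eq_true (ε i) with h | h <;>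
        rcases Bool.eq_false_or_eq_true (ε₀ i) with h₀ | h₀ <;> simp [compBit, compMul, h, h₀]
  right_inv q := by
    obtain ⟨ε, m⟩ := q
    simp only [Prod.mk.injEq]
    refine ⟨funext fun i => ?_, funext fun i => ?_⟩
    · rcases Bool.eq_false_or_eq_true (ε i) with h | h <;>
        rcases Bool.eq_false_or_eq_true (ε₀ i) with h₀ | h₀ <;> simp [compBit, h, h₀]
    · rcases Bool.eq_false_or_eq_true (ε i) with h | h <;>
        rcases Bool.eq_false_or_eq_true (ε₀ i) with h₀ | h₀ <;> simp [compBit, compMul, h, h₀]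

/-- COMPOSITION OF THE IMAGE MAPS OF THE BOX: `σ_{ε,m} ∘ σ_{ε₀,m₀} = σ_{compParam (ε₀,m₀) (ε,m)}`. [folklore] -/
theorem reflBox_comp (N : Fin (d + 1) → ℕ) (p : (Fin (d + 1) → Bool) × (Fin (d + 1) → ℤ))
    (ε₀ : Fin (d + 1) → Bool) (m₀ z : Fin (d + 1) → ℤ) :
    reflBox N p.1 p.2 (reflBox N ε₀ m₀ z) = reflBox N (compParam ε₀ m₀ p).1 (compParam ε₀ m₀ p).2 z := by
  funext i
  simp only [reflBox_apply, compParam, Equiv.coe_fn_mk]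
  exact refl1Fun_comp (N i) (p.1 i) (ε₀ i) (p.2 i) (m₀ i) (z i)

/-- THE SOURCE IMAGE SERIES IS CONSTANT ON FIBRES: `Σ_{(ε,m)} f(σ_{ε,m}(σ₀ z)) = Σ_{(ε,m)} f(σ_{ε,m} z)`
(re-indexing by right multiplication with `σ₀`; no summability needed). [folklore] -/
theorem srcImages_reflBox {α : Type*} [AddCommMonoid α] [TopologicalSpace α] (N : Fin (d + 1) → ℕ) (f : (Fin (d + 1) → ℤ) → α)
    (ε₀ : Fin (d + 1) → Bool) (m₀ z : Fin (d + 1) → ℤ) :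
    ∑' p : (Fin (d + 1) → Bool) × (Fin (d + 1) → ℤ), f (reflBox N p.1 p.2 (reflBox N ε₀ m₀ z))
      = ∑' p : (Fin (d + 1) → Bool) × (Fin (d + 1) → ℤ), f (reflBox N p.1 p.2 z) := by
  simp_rw [reflBox_comp]
  exact (compParam ε₀ m₀).tsum_eq (fun q => f (reflBox N q.1 q.2 z))

/-- summability of the source image series is the same at all points of a fibre. [folklore] -/
theorem summable_srcImages_reflBox_iff {α : Type*} [AddCommMonoid α] [TopologicalSpace α] (N : Fin (d + 1) → ℕ)
    (f : (Fin (d + 1) → ℤ) → α) (ε₀ : Fin (d + 1) → Bool) (m₀ z : Fin (d + 1) → ℤ) :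
    Summable (fun p : (Fin (d + 1) → Bool) × (Fin (d + 1) → ℤ) => f (reflBox N p.1 p.2 (reflBox N ε₀ m₀ z)))
      ↔ Summable (fun p : (Fin (d + 1) → Bool) × (Fin (d + 1) → ℤ) => f (reflBox N p.1 p.2 z)) := by
  simp_rw [reflBox_comp]
  exact (compParam ε₀ m₀).summable_iff (f := fun q : (Fin (d + 1) → Bool) × (Fin (d + 1) → ℤ) =>
    f (reflBox N q.1 q.2 z))

/-- in particular the source image series at `z` equals the one at `foldBox N z`. [folklore] -/
theorem srcImages_foldBox {α : Type*} [AddCommMonoid α] [TopologicalSpace α] (N : Fin (d + 1) → ℕ)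
    (f : (Fin (d + 1) → ℤ) → α) (z : Fin (d + 1) → ℤ) :
    ∑' p : (Fin (d + 1) → Bool) × (Fin (d + 1) → ℤ), f (reflBox N p.1 p.2 (foldBox N z))
      = ∑' p : (Fin (d + 1) → Bool) × (Fin (d + 1) → ℤ), f (reflBox N p.1 p.2 z) := by
  conv_rhs => rw [← reflBox_foldBox N z]
  exact (srcImages_reflBox N f (bitsOf N z) (mulsOf N z) (foldBox N z)).symm

/-- the inverse image map has parameters `(ε, m')`, `m'_μ = m_μ` for a reflection and `-m_μ` for a translation:
`σ_{ε,m} (σ_{ε,m'} y) = y`. [folklore] -/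
theorem reflBox_reflBox_inv (N : Fin (d + 1) → ℕ) (ε : Fin (d + 1) → Bool) (m y : Fin (d + 1) → ℤ) :
    reflBox N ε m (reflBox N ε (fun i => if ε i then m i else -m i) y) = y := by
  funext i
  simp only [reflBox_apply, refl1Fun]
  rcases Bool.eq_false_or_eq_true (ε i) with h | h <;> simp [h]

/-- inversion on the parameter set (an involution). [folklore] -/
def invParam : ((Fin (d + 1) → Bool) × (Fin (d + 1) → ℤ)) ≃ ((Fin (d + 1) → Bool) × (Fin (d + 1) → ℤ)) where
  toFun p := (p.1, fun i => if p.1 i then p.2 i else -p.2 i)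
  invFun p := (p.1, fun i => if p.1 i then p.2 i else -p.2 i)
  left_inv p := by
    obtain ⟨ε, m⟩ := p
    simp only [Prod.mk.injEq, true_and]
    funext i
    split_ifs <;> simp
  right_inv p := by
    obtain ⟨ε, m⟩ := p
    simp only [Prod.mk.injEq, true_and]
    funext i
    split_ifs <;> simp

/-- moving an image map from the source to the target inside the sup norm: `|σ_{ε,m} u - y|_∞ = |u - σ_{ε,m}⁻¹ y|_∞`
(the image maps are isometries). [folklore] -/
theorem supNorm_reflBox_src (N : Fin (d + 1) → ℕ) (ε : Fin (d + 1) → Bool) (m u y : Fin (d + 1) → ℤ) :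
    supNorm (reflBox N ε m u - y) = supNorm (u - reflBox N ε (fun i => if ε i then m i else -m i) y) := by
  conv_lhs => rw [← reflBox_reflBox_inv N ε m y]
  exact supNorm_reflBox_sub N ε m u _

/-! ### The majorant of the source image series -/

/-- the exponential majorant summed over the SOURCE images: for `u, y` in the unit box,
`Σ_{(ε,m)} M e^{-κ₀|σ̃_{ε,m} u - y|_∞} ≤ M · boxConst κ₀ d M · e^{-(κ₀/(d+1))|u - y|_∞}` (by inversion this is the
target-image sum of §6). [folklore] -/
theorem tsum_srcMajorant_unif {M : Fin (d + 1) → ℕ} (hM : ∀ i, 1 ≤ M i) {κ₀ MK : ℝ} (hκ₀ : 0 < κ₀) (hMK : 0 ≤ MK)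
    {u y : Fin (d + 1) → ℤ} (hu : u ∈ boxDom M) (hy : y ∈ boxDom M) :
    Summable (fun p : (Fin (d + 1) → Bool) × (Fin (d + 1) → ℤ) =>
        MK * Real.exp (-(κ₀ * supNorm (reflBox M p.1 p.2 u - y)))) ∧
      ∑' p : (Fin (d + 1) → Bool) × (Fin (d + 1) → ℤ), MK * Real.exp (-(κ₀ * supNorm (reflBox M p.1 p.2 u - y)))
        ≤ MK * boxConst κ₀ d M * Real.exp (-(κ₀ / (d + 1) * supNorm (u - y))) := by
  -- the target-image sum of §6, in parameter form
  set K₀ : (Fin (d + 1) → ℤ) → (Fin (d + 1) → ℤ) → ℂ :=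
    fun v w => ((MK * Real.exp (-(κ₀ * supNorm (v - w))) : ℝ) : ℂ) with hK₀
  have hnorm : ∀ v w, ‖K₀ v w‖ = MK * Real.exp (-(κ₀ * supNorm (v - w))) := fun v w => by
    rw [hK₀, Complex.norm_real, Real.norm_eq_abs, abs_of_nonneg (by positivity)]
  obtain ⟨hs, hb⟩ := summable_norm_images_unif hM hκ₀ hMK (fun v w => (hnorm v w).le) hu hy
  simp only [hnorm] at hs hb
  -- inversion `p ↦ p⁻¹` carries the source sum to the target sum
  have e : (fun p : (Fin (d + 1) → Bool) × (Fin (d + 1) → ℤ) =>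
        MK * Real.exp (-(κ₀ * supNorm (reflBox M p.1 p.2 u - y))))
      = fun p : (Fin (d + 1) → Bool) × (Fin (d + 1) → ℤ) =>
          (fun q : (Fin (d + 1) → Bool) × (Fin (d + 1) → ℤ) =>
            MK * Real.exp (-(κ₀ * supNorm (u - reflBox M q.1 q.2 y)))) (invParam p) := by
    funext p
    simp only [invParam, Equiv.coe_fn_mk, supNorm_reflBox_src]
  rw [e]
  refine ⟨(invParam.summable_iff (f := fun q : (Fin (d + 1) → Bool) × (Fin (d + 1) → ℤ) =>
    MK * Real.exp (-(κ₀ * supNorm (u - reflBox M q.1 q.2 y))))).2 hs, ?_⟩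
  rw [invParam.tsum_eq (fun q : (Fin (d + 1) → Bool) × (Fin (d + 1) → ℤ) =>
    MK * Real.exp (-(κ₀ * supNorm (u - reflBox M q.1 q.2 y))))]
  exact hb

/-- **THE SOURCE IMAGE SERIES OF A UNIT-RATE KERNEL**: if `‖K(u,y)‖ ≤ M_K e^{-κ₀|blk u - y|_∞}` then for a fine box
point `x` and a unit label `y` of the unit box the series `Σ_{(ε,m)} K(σ_{ε,m} x, y)` converges absolutely and is
`≤ M_K · boxConst κ₀ d M · e^{-(κ₀/(d+1))|blk x - y|_∞}` in norm (`blk ∘ σ = σ̃ ∘ blk`, `blk_reflBox_mul`). [folklore] -/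
theorem norm_srcImages_le {b : ℕ} (hb : 1 ≤ b) {M : Fin (d + 1) → ℕ} (hM : ∀ i, 1 ≤ M i)
    {f : (Fin (d + 1) → ℤ) → ℂ} {κ₀ MK : ℝ} (hκ₀ : 0 < κ₀) (hMK : 0 ≤ MK) {y : Fin (d + 1) → ℤ} (hy : y ∈ boxDom M)
    (hf : ∀ u, ‖f u‖ ≤ MK * Real.exp (-(κ₀ * supNorm (blk b u - y))))
    {x : Fin (d + 1) → ℤ} (hx : x ∈ boxDom (fun i => b * M i)) :
    Summable (fun p : (Fin (d + 1) → Bool) × (Fin (d + 1) → ℤ) => f (reflBox (fun i => b * M i) p.1 p.2 x)) ∧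
      ‖∑' p : (Fin (d + 1) → Bool) × (Fin (d + 1) → ℤ), f (reflBox (fun i => b * M i) p.1 p.2 x)‖
        ≤ MK * boxConst κ₀ d M * Real.exp (-(κ₀ / (d + 1) * supNorm (blk b x - y))) := by
  obtain ⟨hs, hle⟩ := tsum_srcMajorant_unif hM hκ₀ hMK (blk_mem_boxDom hb hx) hy
  have h1 : ∀ p : (Fin (d + 1) → Bool) × (Fin (d + 1) → ℤ), ‖f (reflBox (fun i => b * M i) p.1 p.2 x)‖
      ≤ MK * Real.exp (-(κ₀ * supNorm (reflBox M p.1 p.2 (blk b x) - y))) := fun p => by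
    rw [← blk_reflBox_mul hb M p.1 p.2 x]
    exact hf _
  have hs' : Summable (fun p : (Fin (d + 1) → Bool) × (Fin (d + 1) → ℤ) =>
      ‖f (reflBox (fun i => b * M i) p.1 p.2 x)‖) :=
    Summable.of_nonneg_of_le (fun _ => norm_nonneg _) h1 hs
  refine ⟨Summable.of_norm hs', ?_⟩
  calc ‖∑' p : (Fin (d + 1) → Bool) × (Fin (d + 1) → ℤ), f (reflBox (fun i => b * M i) p.1 p.2 x)‖
      ≤ ∑' p : (Fin (d + 1) → Bool) × (Fin (d + 1) → ℤ), ‖f (reflBox (fun i => b * M i) p.1 p.2 x)‖ :=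
        norm_tsum_le_tsum_norm hs'
    _ ≤ ∑' p : (Fin (d + 1) → Bool) × (Fin (d + 1) → ℤ),
          MK * Real.exp (-(κ₀ * supNorm (reflBox M p.1 p.2 (blk b x) - y))) := Summable.tsum_le_tsum h1 hs' hs
    _ ≤ _ := hle

/-! ### The identity: images on the source variable -/

/-- **`opBox · (Σ_{(ε,m)} K(σ_{ε,m} ·, y)) = 1_{B(y)}` ON THE BOX.**  Box of `N_μ = b·M_μ` fine sites, `y` a unit label
of the unit box; `K(u,y)` any kernel with (α) `Σ_{z ∈ opSupp u} opK(u,z) K(z,y) = 1_{blk u = y}` for all fine `u`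
(the basic equation (2.44) with right-hand side `Q_j^*δ_y`, on the whole fine lattice) and (β) summable source image
series at the box points.  Then `W(z) = Σ_{(ε,m)} K(σ_{ε,m} z, y)` solves the NEUMANN box equation
`Σ_{z ∈ □} opBox(x,z) W(z) = 1_{blk x = y}` (`x ∈ □`).  [cite: Balaban1983RegularityDecay, p. 584 (2.42)/(2.44),
dictionary] [folklore] -/
theorem opBox_mul_srcImages {b : ℕ} (hb : 1 ≤ b) {M : Fin (d + 1) → ℕ} (hN : ∀ i, 1 ≤ (fun i => b * M i) i)
    (c₁ msq a : ℂ) {K : (Fin (d + 1) → ℤ) → (Fin (d + 1) → ℤ) → ℂ} {y : Fin (d + 1) → ℤ} (hy : y ∈ boxDom M)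
    (hDK : ∀ u, ∑ z ∈ opSupp b u, opK c₁ msq a b u z * K z y = if blk b u = y then 1 else 0)
    (hsum : ∀ u, u ∈ boxDom (fun i => b * M i) →
      Summable (fun p : (Fin (d + 1) → Bool) × (Fin (d + 1) → ℤ) => K (reflBox (fun i => b * M i) p.1 p.2 u) y))
    {x : Fin (d + 1) → ℤ} (hx : x ∈ boxDom (fun i => b * M i)) :
    ∑ z ∈ boxDom (fun i => b * M i), opBoxK c₁ msq a b (fun i => b * M i) x z
        * (∑' p : (Fin (d + 1) → Bool) × (Fin (d + 1) → ℤ), K (reflBox (fun i => b * M i) p.1 p.2 z) y)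
      = if blk b x = y then 1 else 0 := by
  classical
  set N : Fin (d + 1) → ℕ := fun i => b * M i with hNdef
  have hbN : ∀ i, (b : ℤ) ∣ (N i : ℤ) := fun i => ⟨M i, by rw [hNdef]; push_cast; ring⟩
  set W : (Fin (d + 1) → ℤ) → ℂ :=
    fun z => ∑' p : (Fin (d + 1) → Bool) × (Fin (d + 1) → ℤ), K (reflBox N p.1 p.2 z) y with hW
  -- (β) everywhere: every site is an image of a box point
  have hsumAll : ∀ u, Summable (fun p : (Fin (d + 1) → Bool) × (Fin (d + 1) → ℤ) => K (reflBox N p.1 p.2 u) y) := by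
    intro u
    rw [← reflBox_foldBox N u, summable_srcImages_reflBox_iff N (fun v => K v y)]
    exact hsum _ (foldBox_mem_boxDom hN u)
  -- step 1: the box operator is the folded operator; unfold and re-sum fibrewise
  have h1 : ∑ z ∈ boxDom N, opBoxK c₁ msq a b N x z * W z
      = ∑ z' ∈ opSupp b x, opK c₁ msq a b x z' * W ((box N hN).fold z') := by
    have e : ∑ z ∈ boxDom N, opBoxK c₁ msq a b N x z * W z
        = ∑ z ∈ boxDom N, (box N hN).foldOp (opK c₁ msq a b) (opSupp b) x z * W z :=
      Finset.sum_congr rfl fun z hz => by rw [foldOp_opK hN hb hbN c₁ msq a hx hz]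
    rw [e]
    unfold ImageSystem.foldOp
    simp_rw [Finset.sum_mul]
    have hmaps : ∀ z' ∈ opSupp b x, (box N hN).fold z' ∈ boxDom N := fun z' _ => foldBox_mem_boxDom hN z'
    rw [← Finset.sum_fiberwise_of_maps_to hmaps]
    refine Finset.sum_congr rfl fun z _ => Finset.sum_congr rfl fun z' hz' => ?_
    rw [(Finset.mem_filter.1 hz').2]
  -- step 2: the source image series is constant on fibres
  have h2 : ∀ z', W ((box N hN).fold z') = W z' := fun z' => by
    rw [hW, box_fold]
    exact srcImages_foldBox N (fun v => K v y) z'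
  -- step 3: exchange the finite sum with the image series
  have h3 : ∑ z' ∈ opSupp b x, opK c₁ msq a b x z' * W z'
      = ∑' p : (Fin (d + 1) → Bool) × (Fin (d + 1) → ℤ), ∑ z' ∈ opSupp b x,
          opK c₁ msq a b x z' * K (reflBox N p.1 p.2 z') y := by
    rw [Summable.tsum_finsetSum (fun z' _ => (hsumAll z').mul_left (opK c₁ msq a b x z'))]
    exact Finset.sum_congr rfl fun z' _ => ((hsumAll z').tsum_mul_left (opK c₁ msq a b x z')).symm
  -- step 4: covariance of the free operator moves the image map onto `x`; then (α) at `σ x`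
  have h4 : ∀ p : (Fin (d + 1) → Bool) × (Fin (d + 1) → ℤ),
      ∑ z' ∈ opSupp b x, opK c₁ msq a b x z' * K (reflBox N p.1 p.2 z') y
        = if blk b (reflBox N p.1 p.2 x) = y then 1 else 0 := by
    intro p
    rw [← hDK (reflBox N p.1 p.2 x), ← opSupp_reflBox hb hbN p.1 p.2 x,
      Finset.sum_image (reflBox N p.1 p.2).injective.injOn]
    refine Finset.sum_congr rfl fun z' _ => ?_
    rw [opK_reflBox hb hbN]
  -- step 5: the fibre count `#{(ε,m) | σ_{ε,m} x ∈ B(y)} = 1_{blk x = y}`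
  set p₀ : (Fin (d + 1) → Bool) × (Fin (d + 1) → ℤ) := (fun _ => false, fun _ => 0) with hp₀
  have h5 : ∀ p : (Fin (d + 1) → Bool) × (Fin (d + 1) → ℤ), p ≠ p₀ →
      (if blk b (reflBox N p.1 p.2 x) = y then (1 : ℂ) else 0) = 0 := by
    intro p hp
    rw [if_neg]
    intro hblk
    apply hp
    have hmem : reflBox N p.1 p.2 x ∈ boxDom N := blockL_subset_boxDom hb hy ((mem_blockL hb).2 hblk)
    have hfix : foldBox N (reflBox N p.1 p.2 x) = reflBox N p.1 p.2 x := (mem_boxDom_iff_fold hN _).1 hmem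
    have hfx : foldBox N x = x := (mem_boxDom_iff_fold hN x).1 hx
    rw [foldBox_reflBox hN, hfx] at hfix
    have h := reflBox_inj hN x (hfix.symm.trans (reflBox_id N x).symm)
    exact Prod.ext h.1 h.2
  rw [h1]
  simp_rw [h2]
  rw [h3, tsum_congr h4, tsum_eq_single p₀ h5, hp₀]
  simp only [reflBox_id]

/-- **(2.42) FOR `G_j(□)Q_j^*` — IMAGES ON THE SOURCE VARIABLE.**  Under (α), (β) of `opBox_mul_srcImages`, for ANY
inverse `GB` of the Neumann box operator, every fine box point `x` and every unit label `y` of the unit box: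
`Σ_{x' ∈ □, blk x' = y} GB(x,x') = Σ_{(ε,m)} K(σ_{ε,m} x, y)` — `(G_j(□)Q_j^*)(x,y)` is the source image sum of
`(G_jQ_j^*)(·,y)`.  No fine propagator `G_j`, no two-sidedness and no fine decay enter.
[cite: Balaban1983RegularityDecay, p. 584 (2.42) with p. 582 (2.35), dictionary] [folklore] -/
theorem greenBoxQ_srcImages {b : ℕ} (hb : 1 ≤ b) {M : Fin (d + 1) → ℕ} (hN : ∀ i, 1 ≤ (fun i => b * M i) i)
    (c₁ msq a : ℂ) {K : (Fin (d + 1) → ℤ) → (Fin (d + 1) → ℤ) → ℂ} {y : Fin (d + 1) → ℤ} (hy : y ∈ boxDom M)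
    (hDK : ∀ u, ∑ z ∈ opSupp b u, opK c₁ msq a b u z * K z y = if blk b u = y then 1 else 0)
    (hsum : ∀ u, u ∈ boxDom (fun i => b * M i) →
      Summable (fun p : (Fin (d + 1) → Bool) × (Fin (d + 1) → ℤ) => K (reflBox (fun i => b * M i) p.1 p.2 u) y))
    (GB : Matrix ↥(boxDom (fun i => b * M i)) ↥(boxDom (fun i => b * M i)) ℂ)
    (hGB : (Matrix.of fun x y : ↥(boxDom (fun i => b * M i)) => opBoxK c₁ msq a b (fun i => b * M i) x.1 y.1) * GB = 1)
    (x : ↥(boxDom (fun i => b * M i))) :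
    ∑ x' : ↥(boxDom (fun i => b * M i)), (if blk b x'.1 = y then GB x x' else 0)
      = ∑' p : (Fin (d + 1) → Bool) × (Fin (d + 1) → ℤ), K (reflBox (fun i => b * M i) p.1 p.2 x.1) y := by
  classical
  have hGA := mul_eq_one_comm.1 hGB
  -- the indicator of `B(y)` is `opBox · W`, `W` the source image series
  have hu : ∀ x' : ↥(boxDom (fun i => b * M i)), (if blk b x'.1 = y then (1 : ℂ) else 0)
      = ∑ z : ↥(boxDom (fun i => b * M i)), opBoxK c₁ msq a b (fun i => b * M i) x'.1 z.1
        * (∑' p : (Fin (d + 1) → Bool) × (Fin (d + 1) → ℤ), K (reflBox (fun i => b * M i) p.1 p.2 z.1) y) := by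
    intro x'
    rw [← opBox_mul_srcImages hb hN c₁ msq a hy hDK hsum x'.2,
      ← Finset.sum_coe_sort (boxDom (fun i => b * M i))]
  calc ∑ x' : ↥(boxDom (fun i => b * M i)), (if blk b x'.1 = y then GB x x' else 0)
      = ∑ x' : ↥(boxDom (fun i => b * M i)), GB x x' * (if blk b x'.1 = y then (1 : ℂ) else 0) := by
        refine Finset.sum_congr rfl fun x' _ => ?_
        split_ifs <;> simp
    _ = ∑ x' : ↥(boxDom (fun i => b * M i)), GB x x'
          * ∑ z : ↥(boxDom (fun i => b * M i)), opBoxK c₁ msq a b (fun i => b * M i) x'.1 z.1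
            * (∑' p : (Fin (d + 1) → Bool) × (Fin (d + 1) → ℤ), K (reflBox (fun i => b * M i) p.1 p.2 z.1) y) :=
        Finset.sum_congr rfl fun x' _ => by rw [hu x']
    _ = ∑ z : ↥(boxDom (fun i => b * M i)),
          (∑ x' : ↥(boxDom (fun i => b * M i)), GB x x' * opBoxK c₁ msq a b (fun i => b * M i) x'.1 z.1)
            * (∑' p : (Fin (d + 1) → Bool) × (Fin (d + 1) → ℤ), K (reflBox (fun i => b * M i) p.1 p.2 z.1) y) := by
        simp_rw [Finset.mul_sum, Finset.sum_mul, ← mul_assoc]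
        rw [Finset.sum_comm]
    _ = ∑ z : ↥(boxDom (fun i => b * M i)),
          (GB * Matrix.of fun x y : ↥(boxDom (fun i => b * M i)) => opBoxK c₁ msq a b (fun i => b * M i) x.1 y.1) x z
            * (∑' p : (Fin (d + 1) → Bool) × (Fin (d + 1) → ℤ), K (reflBox (fun i => b * M i) p.1 p.2 z.1) y) := by
        simp only [Matrix.mul_apply, Matrix.of_apply]
    _ = ∑' p : (Fin (d + 1) → Bool) × (Fin (d + 1) → ℤ), K (reflBox (fun i => b * M i) p.1 p.2 x.1) y := by
        rw [hGA]
        simp only [Matrix.one_apply, ite_mul, one_mul, zero_mul, Finset.sum_ite_eq, Finset.mem_univ, if_true]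

/-! ### (2.35) for `G_j(□)Q_j^*` from the two certified properties of `G_jQ_j^*` -/

/-- **(2.35), FIRST QUANTITY, FOR `G_j(□)Q_j^*` — FROM (α) AND UNIT-RATE DECAY OF `K = G_jQ_j^*` ONLY.**  Box of
`N_μ = b·M_μ` fine sites; `K(u,y)` with (α) `Σ_{z ∈ opSupp u} opK(u,z) K(z,y) = 1_{blk u = y}` (all fine `u`, all
labels `y` — `B4Green244.green244`'s shape) and (β') `‖K(u,y)‖ ≤ M_K e^{-κ₀|blk u - y|_∞}` (`B4Green244.K_decay`'s
shape); `GB` ANY inverse of the Neumann box operator.  Then for every fine box point `x` and unit label `y` of the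
unit box `‖Σ_{x' ∈ □, blk x' = y} GB(x,x')‖ ≤ M_K · boxConst κ₀ d M · e^{-(κ₀/(d+1))|blk x - y|_∞}`, with
`boxConst κ₀ d M ≤ 2^{d+1}(1 + 2/(1 - e^{-2κ₀/(d+1)}))^{d+1}` (`boxConst_le_one`) — independent of `□` and `b = L^j`.
[cite: Balaban1983RegularityDecay, p. 582 Lemma 2.4 (2.35) first quantity, p. 584 (2.42), dictionary] -/
theorem greenBoxQ_decay_src {b : ℕ} (hb : 1 ≤ b) {M : Fin (d + 1) → ℕ} (hM : ∀ i, 1 ≤ M i)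
    (hN : ∀ i, 1 ≤ (fun i => b * M i) i) (c₁ msq a : ℂ) {K : (Fin (d + 1) → ℤ) → (Fin (d + 1) → ℤ) → ℂ}
    {κ₀ MK : ℝ} (hκ₀ : 0 < κ₀) (hMK : 0 ≤ MK)
    (hDK : ∀ u y, ∑ z ∈ opSupp b u, opK c₁ msq a b u z * K z y = if blk b u = y then 1 else 0)
    (hKdec : ∀ u y, ‖K u y‖ ≤ MK * Real.exp (-(κ₀ * supNorm (blk b u - y))))
    (GB : Matrix ↥(boxDom (fun i => b * M i)) ↥(boxDom (fun i => b * M i)) ℂ)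
    (hGB : (Matrix.of fun x y : ↥(boxDom (fun i => b * M i)) => opBoxK c₁ msq a b (fun i => b * M i) x.1 y.1) * GB = 1)
    (x : ↥(boxDom (fun i => b * M i))) {y : Fin (d + 1) → ℤ} (hy : y ∈ boxDom M) :
    ‖∑ x' : ↥(boxDom (fun i => b * M i)), (if blk b x'.1 = y then GB x x' else 0)‖
      ≤ MK * boxConst κ₀ d M * Real.exp (-(κ₀ / (d + 1) * supNorm (blk b x.1 - y))) := by
  have hβ : ∀ u, u ∈ boxDom (fun i => b * M i) →
      Summable (fun p : (Fin (d + 1) → Bool) × (Fin (d + 1) → ℤ) => K (reflBox (fun i => b * M i) p.1 p.2 u) y) :=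
    fun u hu => (norm_srcImages_le hb hM hκ₀ hMK hy (fun v => hKdec v y) hu).1
  rw [greenBoxQ_srcImages hb hN c₁ msq a hy (fun u => hDK u y) hβ GB hGB x]
  exact (norm_srcImages_le hb hM hκ₀ hMK hy (fun v => hKdec v y) x.2).2

/-- an image map moves `x + e_μ` to `σx ± e_μ` (a reflection in direction `μ` flips the step). [folklore] -/
theorem reflBox_add_single (N : Fin (d + 1) → ℕ) (ε : Fin (d + 1) → Bool) (m x : Fin (d + 1) → ℤ) (μ : Fin (d + 1)) :
    reflBox N ε m (x + Pi.single μ 1) = reflBox N ε m x + Pi.single μ (if ε μ then -1 else 1) := by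
  have h := reflBox_sub N ε m (x + Pi.single μ 1) x
  rw [add_sub_cancel_left, sflip_single] at h
  rw [← h, add_sub_cancel]

/-- **(2.35), SECOND QUANTITY (`∂_μ`), FOR `G_j(□)Q_j^*` — FROM (α) AND THE `±e_μ` DIFFERENCE BOUND ON `K` ONLY**:
if moreover (γ) `‖K(u ± e_μ, y) - K(u,y)‖ ≤ M₁ e^{-κ₀|blk u - y|_∞}` (both signs: a reflection flips `e_μ`), then
for fine box points `x`, `x + e_μ` and every unit label `y` of the unit box
`‖Σ_{x' ∈ □, blk x' = y} (GB(x+e_μ,x') - GB(x,x'))‖ ≤ M₁ · boxConst κ₀ d M · e^{-(κ₀/(d+1))|blk x - y|_∞}`.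
[cite: Balaban1983RegularityDecay, p. 582 Lemma 2.4 (2.35) second quantity, p. 584 (2.42), dictionary] -/
theorem greenBoxQ_deriv_decay_src {b : ℕ} (hb : 1 ≤ b) {M : Fin (d + 1) → ℕ} (hM : ∀ i, 1 ≤ M i)
    (hN : ∀ i, 1 ≤ (fun i => b * M i) i) (c₁ msq a : ℂ) {K : (Fin (d + 1) → ℤ) → (Fin (d + 1) → ℤ) → ℂ}
    {κ₀ MK M₁ : ℝ} (hκ₀ : 0 < κ₀) (hMK : 0 ≤ MK) (hM₁ : 0 ≤ M₁)
    (hDK : ∀ u y, ∑ z ∈ opSupp b u, opK c₁ msq a b u z * K z y = if blk b u = y then 1 else 0)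
    (hKdec : ∀ u y, ‖K u y‖ ≤ MK * Real.exp (-(κ₀ * supNorm (blk b u - y))))
    (μ : Fin (d + 1))
    (hKder : ∀ u y, ‖K (u + Pi.single μ 1) y - K u y‖ ≤ M₁ * Real.exp (-(κ₀ * supNorm (blk b u - y))) ∧
      ‖K (u + Pi.single μ (-1)) y - K u y‖ ≤ M₁ * Real.exp (-(κ₀ * supNorm (blk b u - y))))
    (GB : Matrix ↥(boxDom (fun i => b * M i)) ↥(boxDom (fun i => b * M i)) ℂ)
    (hGB : (Matrix.of fun x y : ↥(boxDom (fun i => b * M i)) => opBoxK c₁ msq a b (fun i => b * M i) x.1 y.1) * GB = 1)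
    (x xe : ↥(boxDom (fun i => b * M i))) (hxe : xe.1 = x.1 + Pi.single μ 1) {y : Fin (d + 1) → ℤ}
    (hy : y ∈ boxDom M) :
    ‖∑ x' : ↥(boxDom (fun i => b * M i)), (if blk b x'.1 = y then GB xe x' - GB x x' else 0)‖
      ≤ M₁ * boxConst κ₀ d M * Real.exp (-(κ₀ / (d + 1) * supNorm (blk b x.1 - y))) := by
  classical
  have hβ : ∀ u, u ∈ boxDom (fun i => b * M i) →
      Summable (fun p : (Fin (d + 1) → Bool) × (Fin (d + 1) → ℤ) => K (reflBox (fun i => b * M i) p.1 p.2 u) y) :=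
    fun u hu => (norm_srcImages_le hb hM hκ₀ hMK hy (fun v => hKdec v y) hu).1
  have hsplit : ∑ x' : ↥(boxDom (fun i => b * M i)), (if blk b x'.1 = y then GB xe x' - GB x x' else 0)
      = ∑ x' : ↥(boxDom (fun i => b * M i)), (if blk b x'.1 = y then GB xe x' else 0)
        - ∑ x' : ↥(boxDom (fun i => b * M i)), (if blk b x'.1 = y then GB x x' else 0) := by
    rw [← Finset.sum_sub_distrib]
    refine Finset.sum_congr rfl fun x' _ => ?_
    split_ifs <;> simp
  rw [hsplit, greenBoxQ_srcImages hb hN c₁ msq a hy (fun u => hDK u y) hβ GB hGB xe,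
    greenBoxQ_srcImages hb hN c₁ msq a hy (fun u => hDK u y) hβ GB hGB x, ← Summable.tsum_sub (hβ _ xe.2) (hβ _ x.2)]
  -- pointwise along the images: the difference kernel `K(σx ± e_μ, y) - K(σx, y)`
  have hpt : ∀ p : (Fin (d + 1) → Bool) × (Fin (d + 1) → ℤ),
      ‖K (reflBox (fun i => b * M i) p.1 p.2 xe.1) y - K (reflBox (fun i => b * M i) p.1 p.2 x.1) y‖
        ≤ M₁ * Real.exp (-(κ₀ * supNorm (reflBox M p.1 p.2 (blk b x.1) - y))) := by
    intro p
    rw [hxe, reflBox_add_single, ← blk_reflBox_mul hb M p.1 p.2 x.1]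
    split_ifs
    · exact (hKder _ y).2
    · exact (hKder _ y).1
  obtain ⟨hs, hle⟩ := tsum_srcMajorant_unif hM hκ₀ hM₁ (blk_mem_boxDom hb x.2) hy
  have hs' : Summable (fun p : (Fin (d + 1) → Bool) × (Fin (d + 1) → ℤ) =>
      ‖K (reflBox (fun i => b * M i) p.1 p.2 xe.1) y - K (reflBox (fun i => b * M i) p.1 p.2 x.1) y‖) :=
    Summable.of_nonneg_of_le (fun _ => norm_nonneg _) hpt hs
  calc ‖∑' p : (Fin (d + 1) → Bool) × (Fin (d + 1) → ℤ),
        (K (reflBox (fun i => b * M i) p.1 p.2 xe.1) y - K (reflBox (fun i => b * M i) p.1 p.2 x.1) y)‖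
      ≤ ∑' p : (Fin (d + 1) → Bool) × (Fin (d + 1) → ℤ),
          ‖K (reflBox (fun i => b * M i) p.1 p.2 xe.1) y - K (reflBox (fun i => b * M i) p.1 p.2 x.1) y‖ :=
        norm_tsum_le_tsum_norm hs'
    _ ≤ ∑' p : (Fin (d + 1) → Bool) × (Fin (d + 1) → ℤ),
          M₁ * Real.exp (-(κ₀ * supNorm (reflBox M p.1 p.2 (blk b x.1) - y))) := Summable.tsum_le_tsum hpt hs' hs
    _ ≤ _ := hle

end SourceImages


end Literature.MathematicalPhysics.QuantumFieldTheory.Balaban1983to89.B4Reflection242
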